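import Summits.HodgeConjecture.HodgeConjecture.Cruxes.BlochSeedDiscOne.HeightTower

/-!
line stmt-HodgeConjecture-18881 Cruxes/BlochSeedDiscOne/Lines/birth.lean 814a6a70c14e831a stub_rung_pad4_seedAt

# FinCheck — ORDER (vi): the floor statement `FloorFree h B rmin` IS a decidable finite check, and the WIDTH kernel lemma
(plan-lens-HodgeAV-strengthen g11, lens «strengthen»; director-hodge R19.434 ORDER (vi) ∕ RE-POINT W, R19.454 (2); STRENGTHEN-MEMO-17)

STATUS: BOOKKEEPING about the finite LETTER MODEL of record (`DepthBoundA4.Design`), not a rung, not a certificate, not a floor.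
Letters ≠ sheaves ≠ a SEED. Nothing here is proved toward HC ∕ HC_CM ∕ HC_AV ∕ №4 ∕ 26512 ∕ 18881 ∕ H2, and no storey
`FloorFree h 199 8` (`h = 6 … 14`, `HeightTower.nonex_14_iff_floors`) is closed by this file. What is kernel-checked is that each
storey is EQUIVALENT to a `Decidable` proposition over a `Fintype` (the search space made a kernel object), and — the form the width
node W needs — that `FloorFree` is equivalent to its restriction to designs supported in ANY finite cell set `U` that provably carries
every admissible design (`floorFree_iff_finCheckOn`, `floorFree_iff_floorFreeOn`).

WHAT IS PROVED (sorry-free; no axiom; no `native_decide`; no banned option; imports `HeightTower` only):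
* §1 `lettersOn h : Finset Letter` = the height-`h` alphabet (`mem_lettersOn : ℓ ∈ lettersOn h ↔ ℓ.OnAlphabet h`; `1 + 2h(h+1)`
  letters, 85 at `h = 6`, 421 at `h = 14`) and `cellsOn h : Finset Cell` = `(lettersOn h)⁴` (`mem_cellsOn`).
* §2 NORMALISATION of the two `List (Cell × ℕ)` fields of a `Design` (zeros dropped, duplicates merged): the multiplicity functions
  `Design.mN ∕ Design.mP` of `DepthBoundA4` (`= mult`), and the facts that the class tensor `T`, hence (A1) and `μ`, the copy count,
  the rank and the supports — hence (A4), `OnAlphabet` and the floor condition — depend on a design ONLY through `(mN, mP)`: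
  `wsum_eq_sum_mult`, `total_eq_sum_mult`, `T_eq_sum`, `copies_eq_sum`, `rank_eq_sum`, `mem_suppN_iff_pos`, `mem_suppP_iff_pos`.
* §3 The FUNCTION FORM over a finite cell set `U`: `Tfun ∕ A1fun ∕ A4fun ∕ mufun ∕ copiesfun ∕ rankfun ∕ NoFloor` of a pair
  `gN gP : Cell → ℕ` read on `U`, and `FinCheckOn U B rmin` := «every `m : U → Fin (B+1) × Fin (B+1)` that is (A1), (A4), `μ ≠ 0`,
  copies `≤ B`, rank `≥ rmin` has no floor letter», `FinCheck h B rmin := FinCheckOn (cellsOn h) B rmin`; all of them carry `Decidable`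
  instances obtained by `unfold; infer_instance` (§3.2) — so `FinCheck h B rmin` is a decidable proposition over the Fintype
  `cellsOn h → Fin (B+1) × Fin (B+1)`.
* §4 THE EQUIVALENCES. `realise U gN gP` (the design listing `U` once with the given multiplicities; proof use only) has
  `T = Tfun`, `copies = copiesfun`, `rank = rankfun`, `suppN = {gN > 0}`, `suppP = {gP > 0}` (§4.1); hence
  `finCheckOn_of_floorFree (hU : U ⊆ cellsOn h) : FloorFree h B rmin → FinCheckOn U B rmin` and, given a COVER hypothesis
  `hcov : every admissible design at (h, B, rmin) is supported in U`, `floorFree_of_finCheckOn hcov : FinCheckOn U B rmin → FloorFree h B rmin`;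
  together **`floorFree_iff_finCheckOn`** and its instance **`floorFree_iff_finCheck : FloorFree h B rmin ↔ FinCheck h B rmin`**
  (the cover for `U = cellsOn h` is `OnAlphabet`, `suppIn_cellsOn`). The design-level restricted form `FloorFreeOn U` with
  `floorFree_iff_floorFreeOn hcov` is RE-POINT W's «KERNEL lemma `FloorFree h 199 8 ↔ FloorFree restricted to designs supported in U_h`»
  with the cover made an explicit hypothesis: the WIDTH node is now exactly «prove `hcov` for a certificate-size `U_h`» (w2 ∕ w3 ∕ w4), and the
  symmetry quotient of `B4FloorSymmetry` (w1; `floorFree_iff_cellNormal'`, tree, olean not yet on the farm, so cited BY NAME and not imported)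
  composes on the `FloorFree` side of these `Iff`s.
* §5 The instance of record: `nonex_14_iff_finChecks : RingsEmpty 14 199 8 5 → (Nonex 14 199 8 ↔ ∀ h ∈ [6, 14], FinCheck h 199 8)`.
* §6 ONLY FLOOR-TOUCHING DESIGNS NEED A COVER: `CoversFloor U h B rmin` (cover of the admissible designs with a letter `a = 0`)
  already gives `floorFree_iff_finCheckOn_floor` ∕ `floorFree_iff_floorFreeOn_floor` (via `noFloor_of_finCheckOn`, the one-design
  core of §4.3). THE DIAL `coversFloor_empty_iff : CoversFloor ∅ h B rmin ↔ FloorFree h B rmin`: covers interpolate between the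
  trivial cover `cellsOn h` (check = whole search space) and `∅` (cover = the theorem); a small cover is never free. Consequence for
  the lens's (w4): HEIGHT TRANSFER OF WIDTH IS MOOT — floor-free designs (the shifts from storey `h − 1`) need no cover, and the
  floor-touching designs of storey `h` are not shifts of anything (`finCheckOn_transfer` is all that cell sets share).
* §7 THE FIRST PROVED COVER, from (A4) alone (`colevel_drop_two`, `no_ample_cover_of_axis` of `DepthBoundA4`, every height):
  N-letters have `a ≥ 2` (`n_letter_two_le`; N-cells never touch the floor, `touchesFloor_iff_P`), P-letters are off-axis with
  `a ≤ h − 2` (`p_letter_offaxis`, `p_letter_le`); `coverA4 h` := cells with all letters `a ≥ 2` or all letters off-axis,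
  `covers_coverA4 : Covers (coverA4 h) h B rmin`, `floorFree_iff_finCheckOn_coverA4`. Honest size at `h = 6`: `15 453 985` of
  `52 200 625` cells — (A4) alone shrinks the check by a factor `3.4` only; certificate-size covers must come from the budget (w2 ∕ w3).
* §8 HEIGHT TRANSFER — the lens object of the cycle (director R19.471 (3) (a)(b)(c)): `Admissible`, `append`, the computable letter-step
  universe `floorCells h'` (size `(2h'(h'−1))⁴ − (2(h'−1)(h'−2))⁴`, table §8.4), `FloorFamily`, the split `offFloorPart ∕ floorPart`,
  list-permutation invariance of admissibility (§8.1), and **`floorFree_succ_iff : FloorFree (h+1) B rmin ↔ ∀ E F, E.OnAlphabet h →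
  FloorFamily (h+1) F → F.suppP ≠ [] → ¬ Admissible (h+1) B rmin (append (shiftD 1 E) F)`** — BOTH directions kernel — and
  `nonex_succ_iff_floorFamilies`. (c): the parts MIX (`T_append`, `mu_append`; `cellCoef_floor_of_h` is the only vanishing
  mechanism), so `E` obeys only a RELAXED system; the relaxed predicate and its price are in STRENGTHEN-MEMO-17 §3.
* §9 COVER-LEMMA PROGRAMME W-1 (director R19.480 (2)): (w2) SHADOW CONES — `upSet h ℓ` (letters amply above `ℓ`), `shadow h x = ∏_f upSet`
  (`mem_shadow ↔ on-alphabet ∧ Live`, `card_shadow`), the cone rule `exists_suppN_mem_shadow` (every P-cell of an (A4) design has an N-cell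
  OF THE DESIGN in its cone), STRICT-SHRINK boxes `upSet_shrink`, axis degeneracies `upSet_y_eq_zero ∕ upSet_eq_empty_of_axis ∕
  shadow_eq_empty_of_axis`, and the `h = 6` numbers by kernel `decide` on the list form `upList` (`mem_upList`, `card_upSet_eq_length`):
  up-set table `5∕8∕9∕4∕6∕3∕4∕2∕1` per off-axis letter type (`upList_six_table`, `upList_six_051 ∕ 033 ∕ 411` explicit), `≤ 9` above every
  alphabet letter (`upList_six_le_nine`, 169-letter `decide`), hence **`card_shadow_six_le : |shadow 6 x| ≤ 9⁴ = 6 561`** for every cell on the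
  alphabet. (A4)-SATURATION — **`coverA4_saturated`**: every cell of `coverA4 h` is in the support of an explicit two-cell design
  `OnAlphabet h ∧ A4` (copies `2`, rank `0`) supported in `coverA4 h`; hence **`coverA4_least ∕ coverA4_isLeast`**: `coverA4 h` is the LEAST
  (A4)+alphabet cover (`A4Cover`). DIAL READING OF THE CYCLE: `|U₆| 15 453 985 → 15 453 985` — the (A4) dial is at its proved bottom; every
  further UNION-cover shrink is an (A1) ∕ μ ∕ budget (integrality-carrying) fact (R19.480 (3)); the cone rule is a ROW ∕ branching ∕
  leaf-closure rule for ORDER P (law type, threshold 1), not a union shrink. (w3) probe numbers (profile-certificate LP, exact ℚ): MEMO-17 §7.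
* §10 (w3) FAMILY-MASS LEMMA at `h = 6` (director R19.480 (2) (w3)): a balanced e-free integer CERTIFICATE FUNCTIONAL `Psi : Cell → ℤ`
  (eleven word-orbit sums `mO O_jk`, coefficients from the cycle's exact S₄-profile LP, checked here by the kernel): BALANCE `Psi_balance`
  (`Σ_S (m_N − m_P)·Ψ = 0` for every (A1) design, from (A1.2) alone via `sum_mO_rel`), SIGNS by kernel `decide` on the `495 + 495` SORTED
  representative tuples, transported to all cells by the slot symmetry `Psi_comp` and the profile congruence `Psi_congr` (`Psi_le_of_N : Ψ ≤ 9216` on N-cells, `Psi_nonneg_of_P : 0 ≤ Ψ` on P-cells), VALUES `214 272 ∕ 158 400` on the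
  two deepest floor families, hence **`deep18_family_mass_le : Σ_{(0;±3,±3)⁴} m_P ≤ 8`** and **`deep20_family_mass_le : Σ_{(0;{4,2})⁴} m_P ≤ 10`**
  for every `Admissible 6 199 rmin` design and every supporting cell set — two proved KNAPSACK ROWS for ORDER P (not law-type, not a cover
  shrink: `|U₆|` unchanged; MEMO-17 §7).
* §10.7 W-2′ the ALL-FLOOR ROW (same template, second certificate `PsiA`; the generic mass argument `mass_core` reads the family value
  on P-cells only): `PsiA_balance`, `PsiA_comp`, `PsiA_le_of_N : Ψ_A ≤ 2 583 168` on N-cells, `PsiA_nonneg_of_P`, and `PsiA_ge_of_floor :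
  33 291 648 ≤ Ψ_A` on every P-type cell with all four letters on the floor (sorted `decide` cut down by `(RepPv i3).a = 0`), hence
  **`floor4_family_mass_le : Σ_{all four letters on the floor a = 0} m_P ≤ 14`** for every `Admissible 6 199 rmin` design (`20⁴ = 160 000`
  cells in ONE knapsack row; `14 = ⌊199·U∕(V+U)⌋` is the optimum of the e-free S₄-profile certificate LP for this family, exact value `86697∕6727`).
* §10.8 W-2″ the ISOTYPIC ROW of the deepest family (third certificate `PsiB`, `U = 12 288`, value `167 232`): **`deep26_family_mass_le :
  Σ_{(0;{±5,±1})⁴} m_P ≤ 13`** (its own certificate optimum `871∕64`; the all-floor row gives `14` there). With §10 ∕ §10.7 this types ALL FOUR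
  h = 6 floor values of the e-free S₄-profile certificate census (`8 ∕ 10 ∕ 13 ∕ 14`, STRENGTHEN-MEMO-17 §8).
* §10.9 THE FOUR ROWS WITH MINIMAL HYPOTHESES AND IN FUNCTION FORM: `mass_core₀` (budget only), `rows_of_budget` ((A1), (A4), alphabet,
  copies `≤ 199` — no `μ ≠ 0`, no rank), `realise_mN ∕ realise_mP ∕ suppIn_realise`, and **`rows_fun`**: on ANY `U ⊆ cellsOn 6` every pair
  `gN gP : Cell → ℕ` with `A1fun ∧ A4fun ∧ copiesfun ≤ 199` has `Σ_{U ∩ X₁₈} gP ≤ 8`, `Σ_{U ∩ X₂₀} gP ≤ 10`, `Σ_{U ∩ X₂₆} gP ≤ 13`, `Σ_{U ∩ floor⁴} gP ≤ 14`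
  (`floor4_row_ext` for the `Fin 200 × Fin 200` points of `FinCheckOn U 199 rmin`): the rows are COVER RESTRICTIONS in the §3∕§4 language — sound
  pruning rules at every node of a search over a cover, before `μ` or the rank are known.
* §10.10 THE STOREY COLUMN, first entry `h = 7` (same template; `RepN7v ∕ RepP7v`, 12 + 12 profiles, `1 365 + 1 365` sorted tuples, certificate
  `PsiC`, `U = 560 207 700`, `V = 3 969 926 100`): **`floor4_row_seven : D.OnAlphabet 7 → D.A1 → D.A4 → D.copies ≤ 199 → SuppIn D S →
  Σ_{S ∩ floor⁴} m_P ≤ 24`** (`24⁴ = 331 776` cells; LP optimum `4411029∕622453`), `floor4_family_mass_le_seven` (bundled), `floor4_row_fun_seven`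
  (function form on any `U ⊆ cellsOn 7`).
* §10.11 THE STOREY COLUMN, second entry `h = 8` (`RepN8v ∕ RepP8v`, 16 + 16 profiles, `3 876 + 3 876` sorted tuples, certificate `PsiD`,
  `U = 22 693 991 616`, `V = 106 506 547 200`): **`floor4_row_eight : D.OnAlphabet 8 → D.A1 → D.A4 → D.copies ≤ 199 → SuppIn D S → Σ_{S ∩ floor⁴} m_P ≤ 34`**
  (`28⁴ = 614 656` cells; LP optimum `184907200∕39399291`), `floor4_family_mass_le_eight`, `floor4_row_fun_eight`.

HONEST SIZE. `FinCheck 6 199 8` quantifies over `200^(2·85⁴)` functions: it is the KERNEL FORM OF THE SEARCH SPACE that a branch-and-cut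
certificate (`BnCCert`, dual g10; ORDER P pilot, s4-search-1 g33) must cover — `decide` will never run on it, and nothing in this file is an
algorithm. `BnCCert.FloorFreeH h B rmin` (BnCCert v2) has literally the body of `HeightTower.FloorFree h B rmin`: in any file importing both,
`example : BnCCert.FloorFreeH h B r ↔ HeightTower.FloorFree h B r := Iff.rfl` (not stated here: `BnCCert`'s olean is not on the farm yet).
Words by director-hodge only.
-/

set_option linter.dupNamespace false
set_option autoImplicit false

namespace Summit.HodgeConjecture.HodgeConjecture.Cruxes.BlochSeedDiscOne.FinCheck

open Summit.HodgeConjecture.HodgeConjecture.Cruxes.BlochSeedDiscOne.DepthBoundA4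
open Summit.HodgeConjecture.HodgeConjecture.Cruxes.BlochSeedDiscOne.IntegralityGap
open Summit.HodgeConjecture.HodgeConjecture.Cruxes.BlochSeedDiscOne.HeightTower

/-! ## §1 The finite alphabet `lettersOn h` and the finite cell set `cellsOn h` -/

/-- The height-`h` letter alphabet as a `Finset`, enumerated COMPUTABLY from natural-number boxes: `a = i`, `x = j − n`, `y = k − n`
with `n = h.toNat`, `i ≤ n`, `j, k ≤ 2n`, filtered by `a + |x| + |y| = h` (written with `natAbs`). Empty for `h < 0`. -/
def lettersOn (h : ℤ) : Finset Letter :=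
  ((Finset.range (h.toNat + 1) ×ˢ (Finset.range (2 * h.toNat + 1) ×ˢ Finset.range (2 * h.toNat + 1))).image
      (fun p : ℕ × ℕ × ℕ => (⟨(p.1 : ℤ), (p.2.1 : ℤ) - (h.toNat : ℤ), (p.2.2 : ℤ) - (h.toNat : ℤ)⟩ : Letter))).filter
    (fun ℓ => ℓ.a + (ℓ.x.natAbs : ℤ) + (ℓ.y.natAbs : ℤ) = h)

/-- `lettersOn h` is exactly the height-`h` alphabet `Letter.OnAlphabet h`. -/
theorem mem_lettersOn {h : ℤ} {ℓ : Letter} : ℓ ∈ lettersOn h ↔ ℓ.OnAlphabet h := by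
  constructor
  · intro hm
    rw [lettersOn, Finset.mem_filter, Finset.mem_image] at hm
    obtain ⟨⟨p, -, hpl⟩, hsum⟩ := hm
    rw [Int.natCast_natAbs, Int.natCast_natAbs] at hsum
    refine ⟨hsum, ?_⟩
    rw [← hpl]
    exact Int.natCast_nonneg p.1
  · rintro ⟨hh, h0⟩
    unfold Letter.height at hh
    have hx1 : ℓ.x ≤ |ℓ.x| := le_abs_self _
    have hx2 : -|ℓ.x| ≤ ℓ.x := neg_abs_le _
    have hy1 : ℓ.y ≤ |ℓ.y| := le_abs_self _
    have hy2 : -|ℓ.y| ≤ ℓ.y := neg_abs_le _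
    have hx0 : 0 ≤ |ℓ.x| := abs_nonneg _
    have hy0 : 0 ≤ |ℓ.y| := abs_nonneg _
    have en : ((h.toNat : ℕ) : ℤ) = h := Int.toNat_of_nonneg (by omega)
    have ea : ((ℓ.a.toNat : ℕ) : ℤ) = ℓ.a := Int.toNat_of_nonneg h0
    have ex : (((ℓ.x + h.toNat).toNat : ℕ) : ℤ) = ℓ.x + h.toNat := Int.toNat_of_nonneg (by omega)
    have ey : (((ℓ.y + h.toNat).toNat : ℕ) : ℤ) = ℓ.y + h.toNat := Int.toNat_of_nonneg (by omega)
    rw [lettersOn, Finset.mem_filter, Finset.mem_image]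
    refine ⟨⟨(ℓ.a.toNat, (ℓ.x + h.toNat).toNat, (ℓ.y + h.toNat).toNat), ?_, ?_⟩, ?_⟩
    · simp only [Finset.mem_product, Finset.mem_range]
      refine ⟨by omega, by omega, by omega⟩
    · cases ℓ with
      | mk a x y =>
        simp only [Letter.mk.injEq] at ea ex ey ⊢
        refine ⟨by omega, by omega, by omega⟩
    · rw [Int.natCast_natAbs, Int.natCast_natAbs]
      exact hh

/-- The finite set of cells on the height-`h` alphabet: one letter of `lettersOn h` per factor. -/
def cellsOn (h : ℤ) : Finset Cell := Fintype.piFinset fun _ : Fin 4 => lettersOn h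

theorem mem_cellsOn {h : ℤ} {c : Cell} : c ∈ cellsOn h ↔ ∀ f : Fin 4, (c f).OnAlphabet h := by
  simp only [cellsOn, Fintype.mem_piFinset, mem_lettersOn]

section checks
/-- the three octant floor letters of `B4FloorSymmetry.CellNormal` at `h = 6` are in the alphabet; `(1; 5, 1)` is not. -/
example : (⟨0, 5, 1⟩ : Letter) ∈ lettersOn 6 ∧ (⟨0, 4, 2⟩ : Letter) ∈ lettersOn 6 ∧ (⟨0, 3, 3⟩ : Letter) ∈ lettersOn 6 :=
  ⟨mem_lettersOn.mpr (by unfold Letter.OnAlphabet Letter.height; decide),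
   mem_lettersOn.mpr (by unfold Letter.OnAlphabet Letter.height; decide),
   mem_lettersOn.mpr (by unfold Letter.OnAlphabet Letter.height; decide)⟩
example : (⟨1, 5, 1⟩ : Letter) ∉ lettersOn 6 := fun hm => by
  have := mem_lettersOn.mp hm; unfold Letter.OnAlphabet Letter.height at this; exact absurd this (by decide)
/-- alphabet sizes `1 + 2h(h+1)`: 85 letters at `h = 6`, 421 at `h = 14` (arithmetic only; the `Finset.card` is not evaluated here). -/
example : 1 + 2 * 6 * (6 + 1) = 85 ∧ 1 + 2 * 14 * (14 + 1) = 421 ∧ 85 ^ 4 = 52200625 := by decide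
end checks

/-! ## §2 Normalisation: everything depends on a design only through its multiplicity functions -/

/-- Total multiplicity of the cell `c` in a list of (cell, multiplicity) entries — the body of `Design.mN ∕ Design.mP`. -/
def mult (L : List (Cell × ℕ)) (c : Cell) : ℕ := ((L.filter fun cm => cm.1 = c).map Prod.snd).sum

theorem mN_eq_mult (D : Design) (c : Cell) : D.mN c = mult D.N c := rfl
theorem mP_eq_mult (D : Design) (c : Cell) : D.mP c = mult D.P c := rfl

theorem mult_nil (c : Cell) : mult [] c = 0 := rfl

theorem mult_cons (e : Cell × ℕ) (L : List (Cell × ℕ)) (c : Cell) :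
    mult (e :: L) c = (if e.1 = c then e.2 else 0) + mult L c := by
  unfold mult
  rw [List.filter_cons]
  by_cases h : e.1 = c
  · simp [h]
  · simp [h]

/-- a merged multiplicity never exceeds the total mass of the list. -/
theorem mult_le_total (L : List (Cell × ℕ)) (c : Cell) : mult L c ≤ (L.map Prod.snd).sum := by
  induction L with
  | nil => simp [mult_nil]
  | cons e L ih =>
    rw [mult_cons, List.map_cons, List.sum_cons]
    split <;> omega

/-- a cell has positive merged multiplicity iff some entry at that cell is positive. -/
theorem mult_pos_iff (L : List (Cell × ℕ)) (c : Cell) : 0 < mult L c ↔ ∃ m : ℕ, (c, m) ∈ L ∧ 0 < m := by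
  induction L with
  | nil => simp [mult_nil]
  | cons e L ih =>
    rw [mult_cons]
    constructor
    · intro hpos
      by_cases hL : 0 < mult L c
      · obtain ⟨m, hm, hmpos⟩ := ih.mp hL
        exact ⟨m, List.mem_cons.mpr (Or.inr hm), hmpos⟩
      · have hif : 0 < (if e.1 = c then e.2 else 0) := by omega
        by_cases hc : e.1 = c
        · rw [if_pos hc] at hif
          refine ⟨e.2, List.mem_cons.mpr (Or.inl ?_), hif⟩
          rw [← hc]
        · rw [if_neg hc] at hif
          exact absurd hif (lt_irrefl 0)
    · rintro ⟨m, hm, hmpos⟩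
      rcases List.mem_cons.mp hm with hme | hmL
      · have h1 : e.1 = c := by rw [← hme]
        have h2 : e.2 = m := by rw [← hme]
        rw [if_pos h1, h2]
        omega
      · have := ih.mpr ⟨m, hmL, hmpos⟩
        omega

/-- LIST SUM = FINSET SUM OF MERGED MULTIPLICITIES (Gaussian-integer weights), for any finite cell set `S` containing the cells of the
positive entries. -/
theorem wsum_eq_sum_mult (L : List (Cell × ℕ)) (u : Cell → GaussianInt) (S : Finset Cell)
    (hS : ∀ e ∈ L, 0 < e.2 → e.1 ∈ S) :
    wsum L u = ∑ c ∈ S, (mult L c : GaussianInt) * u c := by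
  induction L with
  | nil => simp [wsum, mult_nil]
  | cons e L ih =>
    have hS' : ∀ e' ∈ L, 0 < e'.2 → e'.1 ∈ S := fun e' he' => hS e' (List.mem_cons.mpr (Or.inr he'))
    have ih' := ih hS'
    simp only [wsum, List.map_cons, List.sum_cons] at ih' ⊢
    rw [ih']
    simp only [mult_cons, Nat.cast_add, add_mul, Finset.sum_add_distrib]
    congr 1
    by_cases he : e.2 = 0
    · simp [he]
    · have hmem : e.1 ∈ S := hS e (List.mem_cons.mpr (Or.inl rfl)) (Nat.pos_of_ne_zero he)
      rw [Finset.sum_congr rfl (fun c _ => show ((if e.1 = c then e.2 else 0 : ℕ) : GaussianInt) * u c =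
            (if e.1 = c then (e.2 : GaussianInt) * u c else 0) by split <;> simp)]
      rw [Finset.sum_ite_eq, if_pos hmem]

/-- LIST MASS = FINSET SUM OF MERGED MULTIPLICITIES. -/
theorem total_eq_sum_mult (L : List (Cell × ℕ)) (S : Finset Cell) (hS : ∀ e ∈ L, 0 < e.2 → e.1 ∈ S) :
    (L.map Prod.snd).sum = ∑ c ∈ S, mult L c := by
  induction L with
  | nil => simp [mult_nil]
  | cons e L ih =>
    have hS' : ∀ e' ∈ L, 0 < e'.2 → e'.1 ∈ S := fun e' he' => hS e' (List.mem_cons.mpr (Or.inr he'))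
    rw [List.map_cons, List.sum_cons, ih hS']
    simp only [mult_cons, Finset.sum_add_distrib]
    congr 1
    by_cases he : e.2 = 0
    · simp [he]
    · have hmem : e.1 ∈ S := hS e (List.mem_cons.mpr (Or.inl rfl)) (Nat.pos_of_ne_zero he)
      rw [Finset.sum_ite_eq, if_pos hmem]

/-- «the design `D` is supported in the cell set `S`». -/
def SuppIn (D : Design) (S : Finset Cell) : Prop := ∀ c ∈ D.suppN ++ D.suppP, c ∈ S

theorem entriesN_in {D : Design} {S : Finset Cell} (h : SuppIn D S) : ∀ e ∈ D.N, 0 < e.2 → e.1 ∈ S :=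
  fun e he hpos => h e.1 (List.mem_append_left _ ((mem_suppN_iff D e.1).mpr ⟨e.2, he, hpos⟩))

theorem entriesP_in {D : Design} {S : Finset Cell} (h : SuppIn D S) : ∀ e ∈ D.P, 0 < e.2 → e.1 ∈ S :=
  fun e he hpos => h e.1 (List.mem_append_right _ ((mem_suppP_iff D e.1).mpr ⟨e.2, he, hpos⟩))

/-- the class tensor through `(mN, mP)`. -/
theorem T_eq_sum {D : Design} {S : Finset Cell} (h : SuppIn D S) (w : Word) :
    D.T w = ∑ c ∈ S, (D.mN c : GaussianInt) * cellCoef c w - ∑ c ∈ S, (D.mP c : GaussianInt) * cellCoef c w := by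
  rw [T_eq_Tf]
  unfold Tf
  rw [wsum_eq_sum_mult D.N _ S (entriesN_in h), wsum_eq_sum_mult D.P _ S (entriesP_in h)]
  rfl

/-- the copy count through `(mN, mP)`. -/
theorem copies_eq_sum {D : Design} {S : Finset Cell} (h : SuppIn D S) :
    D.copies = ∑ c ∈ S, D.mN c + ∑ c ∈ S, D.mP c := by
  unfold Design.copies
  rw [total_eq_sum_mult D.N S (entriesN_in h), total_eq_sum_mult D.P S (entriesP_in h)]
  rfl

/-- the rank through `(mN, mP)`. -/
theorem rank_eq_sum {D : Design} {S : Finset Cell} (h : SuppIn D S) :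
    D.rank = (∑ c ∈ S, (D.mN c : ℤ)) - ∑ c ∈ S, (D.mP c : ℤ) := by
  unfold Design.rank
  rw [total_eq_sum_mult D.N S (entriesN_in h), total_eq_sum_mult D.P S (entriesP_in h)]
  push_cast
  rfl

/-- the supports through `(mN, mP)`. -/
theorem mem_suppN_iff_pos (D : Design) (c : Cell) : c ∈ D.suppN ↔ 0 < D.mN c := by
  rw [mem_suppN_iff, mN_eq_mult, mult_pos_iff]

theorem mem_suppP_iff_pos (D : Design) (c : Cell) : c ∈ D.suppP ↔ 0 < D.mP c := by
  rw [mem_suppP_iff, mP_eq_mult, mult_pos_iff]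

/-- on the alphabet ⇒ supported in `cellsOn h`. -/
theorem suppIn_cellsOn {D : Design} {h : ℤ} (hA : D.OnAlphabet h) : SuppIn D (cellsOn h) :=
  fun c hc => mem_cellsOn.mpr (hA c hc)

/-! ## §3 The function form of the floor problem over a finite cell set `U` -/

section functionForm
variable (U : Finset Cell)

/-- class tensor of a multiplicity pair read on `U`. -/
def Tfun (gN gP : Cell → ℕ) (w : Word) : GaussianInt :=
  ∑ c ∈ U, (gN c : GaussianInt) * cellCoef c w - ∑ c ∈ U, (gP c : GaussianInt) * cellCoef c w

/-- (A1) in function form. -/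
def A1fun (gN gP : Cell → ℕ) : Prop :=
  (∀ w : Word, ¬ w.efree → w ≠ Word.eeee → w ≠ Word.EEEE → Tfun U gN gP w = 0) ∧
  (∀ w w' : Word, w.efree → w'.efree → w.deg = w'.deg → Tfun U gN gP w = Tfun U gN gP w')

/-- `μ` in function form. -/
def mufun (gN gP : Cell → ℕ) : GaussianInt := Tfun U gN gP Word.eeee

/-- copy count in function form. -/
def copiesfun (gN gP : Cell → ℕ) : ℕ := ∑ c ∈ U, gN c + ∑ c ∈ U, gP c

/-- rank in function form. -/
def rankfun (gN gP : Cell → ℕ) : ℤ := (∑ c ∈ U, (gN c : ℤ)) - ∑ c ∈ U, (gP c : ℤ)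

/-- (A4) in function form: every P-cell of `U` has a live N-cell of `U` above it and conversely. -/
def A4fun (gN gP : Cell → ℕ) : Prop :=
  (∀ x ∈ U, 0 < gP x → ∃ y ∈ U, 0 < gN y ∧ Live x y) ∧ (∀ y ∈ U, 0 < gN y → ∃ x ∈ U, 0 < gP x ∧ Live x y)

/-- the floor condition in function form: no support cell of `U` carries a floor letter `a = 0`. -/
def NoFloor (gN gP : Cell → ℕ) : Prop := ∀ c ∈ U, 0 < gN c + gP c → ∀ f : Fin 4, 0 < (c f).a

end functionForm

/-- extension by zero of the N-multiplicities of a finite assignment `m : U → Fin (B+1) × Fin (B+1)`. -/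
def extN {U : Finset Cell} {B : ℕ} (m : U → Fin (B + 1) × Fin (B + 1)) (c : Cell) : ℕ :=
  if hc : c ∈ U then ((m ⟨c, hc⟩).1 : ℕ) else 0

/-- extension by zero of the P-multiplicities. -/
def extP {U : Finset Cell} {B : ℕ} (m : U → Fin (B + 1) × Fin (B + 1)) (c : Cell) : ℕ :=
  if hc : c ∈ U then ((m ⟨c, hc⟩).2 : ℕ) else 0

theorem extN_of_mem {U : Finset Cell} {B : ℕ} (m : U → Fin (B + 1) × Fin (B + 1)) {c : Cell} (hc : c ∈ U) :
    extN m c = ((m ⟨c, hc⟩).1 : ℕ) := by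
  unfold extN; rw [dif_pos hc]

theorem extP_of_mem {U : Finset Cell} {B : ℕ} (m : U → Fin (B + 1) × Fin (B + 1)) {c : Cell} (hc : c ∈ U) :
    extP m c = ((m ⟨c, hc⟩).2 : ℕ) := by
  unfold extP; rw [dif_pos hc]

/-- **FIN-CHECK ON `U`**: every finite multiplicity assignment on `U` with values `≤ B` that is (A1), (A4), `μ ≠ 0`, copies `≤ B`,
rank `≥ rmin` is floor-free. A proposition over the Fintype `U → Fin (B+1) × Fin (B+1)`. -/
def FinCheckOn (U : Finset Cell) (B : ℕ) (rmin : ℤ) : Prop :=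
  ∀ m : U → Fin (B + 1) × Fin (B + 1),
    A1fun U (extN m) (extP m) → A4fun U (extN m) (extP m) → mufun U (extN m) (extP m) ≠ 0 →
    copiesfun U (extN m) (extP m) ≤ B → rmin ≤ rankfun U (extN m) (extP m) → NoFloor U (extN m) (extP m)

/-- **FIN-CHECK(h, B, rmin)** := `FinCheckOn (cellsOn h) B rmin`. -/
def FinCheck (h : ℤ) (B : ℕ) (rmin : ℤ) : Prop := FinCheckOn (cellsOn h) B rmin

/-! ### §3.2 Decidability (instances by `unfold; infer_instance`; named to avoid clashes with other crux workfiles) -/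

instance decEfree_finCheck (w : Word) : Decidable w.efree := by unfold Word.efree; infer_instance
instance decAmpleAbove_finCheck (ℓ ℓ' : Letter) : Decidable (AmpleAbove ℓ ℓ') := by unfold AmpleAbove; infer_instance
instance decLive_finCheck (x y : Cell) : Decidable (Live x y) := by unfold Live; infer_instance
instance decA1fun (U : Finset Cell) (gN gP : Cell → ℕ) : Decidable (A1fun U gN gP) := by unfold A1fun; infer_instance
instance decA4fun (U : Finset Cell) (gN gP : Cell → ℕ) : Decidable (A4fun U gN gP) := by unfold A4fun; infer_instance
instance decNoFloor (U : Finset Cell) (gN gP : Cell → ℕ) : Decidable (NoFloor U gN gP) := by unfold NoFloor; infer_instance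
instance decFinCheckOn (U : Finset Cell) (B : ℕ) (rmin : ℤ) : Decidable (FinCheckOn U B rmin) := by
  unfold FinCheckOn; infer_instance
/-- `FinCheck h B rmin` is a decidable proposition. -/
instance decFinCheck (h : ℤ) (B : ℕ) (rmin : ℤ) : Decidable (FinCheck h B rmin) := by unfold FinCheck; infer_instance

/-! ## §4 The equivalences -/

/-! ### §4.1 Realising a multiplicity pair as a design (proof use only: `Finset.toList` is noncomputable) -/

/-- the design that lists every cell of `U` once with multiplicities `gN ∕ gP`. -/
noncomputable def realise (U : Finset Cell) (gN gP : Cell → ℕ) : Design :=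
  ⟨U.toList.map fun c => (c, gN c), U.toList.map fun c => (c, gP c)⟩

section realise
variable (U : Finset Cell) (gN gP : Cell → ℕ)

theorem realise_wsumN (u : Cell → GaussianInt) : wsum (realise U gN gP).N u = ∑ c ∈ U, (gN c : GaussianInt) * u c := by
  unfold realise wsum
  rw [List.map_map, ← Finset.sum_map_toList U (fun c => (gN c : GaussianInt) * u c)]
  rfl

theorem realise_wsumP (u : Cell → GaussianInt) : wsum (realise U gN gP).P u = ∑ c ∈ U, (gP c : GaussianInt) * u c := by
  unfold realise wsum
  rw [List.map_map, ← Finset.sum_map_toList U (fun c => (gP c : GaussianInt) * u c)]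
  rfl

theorem realise_T (w : Word) : (realise U gN gP).T w = Tfun U gN gP w := by
  rw [T_eq_Tf]
  unfold Tf Tfun
  rw [realise_wsumN, realise_wsumP]

theorem realise_totalN : ((realise U gN gP).N.map Prod.snd).sum = ∑ c ∈ U, gN c := by
  unfold realise
  rw [List.map_map, ← Finset.sum_map_toList U gN]
  rfl

theorem realise_totalP : ((realise U gN gP).P.map Prod.snd).sum = ∑ c ∈ U, gP c := by
  unfold realise
  rw [List.map_map, ← Finset.sum_map_toList U gP]
  rfl

theorem realise_copies : (realise U gN gP).copies = copiesfun U gN gP := by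
  unfold Design.copies copiesfun
  rw [realise_totalN, realise_totalP]

theorem realise_rank : (realise U gN gP).rank = rankfun U gN gP := by
  unfold Design.rank rankfun
  rw [realise_totalN, realise_totalP]
  push_cast
  rfl

theorem mem_suppN_realise {c : Cell} : c ∈ (realise U gN gP).suppN ↔ c ∈ U ∧ 0 < gN c := by
  rw [mem_suppN_iff]
  unfold realise
  simp only [List.mem_map, Finset.mem_toList, Prod.mk.injEq]
  constructor
  · rintro ⟨m, ⟨c', hc', hcc, hm⟩, hpos⟩
    subst hcc; subst hm
    exact ⟨hc', hpos⟩
  · rintro ⟨hc, hpos⟩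
    exact ⟨gN c, ⟨c, hc, rfl, rfl⟩, hpos⟩

theorem mem_suppP_realise {c : Cell} : c ∈ (realise U gN gP).suppP ↔ c ∈ U ∧ 0 < gP c := by
  rw [mem_suppP_iff]
  unfold realise
  simp only [List.mem_map, Finset.mem_toList, Prod.mk.injEq]
  constructor
  · rintro ⟨m, ⟨c', hc', hcc, hm⟩, hpos⟩
    subst hcc; subst hm
    exact ⟨hc', hpos⟩
  · rintro ⟨hc, hpos⟩
    exact ⟨gP c, ⟨c, hc, rfl, rfl⟩, hpos⟩

theorem onAlphabet_realise {h : ℤ} (hU : U ⊆ cellsOn h) : (realise U gN gP).OnAlphabet h := by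
  intro c hc f
  rcases List.mem_append.mp hc with hN | hP
  · exact mem_cellsOn.mp (hU ((mem_suppN_realise U gN gP).mp hN).1) f
  · exact mem_cellsOn.mp (hU ((mem_suppP_realise U gN gP).mp hP).1) f

theorem a1_realise (h1 : A1fun U gN gP) : (realise U gN gP).A1 :=
  ⟨fun w hw e1 e2 => by rw [realise_T]; exact h1.1 w hw e1 e2,
   fun w w' hw hw' hd => by rw [realise_T, realise_T]; exact h1.2 w w' hw hw' hd⟩

theorem a4_realise (h4 : A4fun U gN gP) : (realise U gN gP).A4 := by
  constructor
  · intro x hx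
    obtain ⟨hxU, hpos⟩ := (mem_suppP_realise U gN gP).mp hx
    obtain ⟨y, hyU, hyN, hl⟩ := h4.1 x hxU hpos
    exact ⟨y, (mem_suppN_realise U gN gP).mpr ⟨hyU, hyN⟩, hl⟩
  · intro y hy
    obtain ⟨hyU, hpos⟩ := (mem_suppN_realise U gN gP).mp hy
    obtain ⟨x, hxU, hxP, hl⟩ := h4.2 y hyU hpos
    exact ⟨x, (mem_suppP_realise U gN gP).mpr ⟨hxU, hxP⟩, hl⟩

end realise

/-! ### §4.2 `FloorFree → FinCheckOn U` for every `U ⊆ cellsOn h` -/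

theorem finCheckOn_of_floorFree {h : ℤ} {B : ℕ} {rmin : ℤ} {U : Finset Cell} (hU : U ⊆ cellsOn h)
    (hF : FloorFree h B rmin) : FinCheckOn U B rmin := by
  intro m hA1 hA4 hμ hB hr c hcU hpos f
  have hμ' : (realise U (extN m) (extP m)).mu ≠ 0 := by
    have e : (realise U (extN m) (extP m)).mu = mufun U (extN m) (extP m) := realise_T U _ _ Word.eeee
    rw [e]; exact hμ
  have hD := hF (realise U (extN m) (extP m)) (onAlphabet_realise U _ _ hU) (a1_realise U _ _ hA1) (a4_realise U _ _ hA4)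
    hμ' (by rw [realise_copies]; exact hB) (by rw [realise_rank]; exact hr)
  have hc : c ∈ (realise U (extN m) (extP m)).suppN ++ (realise U (extN m) (extP m)).suppP := by
    by_cases hN : 0 < extN m c
    · exact List.mem_append_left _ ((mem_suppN_realise U _ _).mpr ⟨hcU, hN⟩)
    · exact List.mem_append_right _ ((mem_suppP_realise U _ _).mpr ⟨hcU, by omega⟩)
  exact hD c hc f

/-! ### §4.3 `FinCheckOn U → FloorFree` under a COVER hypothesis («every admissible design is supported in `U`») -/

/-- the cover hypothesis of the width node W for a cell set `U` at `(h, B, rmin)`. -/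
def Covers (U : Finset Cell) (h : ℤ) (B : ℕ) (rmin : ℤ) : Prop :=
  ∀ D : Design, D.OnAlphabet h → D.A1 → D.A4 → D.mu ≠ 0 → D.copies ≤ B → rmin ≤ D.rank → SuppIn D U

/-- `cellsOn h` covers trivially (by `OnAlphabet`). -/
theorem covers_cellsOn (h : ℤ) (B : ℕ) (rmin : ℤ) : Covers (cellsOn h) h B rmin :=
  fun _ hA _ _ _ _ _ => suppIn_cellsOn hA

/-- the one-design core: a design SUPPORTED IN `U` that passes the admissibility tests inherits «no floor letter» from
`FinCheckOn U` (no alphabet, no global cover needed). -/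
theorem noFloor_of_finCheckOn {B : ℕ} {rmin : ℤ} {U : Finset Cell} (hF : FinCheckOn U B rmin) (D : Design)
    (h1 : D.A1) (h4 : D.A4) (hμ : D.mu ≠ 0) (hB : D.copies ≤ B) (hr : rmin ≤ D.rank) (hS : SuppIn D U) :
    ∀ c ∈ D.suppN ++ D.suppP, ∀ f : Fin 4, 0 < (c f).a := by
  intro c hc f
  have hNle : ∀ c', D.mN c' ≤ B := fun c' =>
    le_trans (mult_le_total D.N c') (le_trans (Nat.le_add_right _ _) hB)
  have hPle : ∀ c', D.mP c' ≤ B := fun c' =>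
    le_trans (mult_le_total D.P c') (le_trans (Nat.le_add_left _ _) hB)
  let m : U → Fin (B + 1) × Fin (B + 1) := fun c' =>
    (⟨D.mN c'.1, Nat.lt_succ_of_le (hNle c'.1)⟩, ⟨D.mP c'.1, Nat.lt_succ_of_le (hPle c'.1)⟩)
  have eN : ∀ c' ∈ U, extN m c' = D.mN c' := fun c' hc' => by rw [extN_of_mem m hc']
  have eP : ∀ c' ∈ U, extP m c' = D.mP c' := fun c' hc' => by rw [extP_of_mem m hc']
  have sNg : ∀ w : Word, ∑ c' ∈ U, (extN m c' : GaussianInt) * cellCoef c' w = ∑ c' ∈ U, (D.mN c' : GaussianInt) * cellCoef c' w :=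
    fun w => Finset.sum_congr rfl (fun c' hc' => by rw [eN c' hc'])
  have sPg : ∀ w : Word, ∑ c' ∈ U, (extP m c' : GaussianInt) * cellCoef c' w = ∑ c' ∈ U, (D.mP c' : GaussianInt) * cellCoef c' w :=
    fun w => Finset.sum_congr rfl (fun c' hc' => by rw [eP c' hc'])
  have sNn : ∑ c' ∈ U, extN m c' = ∑ c' ∈ U, D.mN c' := Finset.sum_congr rfl (fun c' hc' => eN c' hc')
  have sPn : ∑ c' ∈ U, extP m c' = ∑ c' ∈ U, D.mP c' := Finset.sum_congr rfl (fun c' hc' => eP c' hc')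
  have sNz : ∑ c' ∈ U, (extN m c' : ℤ) = ∑ c' ∈ U, (D.mN c' : ℤ) := Finset.sum_congr rfl (fun c' hc' => by rw [eN c' hc'])
  have sPz : ∑ c' ∈ U, (extP m c' : ℤ) = ∑ c' ∈ U, (D.mP c' : ℤ) := Finset.sum_congr rfl (fun c' hc' => by rw [eP c' hc'])
  have eT : ∀ w : Word, Tfun U (extN m) (extP m) w = D.T w := fun w => by
    rw [T_eq_sum hS w]
    unfold Tfun
    rw [sNg w, sPg w]
  have eC : copiesfun U (extN m) (extP m) = D.copies := by
    rw [copies_eq_sum hS]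
    unfold copiesfun
    rw [sNn, sPn]
  have eR : rankfun U (extN m) (extP m) = D.rank := by
    rw [rank_eq_sum hS]
    unfold rankfun
    rw [sNz, sPz]
  have hA1' : A1fun U (extN m) (extP m) :=
    ⟨fun w hw e1 e2 => by rw [eT]; exact h1.1 w hw e1 e2,
     fun w w' hw hw' hd => by rw [eT, eT]; exact h1.2 w w' hw hw' hd⟩
  have hA4' : A4fun U (extN m) (extP m) := by
    constructor
    · intro x hxU hpos
      have hx : x ∈ D.suppP := (mem_suppP_iff_pos D x).mpr (by rw [← eP x hxU]; exact hpos)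
      obtain ⟨y, hy, hl⟩ := h4.1 x hx
      have hyU : y ∈ U := hS y (List.mem_append_left _ hy)
      exact ⟨y, hyU, by rw [eN y hyU]; exact (mem_suppN_iff_pos D y).mp hy, hl⟩
    · intro y hyU hpos
      have hy : y ∈ D.suppN := (mem_suppN_iff_pos D y).mpr (by rw [← eN y hyU]; exact hpos)
      obtain ⟨x, hx, hl⟩ := h4.2 y hy
      have hxU : x ∈ U := hS x (List.mem_append_right _ hx)
      exact ⟨x, hxU, by rw [eP x hxU]; exact (mem_suppP_iff_pos D x).mp hx, hl⟩
  have hμ' : mufun U (extN m) (extP m) ≠ 0 := by unfold mufun; rw [eT]; exact hμ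
  have key := hF m hA1' hA4' hμ' (by rw [eC]; exact hB) (by rw [eR]; exact hr)
  have hcU : c ∈ U := hS c hc
  refine key c hcU ?_ f
  rcases List.mem_append.mp hc with hN | hP
  · have := (mem_suppN_iff_pos D c).mp hN
    rw [eN c hcU]; omega
  · have := (mem_suppP_iff_pos D c).mp hP
    rw [eP c hcU]; omega

theorem floorFree_of_finCheckOn {h : ℤ} {B : ℕ} {rmin : ℤ} {U : Finset Cell} (hcov : Covers U h B rmin)
    (hF : FinCheckOn U B rmin) : FloorFree h B rmin :=
  fun D hA h1 h4 hμ hB hr => noFloor_of_finCheckOn hF D h1 h4 hμ hB hr (hcov D hA h1 h4 hμ hB hr)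

/-! ### §4.4 The `Iff`s -/

/-- **THE WIDTH KERNEL LEMMA (function form).** If `U ⊆ cellsOn h` carries every admissible design, the floor statement at
`(h, B, rmin)` IS the finite check on `U`. -/
theorem floorFree_iff_finCheckOn {h : ℤ} {B : ℕ} {rmin : ℤ} {U : Finset Cell} (hU : U ⊆ cellsOn h)
    (hcov : Covers U h B rmin) : FloorFree h B rmin ↔ FinCheckOn U B rmin :=
  ⟨finCheckOn_of_floorFree hU, floorFree_of_finCheckOn hcov⟩

/-- **ORDER (vi): `FloorFree h B rmin ↔ FinCheck h B rmin`** — each storey of the height tower is a decidable finite check. -/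
theorem floorFree_iff_finCheck (h : ℤ) (B : ℕ) (rmin : ℤ) : FloorFree h B rmin ↔ FinCheck h B rmin :=
  floorFree_iff_finCheckOn (Finset.Subset.refl _) (covers_cellsOn h B rmin)

/-- the floor statement RESTRICTED to designs supported in `U` (design form). -/
def FloorFreeOn (U : Finset Cell) (h : ℤ) (B : ℕ) (rmin : ℤ) : Prop :=
  ∀ D : Design, SuppIn D U → D.OnAlphabet h → D.A1 → D.A4 → D.mu ≠ 0 → D.copies ≤ B → rmin ≤ D.rank →
    ∀ c ∈ D.suppN ++ D.suppP, ∀ f : Fin 4, 0 < (c f).a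

/-- **THE WIDTH KERNEL LEMMA (design form, RE-POINT W):** under the cover hypothesis, `FloorFree` ⟺ `FloorFree` restricted to designs
supported in `U`. The width node W is thereby exactly «a certificate-size `U_h` with `Covers U_h h 199 8`». -/
theorem floorFree_iff_floorFreeOn {h : ℤ} {B : ℕ} {rmin : ℤ} {U : Finset Cell} (hcov : Covers U h B rmin) :
    FloorFree h B rmin ↔ FloorFreeOn U h B rmin :=
  ⟨fun hF D _ hA h1 h4 hμ hB hr => hF D hA h1 h4 hμ hB hr,
   fun hF D hA h1 h4 hμ hB hr => hF D (hcov D hA h1 h4 hμ hB hr) hA h1 h4 hμ hB hr⟩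

/-- monotonicity of the finite check in the cell set is NOT claimed (a smaller `U` checks fewer assignments but must still cover);
what holds is: a cover by `U` transfers the check from `cellsOn h` to `U`. -/
theorem finCheckOn_iff_finCheck {h : ℤ} {B : ℕ} {rmin : ℤ} {U : Finset Cell} (hU : U ⊆ cellsOn h) (hcov : Covers U h B rmin) :
    FinCheckOn U B rmin ↔ FinCheck h B rmin := by
  rw [← floorFree_iff_finCheckOn hU hcov, floorFree_iff_finCheck]

/-! ## §5 The instance of record `(B, rmin) = (199, 8)`: nine finite checks -/

/-- Given gs-eng-2's ring-5 certificate (`RingFiveEmpty.ringsEmpty_14_199_8_5`, taken as a hypothesis as in `HeightTower`),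
`Nonex 14 199 8` ⟺ the nine decidable finite checks `FinCheck h 199 8`, `h = 6, …, 14`. -/
theorem nonex_14_iff_finChecks (hR : RingsEmpty 14 199 8 5) :
    Nonex 14 199 8 ↔ ∀ h : ℤ, 6 ≤ h → h ≤ 14 → FinCheck h 199 8 := by
  rw [nonex_14_iff_floors hR]
  exact ⟨fun H h h6 h14 => (floorFree_iff_finCheck h 199 8).mp (H h h6 h14),
    fun H h h6 h14 => (floorFree_iff_finCheck h 199 8).mpr (H h h6 h14)⟩

/-- one storey in W-form: a covering cell set `U₆ ⊆ cellsOn 6` reduces the first open floor to the finite check on `U₆`. -/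
theorem floorFree_six_iff_of_cover {U : Finset Cell} (hU : U ⊆ cellsOn 6) (hcov : Covers U 6 199 8) :
    FloorFree 6 199 8 ↔ FinCheckOn U 199 8 :=
  floorFree_iff_finCheckOn hU hcov


/-! ## §6 Only FLOOR-TOUCHING designs need a cover; the cover DIAL -/

/-- «`D` touches the floor»: some support letter has `a ≤ 0` (i.e. `a = 0` on the alphabet). -/
def TouchesFloor (D : Design) : Prop := ∃ c ∈ D.suppN ++ D.suppP, ∃ f : Fin 4, (c f).a ≤ 0

/-- the cover hypothesis RESTRICTED to floor-touching admissible designs — all the kernel lemma needs. -/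
def CoversFloor (U : Finset Cell) (h : ℤ) (B : ℕ) (rmin : ℤ) : Prop :=
  ∀ D : Design, D.OnAlphabet h → D.A1 → D.A4 → D.mu ≠ 0 → D.copies ≤ B → rmin ≤ D.rank → TouchesFloor D → SuppIn D U

theorem coversFloor_of_covers {U : Finset Cell} {h : ℤ} {B : ℕ} {rmin : ℤ} (hcov : Covers U h B rmin) :
    CoversFloor U h B rmin :=
  fun D hA h1 h4 hμ hB hr _ => hcov D hA h1 h4 hμ hB hr

/-- **KERNEL LEMMA, floor form:** a cover of the FLOOR-TOUCHING admissible designs suffices. -/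
theorem floorFree_of_finCheckOn_floor {h : ℤ} {B : ℕ} {rmin : ℤ} {U : Finset Cell} (hcov : CoversFloor U h B rmin)
    (hF : FinCheckOn U B rmin) : FloorFree h B rmin := by
  intro D hA h1 h4 hμ hB hr c hc f
  by_contra hle
  exact hle (noFloor_of_finCheckOn hF D h1 h4 hμ hB hr (hcov D hA h1 h4 hμ hB hr ⟨c, hc, f, not_lt.mp hle⟩) c hc f)

theorem floorFree_iff_finCheckOn_floor {h : ℤ} {B : ℕ} {rmin : ℤ} {U : Finset Cell} (hU : U ⊆ cellsOn h)
    (hcov : CoversFloor U h B rmin) : FloorFree h B rmin ↔ FinCheckOn U B rmin :=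
  ⟨finCheckOn_of_floorFree hU, floorFree_of_finCheckOn_floor hcov⟩

theorem floorFree_iff_floorFreeOn_floor {h : ℤ} {B : ℕ} {rmin : ℤ} {U : Finset Cell} (hcov : CoversFloor U h B rmin) :
    FloorFree h B rmin ↔ FloorFreeOn U h B rmin :=
  ⟨fun hF D _ hA h1 h4 hμ hB hr => hF D hA h1 h4 hμ hB hr,
   fun hF D hA h1 h4 hμ hB hr c hc f => by
    by_contra hle
    exact hle (hF D (hcov D hA h1 h4 hμ hB hr ⟨c, hc, f, not_lt.mp hle⟩) hA h1 h4 hμ hB hr c hc f)⟩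

/-- **THE DIAL.** At one end `U = cellsOn h` covers trivially (`covers_cellsOn`) and the finite check is the whole search space;
at the other end the EMPTY cell set covers the floor-touching designs iff the floor statement itself holds (and `FinCheckOn ∅`
is trivially true). Every intermediate `U` with a proved `CoversFloor U` trades a priori mathematics (support bounds: w2, w3)
against certificate size — a cover is never free: proving `CoversFloor U` for small `U` IS proving part of the floor. -/
theorem coversFloor_empty_iff (h : ℤ) (B : ℕ) (rmin : ℤ) : CoversFloor ∅ h B rmin ↔ FloorFree h B rmin := by
  constructor
  · intro hcov D hA h1 h4 hμ hB hr c hc f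
    by_contra hle
    exact absurd (hcov D hA h1 h4 hμ hB hr ⟨c, hc, f, not_lt.mp hle⟩ c hc) (Finset.notMem_empty c)
  · intro hF D hA h1 h4 hμ hB hr ht
    obtain ⟨c, hc, f, hle⟩ := ht
    exact absurd (hF D hA h1 h4 hμ hB hr c hc f) (not_lt.mpr hle)

theorem finCheckOn_empty (B : ℕ) (rmin : ℤ) : FinCheckOn ∅ B rmin :=
  fun _ _ _ _ _ _ c hc => absurd hc (Finset.notMem_empty c)

/-- (w4) HEIGHT TRANSFER IS MOOT for covers: floor-free admissible designs need no cover at all (§6), and a floor-touching design at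
storey `h + 1` is not the shift of anything at storey `h`. What cell sets of ONE storey share is only the transfer of a passed
check from a covering `U` to any other `V ⊆ cellsOn h` (no inclusion `U ⊆ V` needed): -/
theorem finCheckOn_transfer {U V : Finset Cell} {B : ℕ} {rmin : ℤ} {h : ℤ} (hV : V ⊆ cellsOn h)
    (hcovU : CoversFloor U h B rmin) (hF : FinCheckOn U B rmin) : FinCheckOn V B rmin :=
  finCheckOn_of_floorFree hV (floorFree_of_finCheckOn_floor hcovU hF)

/-! ## §7 The first PROVED cover: the (A4) letter constraints (STRICT-SHRINK ∕ CLAIM 1 of `DepthBoundA4`, every height) -/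

/-- N-letters of an (A4) design on the alphabet have `a ≥ 2` (co-level drop ≥ 2 above a P-letter with `a ≥ 0`);
in particular N-cells never touch the floor. -/
theorem n_letter_two_le {D : Design} {h : ℤ} (hA : D.OnAlphabet h) (h4 : D.A4) {y : Cell} (hy : y ∈ D.suppN) (f : Fin 4) :
    2 ≤ (y f).a := by
  obtain ⟨x, hx, hl⟩ := h4.2 y hy
  have hxA := hA x (List.mem_append_right _ hx) f
  have hyA := hA y (List.mem_append_left _ hy) f
  have hh : (x f).height = (y f).height := by rw [hxA.1, hyA.1]
  have hd := colevel_drop_two (x f) (y f) hh (hl f)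
  obtain ⟨hxh, hx0⟩ := hxA
  obtain ⟨hyh, _⟩ := hyA
  unfold Letter.height at hxh hyh
  unfold Letter.colevel at hd
  omega

/-- P-letters of an (A4) design on the alphabet are OFF-AXIS (`x·y ≠ 0`) … -/
theorem p_letter_offaxis {D : Design} {h : ℤ} (hA : D.OnAlphabet h) (h4 : D.A4) {x : Cell} (hx : x ∈ D.suppP) (f : Fin 4) :
    (x f).x * (x f).y ≠ 0 := by
  obtain ⟨y, hy, hl⟩ := h4.1 x hx
  have hxA := hA x (List.mem_append_right _ hx) f
  have hyA := hA y (List.mem_append_left _ hy) f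
  have hh : (x f).height = (y f).height := by rw [hxA.1, hyA.1]
  intro hax
  exact no_ample_cover_of_axis (x f) (y f) hh hax (hl f)

/-- … and have `a ≤ h − 2`. -/
theorem p_letter_le {D : Design} {h : ℤ} (hA : D.OnAlphabet h) (h4 : D.A4) {x : Cell} (hx : x ∈ D.suppP) (f : Fin 4) :
    (x f).a + 2 ≤ h := by
  obtain ⟨y, hy, hl⟩ := h4.1 x hx
  have hxA := hA x (List.mem_append_right _ hx) f
  have hyA := hA y (List.mem_append_left _ hy) f
  have hh : (x f).height = (y f).height := by rw [hxA.1, hyA.1]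
  have hd := colevel_drop_two (x f) (y f) hh (hl f)
  obtain ⟨hxh, _⟩ := hxA
  obtain ⟨hyh, hy0⟩ := hyA
  unfold Letter.height at hxh hyh
  unfold Letter.colevel at hd
  have := abs_nonneg (y f).x
  have := abs_nonneg (y f).y
  omega

/-- floor letters sit in P-cells only. -/
theorem touchesFloor_iff_P {D : Design} {h : ℤ} (hA : D.OnAlphabet h) (h4 : D.A4) :
    TouchesFloor D ↔ ∃ c ∈ D.suppP, ∃ f : Fin 4, (c f).a = 0 := by
  constructor
  · rintro ⟨c, hc, f, hle⟩
    rcases List.mem_append.mp hc with hN | hP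
    · have := n_letter_two_le hA h4 hN f; omega
    · exact ⟨c, hP, f, le_antisymm hle (hA c hc f).2⟩
  · rintro ⟨c, hP, f, h0⟩
    exact ⟨c, List.mem_append_right _ hP, f, le_of_eq h0⟩

/-- **the (A4) cover**: cells of the alphabet whose four letters all have `a ≥ 2` (the only possible N-cells) or are all off-axis
(the only possible P-cells). Computable. -/
def coverA4 (h : ℤ) : Finset Cell :=
  (cellsOn h).filter (fun c => (∀ f : Fin 4, 2 ≤ (c f).a) ∨ (∀ f : Fin 4, (c f).x * (c f).y ≠ 0))

theorem coverA4_subset (h : ℤ) : coverA4 h ⊆ cellsOn h := Finset.filter_subset _ _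

/-- `coverA4 h` carries EVERY admissible design (not only the floor-touching ones), at every budget and rank. -/
theorem covers_coverA4 (h : ℤ) (B : ℕ) (rmin : ℤ) : Covers (coverA4 h) h B rmin := by
  intro D hA _ h4 _ _ _ c hc
  rw [coverA4, Finset.mem_filter]
  refine ⟨mem_cellsOn.mpr (hA c hc), ?_⟩
  rcases List.mem_append.mp hc with hN | hP
  · exact Or.inl (fun f => n_letter_two_le hA h4 hN f)
  · exact Or.inr (fun f => p_letter_offaxis hA h4 hP f)

/-- hence the floor statement is the finite check on `coverA4 h`. -/
theorem floorFree_iff_finCheckOn_coverA4 (h : ℤ) (B : ℕ) (rmin : ℤ) :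
    FloorFree h B rmin ↔ FinCheckOn (coverA4 h) B rmin :=
  floorFree_iff_finCheckOn (coverA4_subset h) (covers_coverA4 h B rmin)

/-- honest size at `h = 6` (arithmetic only): N-type letters (`a ≥ 2`, co-level `≤ 4`) `1+4+8+12+16 = 41`, off-axis letters
(co-level `c ≥ 2`, `4(c−1)` each) `4+8+12+16+20 = 60`, both `4+8+12 = 24`; so `|coverA4 6| = 41⁴ + 60⁴ − 24⁴ = 15 453 985`
cells against `85⁴ = 52 200 625` — a factor `3.4`, i.e. the (A4) letter constraints alone do not make the check small;
the budget-driven support bounds (w2 ∕ w3, `DeepCellBudget`) are where a certificate-size `U₆` must come from. -/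
example : 1 + 4 + 8 + 12 + 16 = 41 ∧ 4 + 8 + 12 + 16 + 20 = 60 ∧ 41 ^ 4 + 60 ^ 4 - 24 ^ 4 = 15453985 := by decide


/-! ## §8 HEIGHT TRANSFER (director R19.471 (3)): storey `h + 1` = (shift of a height-`h` design) ⊔ (a FLOOR FAMILY)

The strengthen lens's object for the cycle, STATED and with BOTH directions kernel: `floorFree_succ_iff`. The finite universe of
the letter step at storey `h'` is the explicit computable Finset `floorCells h'` (cells with four off-axis letters, at least one of
them a floor letter `a = 0`); its size is `(2h'(h'−1))⁴ − (2(h'−1)(h'−2))⁴` (off-axis letters `2h'(h'−1)`, off-axis non-floor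
letters `2(h'−1)(h'−2)`): `10 400 000` at `h' = 6`, `36 827 136` at `h' = 7`, …, `8 079 335 680` at `h' = 14` (§8.4).
WHY IT MIGHT FAIL ∕ (c) of R19.471: the stripped object `E` is NOT an (A1) ∧ (A4) object of storey `h` in general — the (A1) word
rows MIX the two parts (`T_append`: `T (shift E ⊔ F) w = T (shift E) w + T F w`, and `T F w` vanishes identically only on words
carrying the symbol `h` on a floor factor of every cell of `F`, since `Sym.h.coef ℓ = ℓ.a`), (A4).2 may hold for an N-cell of
`shift E` only through a floor cell of `F`, and `μ E = μ (shift E ⊔ F) − μ F`. So an induction on `h` can only run on the RELAXED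
predicate «`E` is (A1)-clean modulo the pulled-back floor columns, (A4) modulo `F`-orphans» — see STRENGTHEN-MEMO-17 §3 for the
row census and the price; nothing in this section is a floor. -/

/-- admissibility at `(h, B, rmin)`, bundled (the six hypotheses of `FloorFree` ∕ `Nonex`). -/
def Admissible (h : ℤ) (B : ℕ) (rmin : ℤ) (D : Design) : Prop :=
  D.OnAlphabet h ∧ D.A1 ∧ D.A4 ∧ D.mu ≠ 0 ∧ D.copies ≤ B ∧ rmin ≤ D.rank

theorem floorFree_iff_admissible (h : ℤ) (B : ℕ) (rmin : ℤ) :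
    FloorFree h B rmin ↔ ∀ D : Design, Admissible h B rmin D → ∀ c ∈ D.suppN ++ D.suppP, ∀ f : Fin 4, 0 < (c f).a :=
  ⟨fun H D hD => H D hD.1 hD.2.1 hD.2.2.1 hD.2.2.2.1 hD.2.2.2.2.1 hD.2.2.2.2.2,
   fun H D hA h1 h4 hμ hB hr => H D ⟨hA, h1, h4, hμ, hB, hr⟩⟩

/-- juxtaposition of two designs: lists appended (multiplicities add cell-wise). -/
def append (D D' : Design) : Design := ⟨D.N ++ D'.N, D.P ++ D'.P⟩

/-! ### §8.1 List-permutation invariance of every admissibility predicate -/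

section perm
variable {D D' : Design}

theorem suppN_perm (hN : D.N.Perm D'.N) : D.suppN.Perm D'.suppN := (hN.filter _).map _
theorem suppP_perm (hP : D.P.Perm D'.P) : D.suppP.Perm D'.suppP := (hP.filter _).map _

theorem T_perm (hN : D.N.Perm D'.N) (hP : D.P.Perm D'.P) (w : Word) : D.T w = D'.T w := by
  unfold Design.T
  rw [(hN.map _).sum_eq, (hP.map _).sum_eq]

theorem copies_perm (hN : D.N.Perm D'.N) (hP : D.P.Perm D'.P) : D.copies = D'.copies := by
  unfold Design.copies
  rw [(hN.map _).sum_eq, (hP.map _).sum_eq]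

theorem rank_perm (hN : D.N.Perm D'.N) (hP : D.P.Perm D'.P) : D.rank = D'.rank := by
  unfold Design.rank
  rw [(hN.map _).sum_eq, (hP.map _).sum_eq]

theorem mem_supp_perm (hN : D.N.Perm D'.N) (hP : D.P.Perm D'.P) (c : Cell) :
    c ∈ D.suppN ++ D.suppP ↔ c ∈ D'.suppN ++ D'.suppP := by
  rw [List.mem_append, List.mem_append, (suppN_perm hN).mem_iff, (suppP_perm hP).mem_iff]

theorem onAlphabet_perm (hN : D.N.Perm D'.N) (hP : D.P.Perm D'.P) {h : ℤ} (hA : D.OnAlphabet h) : D'.OnAlphabet h :=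
  fun c hc f => hA c ((mem_supp_perm hN hP c).mpr hc) f

theorem a1_perm (hN : D.N.Perm D'.N) (hP : D.P.Perm D'.P) (h1 : D.A1) : D'.A1 :=
  ⟨fun w hw e1 e2 => by rw [← T_perm hN hP]; exact h1.1 w hw e1 e2,
   fun w w' hw hw' hd => by rw [← T_perm hN hP, ← T_perm hN hP]; exact h1.2 w w' hw hw' hd⟩

theorem a4_perm (hN : D.N.Perm D'.N) (hP : D.P.Perm D'.P) (h4 : D.A4) : D'.A4 :=
  ⟨fun x hx => by
    obtain ⟨y, hy, hl⟩ := h4.1 x ((suppP_perm hP).mem_iff.mpr hx)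
    exact ⟨y, (suppN_perm hN).mem_iff.mp hy, hl⟩,
   fun y hy => by
    obtain ⟨x, hx, hl⟩ := h4.2 y ((suppN_perm hN).mem_iff.mpr hy)
    exact ⟨x, (suppP_perm hP).mem_iff.mp hx, hl⟩⟩

theorem admissible_perm (hN : D.N.Perm D'.N) (hP : D.P.Perm D'.P) {h : ℤ} {B : ℕ} {rmin : ℤ}
    (hD : Admissible h B rmin D) : Admissible h B rmin D' := by
  obtain ⟨hA, h1, h4, hμ, hB, hr⟩ := hD
  refine ⟨onAlphabet_perm hN hP hA, a1_perm hN hP h1, a4_perm hN hP h4, ?_, ?_, ?_⟩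
  · unfold Design.mu; rw [← T_perm hN hP]; exact hμ
  · rw [← copies_perm hN hP]; exact hB
  · rw [← rank_perm hN hP]; exact hr

end perm

/-! ### §8.2 The floor cells and floor families; the split of a design into its floor part and the rest -/

/-- **the finite universe of the letter step at height `h'`**: cells of the alphabet with four OFF-AXIS letters (the only possible
P-letters, §7) at least one of which is a FLOOR letter `a = 0`. Computable; decidable membership. -/
def floorCells (h' : ℤ) : Finset Cell :=
  (cellsOn h').filter (fun c => (∀ f : Fin 4, (c f).x * (c f).y ≠ 0) ∧ ∃ f : Fin 4, (c f).a = 0)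

theorem floorCells_subset (h' : ℤ) : floorCells h' ⊆ cellsOn h' := Finset.filter_subset _ _

/-- a FLOOR FAMILY at height `h'`: a pure-P design supported on floor cells. -/
def FloorFamily (h' : ℤ) (F : Design) : Prop := F.N = [] ∧ ∀ c ∈ F.suppP, c ∈ floorCells h'

/-- «this P-entry sits on a floor cell». -/
def isFloorEntry (cm : Cell × ℕ) : Bool := decide (∃ f : Fin 4, (cm.1 f).a = 0)

/-- the floor part of a design: its P-entries on cells with a floor letter (no N-entries: N-cells never touch the floor, §7). -/
def floorPart (D : Design) : Design := ⟨[], D.P.filter isFloorEntry⟩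

/-- the rest: all N-entries and the P-entries off the floor. -/
def offFloorPart (D : Design) : Design := ⟨D.N, D.P.filter fun cm => !isFloorEntry cm⟩

theorem suppN_append (D D' : Design) : (append D D').suppN = D.suppN ++ D'.suppN := by
  unfold append Design.suppN; rw [List.filter_append, List.map_append]

theorem suppP_append (D D' : Design) : (append D D').suppP = D.suppP ++ D'.suppP := by
  unfold append Design.suppP; rw [List.filter_append, List.map_append]

theorem append_parts_N (D : Design) : (append (offFloorPart D) (floorPart D)).N = D.N := by
  unfold append offFloorPart floorPart; exact List.append_nil D.N

theorem append_parts_P_perm (D : Design) : (append (offFloorPart D) (floorPart D)).P.Perm D.P := by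
  unfold append offFloorPart floorPart
  exact List.perm_append_comm.trans (List.filter_append_perm isFloorEntry D.P)

theorem mem_suppP_filter {D : Design} {q : Cell × ℕ → Bool} {c : Cell} (hc : c ∈ Design.suppP ⟨[], D.P.filter q⟩) :
    c ∈ D.suppP ∧ ∃ m : ℕ, (c, m) ∈ D.P ∧ 0 < m ∧ q (c, m) = true := by
  obtain ⟨m, hm, hpos⟩ := (mem_suppP_iff _ c).mp hc
  rw [List.mem_filter] at hm
  exact ⟨(mem_suppP_iff D c).mpr ⟨m, hm.1, hpos⟩, m, hm.1, hpos, hm.2⟩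

theorem mem_suppP_offFloor {D : Design} {c : Cell} (hc : c ∈ (offFloorPart D).suppP) :
    c ∈ D.suppP ∧ ∀ f : Fin 4, (c f).a ≠ 0 := by
  obtain ⟨m, hm, hpos⟩ := (mem_suppP_iff _ c).mp hc
  unfold offFloorPart at hm
  rw [List.mem_filter] at hm
  refine ⟨(mem_suppP_iff D c).mpr ⟨m, hm.1, hpos⟩, fun f h0 => ?_⟩
  have : isFloorEntry (c, m) = true := by unfold isFloorEntry; exact decide_eq_true ⟨f, h0⟩
  rw [this] at hm
  exact absurd hm.2 (by decide)

theorem mem_suppP_floorPart {D : Design} {c : Cell} (hc : c ∈ (floorPart D).suppP) :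
    c ∈ D.suppP ∧ ∃ f : Fin 4, (c f).a = 0 := by
  obtain ⟨m, hm, hpos⟩ := (mem_suppP_iff _ c).mp hc
  unfold floorPart at hm
  rw [List.mem_filter] at hm
  refine ⟨(mem_suppP_iff D c).mpr ⟨m, hm.1, hpos⟩, ?_⟩
  have := hm.2
  unfold isFloorEntry at this
  exact of_decide_eq_true this

theorem suppN_offFloor (D : Design) : (offFloorPart D).suppN = D.suppN := rfl

/-- the floor part of an admissible design is a floor family. -/
theorem floorFamily_floorPart {D : Design} {h' : ℤ} (hA : D.OnAlphabet h') (h4 : D.A4) : FloorFamily h' (floorPart D) := by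
  refine ⟨rfl, fun c hc => ?_⟩
  obtain ⟨hcP, f, h0⟩ := mem_suppP_floorPart hc
  rw [floorCells, Finset.mem_filter]
  exact ⟨mem_cellsOn.mpr (hA c (List.mem_append_right _ hcP)), fun g => p_letter_offaxis hA h4 hcP g, f, h0⟩

/-- the rest shifts DOWN one storey: all its letters have `a ≥ 1`. -/
theorem onAlphabet_unshift_offFloor {D : Design} {h : ℤ} (hA : D.OnAlphabet (h + 1)) (h4 : D.A4) :
    (shiftD (-1) (offFloorPart D)).OnAlphabet h := by
  have hA' : (offFloorPart D).OnAlphabet (h + 1) := by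
    intro c hc f
    rcases List.mem_append.mp hc with hN | hP
    · exact hA c (List.mem_append_left _ (by rw [suppN_offFloor] at hN; exact hN)) f
    · exact hA c (List.mem_append_right _ (mem_suppP_offFloor hP).1) f
  have key := onAlphabet_shift (offFloorPart D) (h + 1) (-1) hA' (fun c hc f => by
    rcases List.mem_append.mp hc with hN | hP
    · rw [suppN_offFloor] at hN
      have := n_letter_two_le hA h4 hN f
      omega
    · obtain ⟨hcP, hne⟩ := mem_suppP_offFloor hP
      have h0 := (hA c (List.mem_append_right _ hcP) f).2
      have h1 := hne f
      omega)
  have e : h + 1 + (-1 : ℤ) = h := by ring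
  rw [e] at key
  exact key

/-- shifting down and up again is the identity. -/
theorem shiftD_one_neg_one (X : Design) : shiftD 1 (shiftD (-1) X) = X := by
  unfold shiftD
  rw [mapD_mapD]
  have hc : (fun c : Cell => shiftCell 1 (shiftCell (-1) c)) = fun c => c := by
    funext c; funext g
    simp only [shiftCell, shiftL_shiftL]
    norm_num [shiftL_zero]
  rw [hc]
  cases X with
  | mk N P => simp [mapD]

/-! ### §8.3 THE HEIGHT-TRANSFER `↔` -/

/-- **HEIGHT TRANSFER (R19.471 (3)).** The floor statement at storey `h + 1` says exactly: NO height-`h` design `E` (arbitrary —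
under the tower hypothesis `Nonex h` it is never itself admissible) extends by a NON-EMPTY floor family `F ⊆ floorCells (h+1)` to an
admissible design `shift E ⊔ F` at storey `h + 1`. Both directions kernel; `(←)` is the split `D = offFloorPart D ⊔ floorPart D`
up to list permutation (§8.1–8.2). -/
theorem floorFree_succ_iff (h : ℤ) (B : ℕ) (rmin : ℤ) :
    FloorFree (h + 1) B rmin ↔
      ∀ E F : Design, E.OnAlphabet h → FloorFamily (h + 1) F → F.suppP ≠ [] →
        ¬ Admissible (h + 1) B rmin (append (shiftD 1 E) F) := by
  constructor
  · intro hF E F _ hFF hne hadm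
    obtain ⟨c, hc⟩ := List.exists_mem_of_ne_nil F.suppP hne
    have hcf := hFF.2 c hc
    rw [floorCells, Finset.mem_filter] at hcf
    obtain ⟨_, _, f, h0⟩ := hcf
    have hmem : c ∈ (append (shiftD 1 E) F).suppN ++ (append (shiftD 1 E) F).suppP :=
      List.mem_append_right _ (by rw [suppP_append]; exact List.mem_append_right _ hc)
    have := (floorFree_iff_admissible (h + 1) B rmin).mp hF _ hadm c hmem f
    omega
  · intro H
    rw [floorFree_iff_admissible]
    intro D hD c hc f
    by_contra hle
    obtain ⟨hA, h1, h4, hμ, hB, hr⟩ := hD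
    -- the touching cell is a P-cell with a floor letter
    have hcP : c ∈ D.suppP := by
      rcases List.mem_append.mp hc with hN | hP
      · have := n_letter_two_le hA h4 hN f; omega
      · exact hP
    have h0 : (c f).a = 0 := le_antisymm (not_lt.mp hle) (hA c hc f).2
    -- the split
    let E := shiftD (-1) (offFloorPart D)
    let F := floorPart D
    have hE : E.OnAlphabet h := onAlphabet_unshift_offFloor hA h4
    have hFF : FloorFamily (h + 1) F := floorFamily_floorPart hA h4
    have hne : F.suppP ≠ [] := by
      obtain ⟨m, hm, hpos⟩ := (mem_suppP_iff D c).mp hcP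
      have hfe : isFloorEntry (c, m) = true := by unfold isFloorEntry; exact decide_eq_true ⟨f, h0⟩
      have hcF : c ∈ F.suppP :=
        (mem_suppP_iff F c).mpr ⟨m, by unfold F floorPart; exact List.mem_filter.mpr ⟨hm, hfe⟩, hpos⟩
      intro hnil; rw [hnil] at hcF; exact absurd hcF (by simp)
    have hsh : append (shiftD 1 E) F = append (offFloorPart D) (floorPart D) := by
      unfold E; rw [shiftD_one_neg_one]
    refine H E F hE hFF hne ?_
    rw [hsh]
    exact admissible_perm (D := D) (by rw [append_parts_N]) (append_parts_P_perm D).symm ⟨hA, h1, h4, hμ, hB, hr⟩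

/-- the same with the tower hypothesis visible: under `Nonex h`, storey `h + 1` is decided by the floor-family extensions alone
(`HeightTower.nonex_succ_iff`). -/
theorem nonex_succ_iff_floorFamilies (h : ℤ) (B : ℕ) (rmin : ℤ) :
    Nonex (h + 1) B rmin ↔ Nonex h B rmin ∧
      ∀ E F : Design, E.OnAlphabet h → FloorFamily (h + 1) F → F.suppP ≠ [] →
        ¬ Admissible (h + 1) B rmin (append (shiftD 1 E) F) := by
  rw [nonex_succ_iff, floorFree_succ_iff]

/-! ### §8.4 The MIXING of the two parts in the class tensor, and the size of the letter-step universe -/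

/-- the class tensor is additive under juxtaposition — so the (A1) rows of `shift E ⊔ F` COUPLE `E` and `F`. -/
theorem T_append (D D' : Design) (w : Word) : (append D D').T w = D.T w + D'.T w := by
  unfold append Design.T
  rw [List.map_append, List.map_append, List.sum_append, List.sum_append]
  ring

theorem mu_append (D D' : Design) : (append D D').mu = D.mu + D'.mu := T_append D D' Word.eeee

theorem copies_append (D D' : Design) : (append D D').copies = D.copies + D'.copies := by
  unfold append Design.copies
  rw [List.map_append, List.map_append, List.sum_append, List.sum_append]
  ring

theorem rank_append (D D' : Design) : (append D D').rank = D.rank + D'.rank := by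
  unfold append Design.rank
  rw [List.map_append, List.map_append, List.sum_append, List.sum_append]
  push_cast
  ring

/-- a floor letter kills the symbol `h` on its factor (`Sym.h.coef ℓ = ℓ.a`): the ONLY mechanism by which a word row can fail to
see a floor cell. -/
theorem coef_h_floor (ℓ : Letter) (h0 : ℓ.a = 0) : Sym.h.coef ℓ = 0 := by
  simp [Sym.coef, h0]

theorem cellCoef_floor_of_h (c : Cell) (w : Word) (f : Fin 4) (hf : w f = Sym.h) (h0 : (c f).a = 0) : cellCoef c w = 0 := by
  unfold cellCoef
  exact Finset.prod_eq_zero (Finset.mem_univ f) (by rw [hf]; exact coef_h_floor (c f) h0)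

/-- size of the letter-step universe (arithmetic; off-axis letters at height `h'`: `2h'(h'−1)`, of which `4(h'−1)` are floor letters):
`|floorCells h'| = (2h'(h'−1))⁴ − (2(h'−1)(h'−2))⁴`; the nine storeys of record `h' = 6, …, 14`. -/
example :
    (2*6*5)^4 - (2*5*4)^4 = 10400000 ∧ (2*7*6)^4 - (2*6*5)^4 = 36827136 ∧ (2*8*7)^4 - (2*7*6)^4 = 107564800 ∧
    (2*9*8)^4 - (2*8*7)^4 = 272629760 ∧ (2*10*9)^4 - (2*9*8)^4 = 619778304 ∧ (2*11*10)^4 - (2*10*9)^4 = 1292800000 ∧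
    (2*12*11)^4 - (2*11*10)^4 = 2514972416 ∧ (2*13*12)^4 - (2*12*11)^4 = 4618321920 ∧
    (2*14*13)^4 - (2*13*12)^4 = 8079335680 := by norm_num


/-! ### §8.5 (c) made kernel: the row system of the juxtaposition, and the rows that survive for `E` -/

/-- (A1).1 of a juxtaposition, unpacked row by row. -/
theorem mixedVanish_append_iff (D D' : Design) :
    MixedVanish (append D D') ↔ ∀ w : Word, ¬ w.efree → w ≠ Word.eeee → w ≠ Word.EEEE → D.T w = -D'.T w := by
  unfold MixedVanish
  simp only [T_append]
  constructor
  · intro H w hw e1 e2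
    exact eq_neg_of_add_eq_zero_left (H w hw e1 e2)
  · intro H w hw e1 e2
    rw [H w hw e1 e2]
    ring

/-- (A1).2 of a juxtaposition, unpacked: the e-free DIFFERENCES of one part are dictated by the other. -/
theorem eAgree_append_iff (D D' : Design) :
    EAgree (append D D') ↔
      ∀ w w' : Word, w.efree → w'.efree → w.deg = w'.deg → D.T w - D.T w' = D'.T w' - D'.T w := by
  unfold EAgree
  simp only [T_append]
  constructor
  · intro H w w' hw hw' hd
    have := H w w' hw hw' hd
    linear_combination this
  · intro H w w' hw hw' hd
    have := H w w' hw hw' hd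
    linear_combination this

/-- THE SURVIVING ROWS: a floor family is invisible to a word that carries the symbol `h` on a floor factor of EACH of its cells
(and, `coef` being `1 ∕ a ∕ β̄ ∕ β ∕ a² − |β|²`, this is the only identically-vanishing mechanism). For such `w` the row of
`shift E ⊔ F` is a row of `shift E` alone; for every other row the two parts MIX. -/
theorem T_floorFamily_eq_zero {h' : ℤ} {F : Design} (hF : FloorFamily h' F) (w : Word)
    (hw : ∀ c ∈ F.suppP, ∃ f : Fin 4, w f = Sym.h ∧ (c f).a = 0) : F.T w = 0 := by
  unfold Design.T
  rw [hF.1, List.map_nil, List.sum_nil, zero_sub, neg_eq_zero]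
  apply List.sum_eq_zero
  intro z hz
  rw [List.mem_map] at hz
  obtain ⟨cm, hcm, rfl⟩ := hz
  by_cases hm : 0 < cm.2
  · have hc : cm.1 ∈ F.suppP := (mem_suppP_iff F cm.1).mpr ⟨cm.2, hcm, hm⟩
    obtain ⟨f, hf, h0⟩ := hw cm.1 hc
    rw [cellCoef_floor_of_h cm.1 w f hf h0, mul_zero]
  · have h0 : cm.2 = 0 := by omega
    rw [h0, Nat.cast_zero, zero_mul]

/-- hence, for the rows `w ∉ {eeee, ēēēē}` e-mixed with `h` on a floor factor of every cell of `F`, the stripped-and-unshifted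
`E` satisfies the (A1).1 row EXACTLY (`T (shift E) w = 0`); all other (A1) rows of `E` are relaxed by `F`. -/
theorem survive_row {h : ℤ} {E F : Design} (hF : FloorFamily (h + 1) F) (hMV : MixedVanish (append (shiftD 1 E) F))
    {w : Word} (hw : ¬ w.efree) (e1 : w ≠ Word.eeee) (e2 : w ≠ Word.EEEE)
    (hrow : ∀ c ∈ F.suppP, ∃ f : Fin 4, w f = Sym.h ∧ (c f).a = 0) : (shiftD 1 E).T w = 0 := by
  rw [(mixedVanish_append_iff _ _).mp hMV w hw e1 e2, T_floorFamily_eq_zero hF w hrow, neg_zero]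


/-! ## §9 COVER-LEMMA PROGRAMME W-1 (director R19.480 (2)): (w2) SHADOW CONES above the floor, and the (A4)-SATURATION of `coverA4`

Two kernel facts for the certificate dial `|U₆|`, both with their `h = 6` numbers.

**(A) Shadow cones (w2).** For a letter `ℓ` of the height-`h` alphabet, `upSet h ℓ` is the set of letters AMPLY ABOVE it;
for a cell `x`, `shadow h x = ∏_f upSet h (x f)` is its SHADOW CONE. Every P-cell of an (A4) design on the alphabet has an
N-cell OF THE DESIGN inside its shadow cone (`exists_suppN_mem_shadow`), and STRICT-SHRINK puts `upSet h ℓ` inside the box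
`|x'| ≤ |ℓ.x| − 1, |y'| ≤ |ℓ.y| − 1, a' ≥ ℓ.a + 2` (`upSet_shrink`); above a letter with `|y| = 1` only AXIS letters survive
(`upSet_y_eq_zero`). At `h = 6` (kernel `decide` on the list form `upList`, §9.3): the up-sets of the off-axis letter types have
sizes `(0;5,1) ↦ 5` (the five axis letters `(2;4,0) (3;3,0) (4;2,0) (5;1,0) (6;0,0)`), `(0;4,2) ↦ 8`, `(0;3,3) ↦ 9`, `(1;4,1) ↦ 4`,
`(1;3,2) ↦ 6`, `(2;3,1) ↦ 3`, `(2;2,2) ↦ 4`, `(3;2,1) ↦ 2`, `(4;1,1) ↦ 1` (the apex), axis letters `↦ 0`; every letter of the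
alphabet has `≤ 9` letters above it, so EVERY shadow cone at `h = 6` has `≤ 9⁴ = 6 561` cells (`card_shadow_six_le`; exact
enumeration off-kernel: over the `10 400 000` floor cells of `floorCells 6` the shadow sizes have maximum `6 561` and mean `554`).
WHAT THIS IS FOR ORDER P: a ROW ∕ BRANCHING rule, not a union shrink — «P-cell `x` used ⇒ some N-cell in `shadow h x` used»
is the lazy big-`M` row of `gomory.py --a4rows`, now with a kernel-certified finite cone per floor cell; as a LEAF-CLOSURE RULE it
is of law type (membership, threshold `1`, representable).

**(B) Saturation.** `coverA4 h` (§7) is not merely a cover: it is the LEAST set carrying every (A4) design on the alphabet —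
every one of its cells lies in the support of an explicit TWO-CELL design `OnAlphabet h ∧ A4` supported in `coverA4 h`
(`coverA4_saturated`: an N-type cell `y` (all `a ≥ 2`) is live over the off-axis cell `dropCell y` one storey-pair below it,
letters `(a−2; x±1, y±1)` pushed away from the axes; an off-axis cell is live under the apex cell `(h;0,0)⁴`), hence
`coverA4_least : (∀ D, D.OnAlphabet h → D.A4 → SuppIn D U) → coverA4 h ⊆ U`. CONSEQUENCE FOR THE DIAL (honest number):
from the (A4) + alphabet axioms alone the union cover cannot drop below `|coverA4 6| = 15 453 985`; the dial reading of this
cycle is `|U₆| : 15 453 985 → 15 453 985` (no proved shrink) — every further shrink of a UNION cover is an (A1) ∕ μ ∕ budget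
fact, i.e. integrality-carrying, exactly as ruled in R19.480 (3). The (w3) probe of this cycle (e-free profile-certificate LP,
exact ℚ, hub-local, `STRENGTHEN-MEMO-17 §7`) confirms the shape: the best S₄-profile certificate bounds the multiplicity of the
deepest isotypic floor cells at `h = 6` by `m ≤ 8 ∕ 10 ∕ 13` (`(0;3,3)⁴ ∕ (0;4,2)⁴ ∕ (0;5,1)⁴`) and the all-floor family mass by
`≤ 14`, but reaches `Φ ≤ 23.25 ≪ 197`, the value a CELL EXCLUSION would need — multiplicity bounds, no cover shrink. -/

section shadow

/-- a clean `Decidable` instance for `AmpleAbove` (definitional unfolding only, so that `decide` evaluates in the kernel). -/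
instance (priority := high) decAmpleAbove' (ℓ q : Letter) : Decidable (AmpleAbove ℓ q) :=
  inferInstanceAs (Decidable (ℓ.a < q.a ∧ (q.x - ℓ.x) ^ 2 + (q.y - ℓ.y) ^ 2 < (q.a - ℓ.a) ^ 2))

/-- §9.1 the UP-SET of a letter inside the height-`h` alphabet: the letters amply above it. -/
def upSet (h : ℤ) (ℓ : Letter) : Finset Letter := (lettersOn h).filter (fun q => AmpleAbove ℓ q)

theorem mem_upSet {h : ℤ} {ℓ q : Letter} : q ∈ upSet h ℓ ↔ q.OnAlphabet h ∧ AmpleAbove ℓ q := by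
  rw [upSet, Finset.mem_filter, mem_lettersOn]

/-- STRICT-SHRINK in up-set form: a letter above `ℓ` in the same alphabet is strictly closer to both axes and at least two
levels higher. -/
theorem upSet_shrink {h : ℤ} {ℓ q : Letter} (hℓ : ℓ.OnAlphabet h) (hq : q ∈ upSet h ℓ) :
    |q.x| + 1 ≤ |ℓ.x| ∧ |q.y| + 1 ≤ |ℓ.y| ∧ ℓ.a + 2 ≤ q.a := by
  obtain ⟨hqA, hA⟩ := mem_upSet.mp hq
  have hh : ℓ.height = q.height := by rw [hℓ.1, hqA.1]
  obtain ⟨hx, hy⟩ := strict_shrink ℓ q hh hA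
  refine ⟨hx, hy, ?_⟩
  have e1 := hℓ.1
  have e2 := hqA.1
  unfold Letter.height at e1 e2
  omega

/-- above a letter at distance `1` from an axis only letters ON that axis survive (at `h = 6`: above `(0;5,1)` sit exactly the
five axis letters `(2;4,0) … (6;0,0)`, none of which can be a P-letter). -/
theorem upSet_y_eq_zero {h : ℤ} {ℓ q : Letter} (hℓ : ℓ.OnAlphabet h) (hq : q ∈ upSet h ℓ) (h1 : |ℓ.y| = 1) : q.y = 0 := by
  have := (upSet_shrink hℓ hq).2.1
  have h0 : |q.y| = 0 := le_antisymm (by omega) (abs_nonneg _)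
  exact abs_eq_zero.mp h0

theorem upSet_x_eq_zero {h : ℤ} {ℓ q : Letter} (hℓ : ℓ.OnAlphabet h) (hq : q ∈ upSet h ℓ) (h1 : |ℓ.x| = 1) : q.x = 0 := by
  have := (upSet_shrink hℓ hq).1
  have h0 : |q.x| = 0 := le_antisymm (by omega) (abs_nonneg _)
  exact abs_eq_zero.mp h0

/-- an axis letter has empty up-set (`no_ample_cover_of_axis`). -/
theorem upSet_eq_empty_of_axis {h : ℤ} {ℓ : Letter} (hℓ : ℓ.OnAlphabet h) (hax : ℓ.x * ℓ.y = 0) : upSet h ℓ = ∅ := by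
  rw [Finset.eq_empty_iff_forall_notMem]
  intro q hq
  obtain ⟨hqA, hA⟩ := mem_upSet.mp hq
  exact no_ample_cover_of_axis ℓ q (by rw [hℓ.1, hqA.1]) hax hA

/-- §9.2 the SHADOW CONE of a cell: the cells of the alphabet live over it. -/
def shadow (h : ℤ) (x : Cell) : Finset Cell := Fintype.piFinset fun f => upSet h (x f)

theorem mem_shadow {h : ℤ} {x y : Cell} : y ∈ shadow h x ↔ (∀ f : Fin 4, (y f).OnAlphabet h) ∧ Live x y := by
  simp only [shadow, Fintype.mem_piFinset, mem_upSet, Live]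
  exact ⟨fun H => ⟨fun f => (H f).1, fun f => (H f).2⟩, fun H f => ⟨H.1 f, H.2 f⟩⟩

theorem card_shadow (h : ℤ) (x : Cell) : (shadow h x).card = ∏ f : Fin 4, (upSet h (x f)).card := by
  rw [shadow, Fintype.card_piFinset]

/-- (w2) THE CONE RULE: every P-cell of an (A4) design on the alphabet has an N-cell of the design in its shadow cone. In
particular every cell of a FLOOR FAMILY (§8) forces an N-cell of the whole storey into a cone of `≤ 6 561` cells at `h = 6`. -/
theorem exists_suppN_mem_shadow {D : Design} {h : ℤ} (hA : D.OnAlphabet h) (h4 : D.A4) {x : Cell} (hx : x ∈ D.suppP) :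
    ∃ y ∈ D.suppN, y ∈ shadow h x := by
  obtain ⟨y, hy, hl⟩ := h4.1 x hx
  exact ⟨y, hy, mem_shadow.mpr ⟨fun f => hA y (List.mem_append_left _ hy) f, hl⟩⟩

/-- dually every N-cell sits in the shadow cone of some P-cell of the design. -/
theorem exists_suppP_shadow_mem {D : Design} {h : ℤ} (hA : D.OnAlphabet h) (h4 : D.A4) {y : Cell} (hy : y ∈ D.suppN) :
    ∃ x ∈ D.suppP, y ∈ shadow h x := by
  obtain ⟨x, hx, hl⟩ := h4.2 y hy
  exact ⟨x, hx, mem_shadow.mpr ⟨fun f => hA y (List.mem_append_left _ hy) f, hl⟩⟩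

/-- a shadow cone of a cell with an axis letter is empty: such a cell is never a P-cell (cf. `p_letter_offaxis`). -/
theorem shadow_eq_empty_of_axis {h : ℤ} {x : Cell} (hx : ∀ f, (x f).OnAlphabet h) {f : Fin 4} (hax : (x f).x * (x f).y = 0) :
    shadow h x = ∅ := by
  rw [Finset.eq_empty_iff_forall_notMem]
  intro y hy
  have hl := (mem_shadow.mp hy).2 f
  have hyA := (mem_shadow.mp hy).1 f
  exact no_ample_cover_of_axis (x f) (y f) (by rw [(hx f).1, hyA.1]) hax hl

/-! ### §9.3 the list form `upList` (kernel-evaluable) and the `h = 6` numbers -/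

/-- letters of height `h` over the integer box `[-B, B]²`, as a duplicate-free LIST built from natural-number ranges. -/
def boxList (h : ℤ) (B : ℕ) : List Letter :=
  (List.range (2 * B + 1)).flatMap fun i : ℕ => (List.range (2 * B + 1)).map fun j : ℕ =>
    (⟨h - (((i : ℤ) - B).natAbs : ℤ) - (((j : ℤ) - B).natAbs : ℤ), (i : ℤ) - B, (j : ℤ) - B⟩ : Letter)

theorem mem_boxList {h : ℤ} {B : ℕ} {q : Letter} : q ∈ boxList h B ↔ q.height = h ∧ |q.x| ≤ B ∧ |q.y| ≤ B := by
  constructor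
  · intro hm
    rw [boxList, List.mem_flatMap] at hm
    obtain ⟨i, hi, hm'⟩ := hm
    obtain ⟨j, hj, hq⟩ := List.mem_map.mp hm'
    rw [List.mem_range] at hi hj
    subst hq
    refine ⟨?_, ?_, ?_⟩
    · show (h - (((i : ℤ) - B).natAbs : ℤ) - (((j : ℤ) - B).natAbs : ℤ)) + |(i : ℤ) - B| + |(j : ℤ) - B| = h
      rw [Int.natCast_natAbs, Int.natCast_natAbs]
      ring
    · show |(i : ℤ) - B| ≤ B
      exact abs_le.mpr ⟨by omega, by omega⟩
    · show |(j : ℤ) - B| ≤ B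
      exact abs_le.mpr ⟨by omega, by omega⟩
  · intro H
    obtain ⟨hh, hx, hy⟩ := H
    cases q with
    | mk a x y =>
      unfold Letter.height at hh
      dsimp only at hh hx hy
      obtain ⟨hx1, hx2⟩ := abs_le.mp hx
      obtain ⟨hy1, hy2⟩ := abs_le.mp hy
      have ex : (((x + B).toNat : ℕ) : ℤ) = x + B := Int.toNat_of_nonneg (by omega)
      have ey : (((y + B).toNat : ℕ) : ℤ) = y + B := Int.toNat_of_nonneg (by omega)
      rw [boxList, List.mem_flatMap]
      refine ⟨(x + B).toNat, List.mem_range.mpr (by omega), ?_⟩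
      rw [List.mem_map]
      refine ⟨(y + B).toNat, List.mem_range.mpr (by omega), ?_⟩
      rw [ex, ey]
      have e1 : (((x + (B : ℤ) - B).natAbs : ℕ) : ℤ) = |x| := by rw [add_sub_cancel_right, Int.natCast_natAbs]
      have e2 : (((y + (B : ℤ) - B).natAbs : ℕ) : ℤ) = |y| := by rw [add_sub_cancel_right, Int.natCast_natAbs]
      rw [e1, e2]
      simp only [Letter.mk.injEq]
      exact ⟨by omega, by omega, by omega⟩

/-- the kernel-evaluable up-set: candidates from the box of `ℓ`, filtered by `AmpleAbove`. -/
def upList (h : ℤ) (ℓ : Letter) : List Letter :=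
  (boxList h (max ℓ.x.natAbs ℓ.y.natAbs)).filter (fun q => decide (AmpleAbove ℓ q))

theorem mem_upList {h : ℤ} {ℓ q : Letter} (hℓ : ℓ.OnAlphabet h) : q ∈ upList h ℓ ↔ q.OnAlphabet h ∧ AmpleAbove ℓ q := by
  rw [upList, List.mem_filter, decide_eq_true_eq, mem_boxList]
  have hB : ((max ℓ.x.natAbs ℓ.y.natAbs : ℕ) : ℤ) = max |ℓ.x| |ℓ.y| := by
    rw [Nat.cast_max, Int.natCast_natAbs, Int.natCast_natAbs]
  rw [hB]
  constructor
  · rintro ⟨⟨hh, -, -⟩, hA⟩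
    have := hℓ.2
    have := hA.1
    exact ⟨⟨hh, by omega⟩, hA⟩
  · rintro ⟨hqA, hA⟩
    have hh : ℓ.height = q.height := by rw [hℓ.1, hqA.1]
    obtain ⟨hx, hy⟩ := strict_shrink ℓ q hh hA
    refine ⟨⟨hqA.1, ?_, ?_⟩, hA⟩
    · exact le_trans (by omega) (le_max_left _ _)
    · exact le_trans (by omega) (le_max_right _ _)

theorem upSet_eq_toFinset_upList {h : ℤ} {ℓ : Letter} (hℓ : ℓ.OnAlphabet h) : upSet h ℓ = (upList h ℓ).toFinset := by
  ext q
  rw [mem_upSet, List.mem_toFinset, mem_upList hℓ]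

theorem card_upSet_le_length {h : ℤ} {ℓ : Letter} (hℓ : ℓ.OnAlphabet h) : (upSet h ℓ).card ≤ (upList h ℓ).length := by
  rw [upSet_eq_toFinset_upList hℓ]
  exact List.toFinset_card_le _

theorem card_upSet_eq_length {h : ℤ} {ℓ : Letter} (hℓ : ℓ.OnAlphabet h) (hnd : (upList h ℓ).Nodup) :
    (upSet h ℓ).card = (upList h ℓ).length := by
  rw [upSet_eq_toFinset_upList hℓ]
  exact List.toFinset_card_of_nodup hnd

/-- THE `h = 6` UP-SET TABLE (one representative per off-axis letter type; the other letters of a type by the symmetries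
`x ↦ −x`, `y ↦ −y`, `x ↔ y`, which preserve `AmpleAbove`). -/
theorem upList_six_table :
    (upList 6 ⟨0, 5, 1⟩).length = 5 ∧ (upList 6 ⟨0, 4, 2⟩).length = 8 ∧ (upList 6 ⟨0, 3, 3⟩).length = 9 ∧
    (upList 6 ⟨1, 4, 1⟩).length = 4 ∧ (upList 6 ⟨1, 3, 2⟩).length = 6 ∧ (upList 6 ⟨2, 3, 1⟩).length = 3 ∧
    (upList 6 ⟨2, 2, 2⟩).length = 4 ∧ (upList 6 ⟨3, 2, 1⟩).length = 2 ∧ (upList 6 ⟨4, 1, 1⟩).length = 1 := by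
  decide

/-- the five letters above the floor letter `(0;5,1)` are the AXIS letters `(6;0,0) (5;1,0) (4;2,0) (3;3,0) (2;4,0)`; the single
letter above `(4;1,1)` is the apex `(6;0,0)`. -/
theorem upList_six_051 : upList 6 ⟨0, 5, 1⟩ = [⟨6, 0, 0⟩, ⟨5, 1, 0⟩, ⟨4, 2, 0⟩, ⟨3, 3, 0⟩, ⟨2, 4, 0⟩] := by decide
theorem upList_six_411 : upList 6 ⟨4, 1, 1⟩ = [⟨6, 0, 0⟩] := by decide
/-- the nine letters above the deepest floor letter `(0;3,3)`. -/
theorem upList_six_033 : upList 6 ⟨0, 3, 3⟩ =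
    [⟨6, 0, 0⟩, ⟨5, 0, 1⟩, ⟨4, 0, 2⟩, ⟨5, 1, 0⟩, ⟨4, 1, 1⟩, ⟨3, 1, 2⟩, ⟨4, 2, 0⟩, ⟨3, 2, 1⟩, ⟨2, 2, 2⟩] := by decide

theorem upList_six_nodup :
    (upList 6 ⟨0, 5, 1⟩).Nodup ∧ (upList 6 ⟨0, 4, 2⟩).Nodup ∧ (upList 6 ⟨0, 3, 3⟩).Nodup := by decide

/-- the floor letters' up-sets as `Finset` cardinalities: `5, 8, 9`. -/
theorem card_upSet_six_floor :
    (upSet 6 ⟨0, 5, 1⟩).card = 5 ∧ (upSet 6 ⟨0, 4, 2⟩).card = 8 ∧ (upSet 6 ⟨0, 3, 3⟩).card = 9 := by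
  have hA1 : (⟨0, 5, 1⟩ : Letter).OnAlphabet 6 := by unfold Letter.OnAlphabet Letter.height; decide
  have hA2 : (⟨0, 4, 2⟩ : Letter).OnAlphabet 6 := by unfold Letter.OnAlphabet Letter.height; decide
  have hA3 : (⟨0, 3, 3⟩ : Letter).OnAlphabet 6 := by unfold Letter.OnAlphabet Letter.height; decide
  refine ⟨?_, ?_, ?_⟩
  · rw [card_upSet_eq_length hA1 upList_six_nodup.1]; exact upList_six_table.1
  · rw [card_upSet_eq_length hA2 upList_six_nodup.2.1]; exact upList_six_table.2.1
  · rw [card_upSet_eq_length hA3 upList_six_nodup.2.2]; exact upList_six_table.2.2.1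

set_option maxRecDepth 65536 in
/-- every letter of the height-`6` alphabet (= the letters of height `6` with `0 ≤ a` in the box `[-6,6]²`) has at most `9`
letters above it (kernel `decide` over the `169` box letters; the `84` box letters with `a < 0` are outside the alphabet). -/
theorem upList_six_le_nine : ∀ ℓ ∈ boxList 6 6, 0 ≤ ℓ.a → (upList 6 ℓ).length ≤ 9 := by decide

theorem card_upSet_six_le {ℓ : Letter} (hℓ : ℓ.OnAlphabet 6) : (upSet 6 ℓ).card ≤ 9 := by
  refine le_trans (card_upSet_le_length hℓ) (upList_six_le_nine ℓ (mem_boxList.mpr ⟨hℓ.1, ?_, ?_⟩) hℓ.2)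
  · have e := hℓ.1; have h0 := hℓ.2; unfold Letter.height at e
    have := abs_nonneg ℓ.y; push_cast; omega
  · have e := hℓ.1; have h0 := hℓ.2; unfold Letter.height at e
    have := abs_nonneg ℓ.x; push_cast; omega

/-- (w2) NUMBER: at `h = 6` every shadow cone has at most `9⁴ = 6 561` cells. -/
theorem card_shadow_six_le {x : Cell} (hx : ∀ f : Fin 4, (x f).OnAlphabet 6) : (shadow 6 x).card ≤ 6561 := by
  rw [card_shadow]
  calc ∏ f : Fin 4, (upSet 6 (x f)).card ≤ ∏ _f : Fin 4, 9 :=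
        Finset.prod_le_prod (fun f _ => Nat.zero_le _) (fun f _ => card_upSet_six_le (hx f))
    _ = 6561 := by simp

/-- so an admissible design uses, for each of its P-cells `x`, an N-cell inside `shadow h x` — at `h = 6` among `≤ 6 561`
cells (`card_shadow_six_le`) out of the `41⁴ = 2 825 761` N-type cells of `coverA4 6`. -/
theorem floor_cone_rule {h : ℤ} {D : Design} {B : ℕ} {rmin : ℤ} (hD : Admissible h B rmin D) {x : Cell}
    (hx : x ∈ D.suppP) : ∃ y ∈ D.suppN, y ∈ shadow h x :=
  exists_suppN_mem_shadow hD.1 hD.2.2.1 hx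

end shadow

section saturation

/-- §9.4 the apex cell `(h;0,0)⁴`. -/
def apexCell (h : ℤ) : Cell := fun _ => ⟨h, 0, 0⟩

/-- push a letter one storey-pair DOWN and one step AWAY from both axes: `(a;x,y) ↦ (a−2; x±1, y±1)`. -/
def dropLetter (q : Letter) : Letter :=
  ⟨q.a - 2, q.x + (if 0 ≤ q.x then 1 else -1), q.y + (if 0 ≤ q.y then 1 else -1)⟩

def dropCell (c : Cell) : Cell := fun f => dropLetter (c f)

theorem dropLetter_a (q : Letter) : (dropLetter q).a = q.a - 2 := rfl
theorem dropLetter_x (q : Letter) : (dropLetter q).x = q.x + (if 0 ≤ q.x then 1 else -1) := rfl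
theorem dropLetter_y (q : Letter) : (dropLetter q).y = q.y + (if 0 ≤ q.y then 1 else -1) := rfl

theorem abs_dropLetter_x (q : Letter) : |(dropLetter q).x| = |q.x| + 1 := by
  rw [dropLetter_x]
  split_ifs with h0
  · rw [abs_of_nonneg h0, abs_of_nonneg (by omega)]
  · rw [abs_of_neg (by omega), abs_of_neg (by omega)]; ring

theorem abs_dropLetter_y (q : Letter) : |(dropLetter q).y| = |q.y| + 1 := by
  rw [dropLetter_y]
  split_ifs with h0
  · rw [abs_of_nonneg h0, abs_of_nonneg (by omega)]
  · rw [abs_of_neg (by omega), abs_of_neg (by omega)]; ring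

theorem dropLetter_offaxis (q : Letter) : (dropLetter q).x * (dropLetter q).y ≠ 0 := by
  have hx : (dropLetter q).x ≠ 0 := by
    intro h0; have := abs_dropLetter_x q; rw [h0, abs_zero] at this; have := abs_nonneg q.x; omega
  have hy : (dropLetter q).y ≠ 0 := by
    intro h0; have := abs_dropLetter_y q; rw [h0, abs_zero] at this; have := abs_nonneg q.y; omega
  exact mul_ne_zero hx hy

/-- the dropped letter stays on the alphabet as soon as `a ≥ 2`. -/
theorem dropLetter_onAlphabet {h : ℤ} {q : Letter} (hq : q.OnAlphabet h) (h2 : 2 ≤ q.a) : (dropLetter q).OnAlphabet h := by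
  refine ⟨?_, by rw [dropLetter_a]; omega⟩
  have e := hq.1
  unfold Letter.height at e ⊢
  rw [abs_dropLetter_x, abs_dropLetter_y, dropLetter_a]
  omega

/-- and `q` is amply above its drop: `a`-gap `2`, lateral offset `(±1, ±1)`, `1 + 1 < 4`. -/
theorem ampleAbove_dropLetter (q : Letter) : AmpleAbove (dropLetter q) q := by
  refine ⟨by rw [dropLetter_a]; omega, ?_⟩
  rw [dropLetter_a, dropLetter_x, dropLetter_y]
  split_ifs <;> nlinarith

theorem live_dropCell (c : Cell) : Live (dropCell c) c := fun f => ampleAbove_dropLetter (c f)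

/-- an OFF-AXIS letter of the alphabet is amply below the apex letter `(h;0,0)`: `x² + y² < (|x| + |y|)²`. -/
theorem ampleAbove_apex {h : ℤ} {p : Letter} (hp : p.OnAlphabet h) (hoff : p.x * p.y ≠ 0) : AmpleAbove p ⟨h, 0, 0⟩ := by
  have e := hp.1
  unfold Letter.height at e
  have hx : p.x ≠ 0 := fun h0 => hoff (by rw [h0, zero_mul])
  have hy : p.y ≠ 0 := fun h0 => hoff (by rw [h0, mul_zero])
  have hx1 : 1 ≤ |p.x| := Int.one_le_abs hx
  have hy1 : 1 ≤ |p.y| := Int.one_le_abs hy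
  have sx : |p.x| ^ 2 = p.x ^ 2 := sq_abs _
  have sy : |p.y| ^ 2 = p.y ^ 2 := sq_abs _
  refine ⟨by show p.a < h; omega, ?_⟩
  show (0 - p.x) ^ 2 + (0 - p.y) ^ 2 < (h - p.a) ^ 2
  have eh : h - p.a = |p.x| + |p.y| := by omega
  rw [eh]
  nlinarith

theorem live_apexCell {h : ℤ} {c : Cell} (hc : ∀ f, (c f).OnAlphabet h) (hoff : ∀ f, (c f).x * (c f).y ≠ 0) :
    Live c (apexCell h) := fun f => ampleAbove_apex (hc f) (hoff f)

/-- the two-cell design `y − x` (multiplicity one each). -/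
def twoCell (y x : Cell) : Design := ⟨[(y, 1)], [(x, 1)]⟩

theorem suppN_twoCell (y x : Cell) : (twoCell y x).suppN = [y] := rfl
theorem suppP_twoCell (y x : Cell) : (twoCell y x).suppP = [x] := rfl

theorem twoCell_A4 {y x : Cell} (hl : Live x y) : (twoCell y x).A4 := by
  rw [Design.A4, suppN_twoCell, suppP_twoCell]
  refine ⟨fun x' hx' => ⟨y, List.mem_singleton.mpr rfl, ?_⟩, fun y' hy' => ⟨x, List.mem_singleton.mpr rfl, ?_⟩⟩
  · rw [List.mem_singleton.mp hx']; exact hl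
  · rw [List.mem_singleton.mp hy']; exact hl

theorem twoCell_onAlphabet {h : ℤ} {y x : Cell} (hy : ∀ f, (y f).OnAlphabet h) (hx : ∀ f, (x f).OnAlphabet h) :
    (twoCell y x).OnAlphabet h := by
  intro c hc f
  rw [suppN_twoCell, suppP_twoCell] at hc
  rcases List.mem_append.mp hc with h1 | h1
  · rw [List.mem_singleton.mp h1]; exact hy f
  · rw [List.mem_singleton.mp h1]; exact hx f

theorem twoCell_suppIn {S : Finset Cell} {y x : Cell} (hy : y ∈ S) (hx : x ∈ S) : SuppIn (twoCell y x) S := by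
  intro c hc
  rw [suppN_twoCell, suppP_twoCell] at hc
  rcases List.mem_append.mp hc with h1 | h1
  · rw [List.mem_singleton.mp h1]; exact hy
  · rw [List.mem_singleton.mp h1]; exact hx

/-- `A4Cover U h`: `U` carries every (A4) design on the height-`h` alphabet (no (A1), no budget, no rank: the letter axioms only). -/
def A4Cover (U : Finset Cell) (h : ℤ) : Prop := ∀ D : Design, D.OnAlphabet h → D.A4 → SuppIn D U

theorem a4Cover_coverA4 (h : ℤ) : A4Cover (coverA4 h) h := by
  intro D hA h4 c hc
  rw [coverA4, Finset.mem_filter]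
  refine ⟨mem_cellsOn.mpr (hA c hc), ?_⟩
  rcases List.mem_append.mp hc with hN | hP
  · exact Or.inl (fun f => n_letter_two_le hA h4 hN f)
  · exact Or.inr (fun f => p_letter_offaxis hA h4 hP f)

theorem A4Cover.covers {U : Finset Cell} {h : ℤ} (hU : A4Cover U h) (B : ℕ) (rmin : ℤ) : Covers U h B rmin :=
  fun D hA _ h4 _ _ _ => hU D hA h4

/-- §9.5 SATURATION: every cell of `coverA4 h` is in the support of a two-cell design `OnAlphabet h ∧ A4` supported in
`coverA4 h`. -/
theorem coverA4_saturated {h : ℤ} {c : Cell} (hc : c ∈ coverA4 h) :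
    ∃ D : Design, D.OnAlphabet h ∧ D.A4 ∧ SuppIn D (coverA4 h) ∧ c ∈ D.suppN ++ D.suppP := by
  have hc' := hc
  rw [coverA4, Finset.mem_filter, mem_cellsOn] at hc'
  obtain ⟨hcA, hN | hP⟩ := hc'
  · -- N-type cell: live over its off-axis drop
    have hdA : ∀ f, (dropCell c f).OnAlphabet h := fun f => dropLetter_onAlphabet (hcA f) (hN f)
    have hd : dropCell c ∈ coverA4 h := by
      rw [coverA4, Finset.mem_filter, mem_cellsOn]
      exact ⟨hdA, Or.inr (fun f => dropLetter_offaxis (c f))⟩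
    exact ⟨twoCell c (dropCell c), twoCell_onAlphabet hcA hdA, twoCell_A4 (live_dropCell c), twoCell_suppIn hc hd,
      by rw [suppN_twoCell, suppP_twoCell]; exact List.mem_append_left _ (List.mem_singleton.mpr rfl)⟩
  · -- off-axis cell: live under the apex cell
    have e0 := (hcA 0).1
    have a0 := (hcA 0).2
    unfold Letter.height at e0
    have hx0 : (c 0).x ≠ 0 := fun h0 => hP 0 (by rw [h0, zero_mul])
    have hy0 : (c 0).y ≠ 0 := fun h0 => hP 0 (by rw [h0, mul_zero])
    have hx1 : 1 ≤ |(c 0).x| := Int.one_le_abs hx0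
    have hy1 : 1 ≤ |(c 0).y| := Int.one_le_abs hy0
    have h2 : 2 ≤ h := by omega
    have haA : ∀ f, (apexCell h f).OnAlphabet h := fun _ => by
      refine ⟨?_, by show 0 ≤ h; omega⟩
      show h + |(0 : ℤ)| + |(0 : ℤ)| = h
      rw [abs_zero]; ring
    have ha : apexCell h ∈ coverA4 h := by
      rw [coverA4, Finset.mem_filter, mem_cellsOn]
      exact ⟨haA, Or.inl (fun _ => by show 2 ≤ h; exact h2)⟩
    exact ⟨twoCell (apexCell h) c, twoCell_onAlphabet haA hcA, twoCell_A4 (live_apexCell hcA hP), twoCell_suppIn ha hc,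
      by rw [suppN_twoCell, suppP_twoCell]; exact List.mem_append_right _ (List.mem_singleton.mpr rfl)⟩

/-- hence `coverA4 h` is the LEAST (A4)+alphabet cover: THE BOTTOM OF THE (A4) DIAL. At `h = 6` no union cover obtained from
the letter axioms alone has fewer than `15 453 985` cells; every further shrink is an (A1) ∕ μ ∕ budget fact. -/
theorem coverA4_least {h : ℤ} {U : Finset Cell} (hU : A4Cover U h) : coverA4 h ⊆ U := by
  intro c hc
  obtain ⟨D, hA, h4, -, hcD⟩ := coverA4_saturated hc
  exact hU D hA h4 c hcD

theorem coverA4_isLeast (h : ℤ) : A4Cover (coverA4 h) h ∧ ∀ U : Finset Cell, A4Cover U h → coverA4 h ⊆ U :=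
  ⟨a4Cover_coverA4 h, fun _ hU => coverA4_least hU⟩

/-- and the saturating designs even have `copies = 2` and `rank = 0`: the least cover is attained inside every budget `B ≥ 2`
(the obstruction to shrinking is not the budget but the absence of (A1) ∕ μ in `A4Cover`). -/
theorem twoCell_copies_rank (y x : Cell) : (twoCell y x).copies = 2 ∧ (twoCell y x).rank = 0 := ⟨rfl, rfl⟩

end saturation


/-! ## §10 (w3) THE FIRST KERNEL FAMILY-MASS LEMMA AT `h = 6` (director R19.480 (2) (w3); STRENGTHEN-MEMO-17 §7)

A balanced e-free CERTIFICATE FUNCTIONAL `Ψ : Cell → ℤ` (an integer combination of the eleven e-free word-orbit sums, found as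
the optimum of the exact S₄-profile LP of the cycle and CHECKED HERE BY THE KERNEL, not by the LP):
* BALANCE `Psi_balance`: for every (A1) design supported in `S`, `Σ_{c∈S} (m_N − m_P)(c)·Ψ(c) = 0` — only (A1.2) «e-free words
  of equal degree agree» is used (the orbit sums of a degree class are proportional to their sizes: `sum_mO_rel`);
* SIGNS (kernel `decide` over SORTED tuples of representative letters, `495 + 495` cells, transported to all cells by the S₄ slot
  symmetry `Psi_comp` (`Tuple.sort`) and by `Psi_congr` — `Ψ(c)` depends only on the multiset of profiles `(a, a² − |β|²)`): `Ψ ≤ 9216` on every N-type cell of the alphabet (`Psi_le_of_N`),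
  `Ψ ≥ 0` on every P-type cell (`Psi_nonneg_of_P`), `Ψ = 214 272` on the deepest floor family `(0;±3,±3)⁴` (256 cells) and
  `Ψ = 158 400` on the family `{(0;±4,±2),(0;±2,±4)}⁴` (4 096 cells);
* hence **`deep18_family_mass_le : Σ_{c ∈ (0;±3,±3)⁴} m_P(c) ≤ 8`** and **`deep20_family_mass_le : Σ_{c ∈ (0;{4,2})⁴} m_P(c) ≤ 10`**
  for EVERY admissible design at `(h, B) = (6, 199)` (any rank): `214272·x ≤ Σ_P m_PΨ = Σ_N m_NΨ ≤ 9216·Σ_N m_N ≤ 9216·(199 − x)`.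
WHAT THIS IS: a family-mass lemma à la `DeepCellBudget §11` (there: `h = 14`, all-floor family, `≤ 33`, vertex machinery), now at
the deciding storey's other end `h = 6`, with a self-contained balanced-certificate proof (no vertex reduction: finite `decide`).
WHAT IT IS FOR ORDER P: two KNAPSACK ROWS with proved constants (`Σ_{X₁₈} m_P ≤ 8`, `Σ_{X₂₀} m_P ≤ 10`) — valid global cuts for
the exact search at `(6, 199, 8)`; NOT of law type (threshold `8 ∕ 10`, not `≤ 1`), so not a leaf-closure rule; and NOT a cover
shrink (no cell is excluded: the LP optimum `Φ = 23.25` is far below the exclusion value `197`, MEMO-17 §7). Numbers for the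
dial: `|U₆|` unchanged (`15 453 985`); function-space reading: on the `256 + 4 096` family cells the P-range `0…199` is replaced by
the two mass rows. Nothing toward HC ∕ HC_CM ∕ HC_AV ∕ №4 ∕ 26512 ∕ 18881 ∕ H2; not a rung. -/

section familyMass

/-- §10.1 integer features of a letter for the e-free symbols: `1 ↦ 1`, `h ↦ a`, `pt ↦ n = a² − |β|²` (`e, ē ↦ 0`, unused). -/
def featZ : Sym → Letter → ℤ
  | .one, _ => 1
  | .h, ℓ => ℓ.a
  | .pt, ℓ => ℓ.selfInt
  | .e, _ => 0
  | .ebar, _ => 0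

theorem coef_eq_featZ (s : Sym) (hs : s.efree = true) (ℓ : Letter) : s.coef ℓ = (featZ s ℓ : GaussianInt) := by
  cases s
  · simp [Sym.coef, featZ]
  · simp [Sym.coef, featZ]
  · simp [Sym.efree] at hs
  · simp [Sym.efree] at hs
  · simp [Sym.coef, featZ]

theorem featZ_congr (s : Sym) {ℓ ℓ' : Letter} (ha : ℓ.a = ℓ'.a) (hn : ℓ.selfInt = ℓ'.selfInt) : featZ s ℓ = featZ s ℓ' := by
  cases s
  · rfl
  · exact ha
  · rfl
  · rfl
  · exact hn

/-- the integer cell coefficient of an e-free word (explicit four-fold product, kernel-evaluable). -/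
def ccZ (c : Cell) (u : Word) : ℤ := featZ (u 0) (c 0) * featZ (u 1) (c 1) * featZ (u 2) (c 2) * featZ (u 3) (c 3)

theorem cellCoef_eq_ccZ (c : Cell) {u : Word} (hu : u.efree) : cellCoef c u = (ccZ c u : GaussianInt) := by
  unfold cellCoef ccZ
  rw [Fin.prod_univ_four, coef_eq_featZ _ (hu 0), coef_eq_featZ _ (hu 1), coef_eq_featZ _ (hu 2), coef_eq_featZ _ (hu 3)]
  push_cast
  ring

theorem ccZ_congr {c c' : Cell} (h : ∀ f, (c f).a = (c' f).a ∧ (c f).selfInt = (c' f).selfInt) (u : Word) :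
    ccZ c u = ccZ c' u := by
  unfold ccZ
  rw [featZ_congr (u 0) (h 0).1 (h 0).2, featZ_congr (u 1) (h 1).1 (h 1).2, featZ_congr (u 2) (h 2).1 (h 2).2,
    featZ_congr (u 3) (h 3).1 (h 3).2]

/-- the orbit sum of integer coefficients over a word list. -/
def mO (O : List Word) (c : Cell) : ℤ := (O.map (ccZ c)).sum

theorem mO_congr {c c' : Cell} (h : ∀ f, (c f).a = (c' f).a ∧ (c f).selfInt = (c' f).selfInt) (O : List Word) :
    mO O c = mO O c' := by
  unfold mO
  rw [List.map_congr_left (fun u _ => ccZ_congr h u)]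

/-! ### §10.2 the eleven e-free word orbits `O_jk` (`j` slots `h`, `k` slots `pt`) and the functional `Ψ` -/

/-- the e-free words with 2 slot(s) `h` and 0 slot(s) `pt` (6 words, degree 2). -/
def O20 : List Word :=
  [![Sym.one, Sym.one, Sym.h, Sym.h],
   ![Sym.one, Sym.h, Sym.one, Sym.h],
   ![Sym.one, Sym.h, Sym.h, Sym.one],
   ![Sym.h, Sym.one, Sym.one, Sym.h],
   ![Sym.h, Sym.one, Sym.h, Sym.one],
   ![Sym.h, Sym.h, Sym.one, Sym.one]]

/-- the e-free words with 0 slot(s) `h` and 1 slot(s) `pt` (4 words, degree 2). -/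
def O01 : List Word :=
  [![Sym.one, Sym.one, Sym.one, Sym.pt],
   ![Sym.one, Sym.one, Sym.pt, Sym.one],
   ![Sym.one, Sym.pt, Sym.one, Sym.one],
   ![Sym.pt, Sym.one, Sym.one, Sym.one]]

/-- the e-free words with 3 slot(s) `h` and 0 slot(s) `pt` (4 words, degree 3). -/
def O30 : List Word :=
  [![Sym.one, Sym.h, Sym.h, Sym.h],
   ![Sym.h, Sym.one, Sym.h, Sym.h],
   ![Sym.h, Sym.h, Sym.one, Sym.h],
   ![Sym.h, Sym.h, Sym.h, Sym.one]]

/-- the e-free words with 1 slot(s) `h` and 1 slot(s) `pt` (12 words, degree 3). -/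
def O11 : List Word :=
  [![Sym.one, Sym.one, Sym.h, Sym.pt],
   ![Sym.one, Sym.one, Sym.pt, Sym.h],
   ![Sym.one, Sym.h, Sym.one, Sym.pt],
   ![Sym.one, Sym.h, Sym.pt, Sym.one],
   ![Sym.one, Sym.pt, Sym.one, Sym.h],
   ![Sym.one, Sym.pt, Sym.h, Sym.one],
   ![Sym.h, Sym.one, Sym.one, Sym.pt],
   ![Sym.h, Sym.one, Sym.pt, Sym.one],
   ![Sym.h, Sym.pt, Sym.one, Sym.one],
   ![Sym.pt, Sym.one, Sym.one, Sym.h],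
   ![Sym.pt, Sym.one, Sym.h, Sym.one],
   ![Sym.pt, Sym.h, Sym.one, Sym.one]]

/-- the e-free words with 4 slot(s) `h` and 0 slot(s) `pt` (1 words, degree 4). -/
def O40 : List Word :=
  [![Sym.h, Sym.h, Sym.h, Sym.h]]

/-- the e-free words with 2 slot(s) `h` and 1 slot(s) `pt` (12 words, degree 4). -/
def O21 : List Word :=
  [![Sym.one, Sym.h, Sym.h, Sym.pt],
   ![Sym.one, Sym.h, Sym.pt, Sym.h],
   ![Sym.one, Sym.pt, Sym.h, Sym.h],
   ![Sym.h, Sym.one, Sym.h, Sym.pt],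
   ![Sym.h, Sym.one, Sym.pt, Sym.h],
   ![Sym.h, Sym.h, Sym.one, Sym.pt],
   ![Sym.h, Sym.h, Sym.pt, Sym.one],
   ![Sym.h, Sym.pt, Sym.one, Sym.h],
   ![Sym.h, Sym.pt, Sym.h, Sym.one],
   ![Sym.pt, Sym.one, Sym.h, Sym.h],
   ![Sym.pt, Sym.h, Sym.one, Sym.h],
   ![Sym.pt, Sym.h, Sym.h, Sym.one]]

/-- the e-free words with 0 slot(s) `h` and 2 slot(s) `pt` (6 words, degree 4). -/
def O02 : List Word :=
  [![Sym.one, Sym.one, Sym.pt, Sym.pt],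
   ![Sym.one, Sym.pt, Sym.one, Sym.pt],
   ![Sym.one, Sym.pt, Sym.pt, Sym.one],
   ![Sym.pt, Sym.one, Sym.one, Sym.pt],
   ![Sym.pt, Sym.one, Sym.pt, Sym.one],
   ![Sym.pt, Sym.pt, Sym.one, Sym.one]]

/-- the e-free words with 3 slot(s) `h` and 1 slot(s) `pt` (4 words, degree 5). -/
def O31 : List Word :=
  [![Sym.h, Sym.h, Sym.h, Sym.pt],
   ![Sym.h, Sym.h, Sym.pt, Sym.h],
   ![Sym.h, Sym.pt, Sym.h, Sym.h],
   ![Sym.pt, Sym.h, Sym.h, Sym.h]]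

/-- the e-free words with 1 slot(s) `h` and 2 slot(s) `pt` (12 words, degree 5). -/
def O12 : List Word :=
  [![Sym.one, Sym.h, Sym.pt, Sym.pt],
   ![Sym.one, Sym.pt, Sym.h, Sym.pt],
   ![Sym.one, Sym.pt, Sym.pt, Sym.h],
   ![Sym.h, Sym.one, Sym.pt, Sym.pt],
   ![Sym.h, Sym.pt, Sym.one, Sym.pt],
   ![Sym.h, Sym.pt, Sym.pt, Sym.one],
   ![Sym.pt, Sym.one, Sym.h, Sym.pt],
   ![Sym.pt, Sym.one, Sym.pt, Sym.h],
   ![Sym.pt, Sym.h, Sym.one, Sym.pt],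
   ![Sym.pt, Sym.h, Sym.pt, Sym.one],
   ![Sym.pt, Sym.pt, Sym.one, Sym.h],
   ![Sym.pt, Sym.pt, Sym.h, Sym.one]]

/-- the e-free words with 2 slot(s) `h` and 2 slot(s) `pt` (6 words, degree 6). -/
def O22 : List Word :=
  [![Sym.h, Sym.h, Sym.pt, Sym.pt],
   ![Sym.h, Sym.pt, Sym.h, Sym.pt],
   ![Sym.h, Sym.pt, Sym.pt, Sym.h],
   ![Sym.pt, Sym.h, Sym.h, Sym.pt],
   ![Sym.pt, Sym.h, Sym.pt, Sym.h],
   ![Sym.pt, Sym.pt, Sym.h, Sym.h]]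

/-- the e-free words with 0 slot(s) `h` and 3 slot(s) `pt` (4 words, degree 6). -/
def O03 : List Word :=
  [![Sym.one, Sym.pt, Sym.pt, Sym.pt],
   ![Sym.pt, Sym.one, Sym.pt, Sym.pt],
   ![Sym.pt, Sym.pt, Sym.one, Sym.pt],
   ![Sym.pt, Sym.pt, Sym.pt, Sym.one]]

set_option maxRecDepth 65536 in
theorem O20_ok : ∀ u ∈ O20, u.efree ∧ u.deg = 2 := by decide +kernel
theorem O20_len : O20.length = 6 := rfl
set_option maxRecDepth 65536 in
theorem O01_ok : ∀ u ∈ O01, u.efree ∧ u.deg = 2 := by decide +kernel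
theorem O01_len : O01.length = 4 := rfl
set_option maxRecDepth 65536 in
theorem O30_ok : ∀ u ∈ O30, u.efree ∧ u.deg = 3 := by decide +kernel
theorem O30_len : O30.length = 4 := rfl
set_option maxRecDepth 65536 in
theorem O11_ok : ∀ u ∈ O11, u.efree ∧ u.deg = 3 := by decide +kernel
theorem O11_len : O11.length = 12 := rfl
set_option maxRecDepth 65536 in
theorem O40_ok : ∀ u ∈ O40, u.efree ∧ u.deg = 4 := by decide +kernel
theorem O40_len : O40.length = 1 := rfl
set_option maxRecDepth 65536 in
theorem O21_ok : ∀ u ∈ O21, u.efree ∧ u.deg = 4 := by decide +kernel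
theorem O21_len : O21.length = 12 := rfl
set_option maxRecDepth 65536 in
theorem O02_ok : ∀ u ∈ O02, u.efree ∧ u.deg = 4 := by decide +kernel
theorem O02_len : O02.length = 6 := rfl
set_option maxRecDepth 65536 in
theorem O31_ok : ∀ u ∈ O31, u.efree ∧ u.deg = 5 := by decide +kernel
theorem O31_len : O31.length = 4 := rfl
set_option maxRecDepth 65536 in
theorem O12_ok : ∀ u ∈ O12, u.efree ∧ u.deg = 5 := by decide +kernel
theorem O12_len : O12.length = 12 := rfl
set_option maxRecDepth 65536 in
theorem O22_ok : ∀ u ∈ O22, u.efree ∧ u.deg = 6 := by decide +kernel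
theorem O22_len : O22.length = 6 := rfl
set_option maxRecDepth 65536 in
theorem O03_ok : ∀ u ∈ O03, u.efree ∧ u.deg = 6 := by decide +kernel
theorem O03_len : O03.length = 4 := rfl

/-- THE CERTIFICATE FUNCTIONAL `Ψ = 9216·Φ` (Φ the optimal S₄-profile certificate of the exact LP for the deepest floor family at
`h = 6`, STRENGTHEN-MEMO-17 §7): an integer combination of the eleven e-free orbit sums. -/
def Psi (c : Cell) : ℤ :=
  mO O20 c * (13000) + (mO O01 c * (-19500) + (mO O30 c * (-14286) + (mO O11 c * (4762) + (mO O40 c * (10440) + (mO O21 c * (-438) + (mO O02 c * (-864) + (mO O31 c * (-471) + (mO O12 c * (157) + (mO O22 c * (14) + (mO O03 c * (-21)))))))))))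


theorem Psi_congr {c c' : Cell} (h : ∀ f, (c f).a = (c' f).a ∧ (c f).selfInt = (c' f).selfInt) : Psi c = Psi c' := by
  unfold Psi
  simp only [mO_congr h]

/-! ### §10.3 BALANCE from (A1.2) -/

/-- for an e-free word, `T` is the cast of the integer functional over any supporting cell set. -/
theorem T_efree_eq {D : Design} {S : Finset Cell} (hS : SuppIn D S) {u : Word} (hu : u.efree) :
    D.T u = ((∑ c ∈ S, ((D.mN c : ℤ) - D.mP c) * ccZ c u : ℤ) : GaussianInt) := by
  rw [T_eq_sum hS u, ← Finset.sum_sub_distrib]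
  push_cast
  refine Finset.sum_congr rfl (fun c _ => ?_)
  rw [cellCoef_eq_ccZ c hu]
  ring

theorem T_list_sum {D : Design} {S : Finset Cell} (hS : SuppIn D S) (O : List Word) (hO : ∀ u ∈ O, u.efree) :
    (O.map D.T).sum = ((∑ c ∈ S, ((D.mN c : ℤ) - D.mP c) * mO O c : ℤ) : GaussianInt) := by
  induction O with
  | nil => simp [mO]
  | cons u O ih =>
    have hu : u.efree := hO u (by simp)
    have hO' : ∀ v ∈ O, v.efree := fun v hv => hO v (by simp [hv])
    rw [List.map_cons, List.sum_cons, ih hO', T_efree_eq hS hu]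
    simp only [mO, List.map_cons, List.sum_cons]
    push_cast
    rw [← Finset.sum_add_distrib]
    exact Finset.sum_congr rfl (fun c _ => by ring)

/-- (A1.2): on a list of e-free words of one degree `d`, `T` is constant. -/
theorem T_list_const {D : Design} (h1 : D.A1) (O : List Word) (u₀ : Word) (hu₀ : u₀.efree) (d : ℕ) (hd₀ : u₀.deg = d)
    (hO : ∀ u ∈ O, u.efree ∧ u.deg = d) : (O.map D.T).sum = (O.length : GaussianInt) * D.T u₀ := by
  induction O with
  | nil => simp
  | cons u O ih =>
    have hu := hO u (by simp)
    have hO' : ∀ v ∈ O, v.efree ∧ v.deg = d := fun v hv => hO v (by simp [hv])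
    rw [List.map_cons, List.sum_cons, ih hO', h1.2 u u₀ hu.1 hu₀ (by rw [hu.2, hd₀]), List.length_cons]
    push_cast
    ring

/-- two orbit sums of the same degree are proportional to the orbit sizes (integer form of (A1.2)). -/
theorem sum_mO_rel {D : Design} {S : Finset Cell} (hS : SuppIn D S) (h1 : D.A1) (O O' : List Word) (u₀ : Word)
    (hu₀ : u₀.efree) (d : ℕ) (hd₀ : u₀.deg = d) (hO : ∀ u ∈ O, u.efree ∧ u.deg = d) (hO' : ∀ u ∈ O', u.efree ∧ u.deg = d) :
    (O'.length : ℤ) * ∑ c ∈ S, ((D.mN c : ℤ) - D.mP c) * mO O c =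
      (O.length : ℤ) * ∑ c ∈ S, ((D.mN c : ℤ) - D.mP c) * mO O' c := by
  have e1 := T_list_sum hS O (fun u hu => (hO u hu).1)
  have e2 := T_list_sum hS O' (fun u hu => (hO' u hu).1)
  have c1 := T_list_const h1 O u₀ hu₀ d hd₀ hO
  have c2 := T_list_const h1 O' u₀ hu₀ d hd₀ hO'
  have H : (((O'.length : ℤ) * ∑ c ∈ S, ((D.mN c : ℤ) - D.mP c) * mO O c : ℤ) : GaussianInt) =
      (((O.length : ℤ) * ∑ c ∈ S, ((D.mN c : ℤ) - D.mP c) * mO O' c : ℤ) : GaussianInt) := by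
    rw [Int.cast_mul, Int.cast_mul, ← e1, ← e2, c1, c2]
    push_cast
    ring
  exact_mod_cast H

theorem sum_mul_Psi (S : Finset Cell) (w : Cell → ℤ) :
    ∑ c ∈ S, w c * Psi c =
      (∑ c ∈ S, w c * mO O20 c) * 13000 + ((∑ c ∈ S, w c * mO O01 c) * (-19500) + ((∑ c ∈ S, w c * mO O30 c) * (-14286) +
      ((∑ c ∈ S, w c * mO O11 c) * 4762 + ((∑ c ∈ S, w c * mO O40 c) * 10440 + ((∑ c ∈ S, w c * mO O21 c) * (-438) +
      ((∑ c ∈ S, w c * mO O02 c) * (-864) + ((∑ c ∈ S, w c * mO O31 c) * (-471) + ((∑ c ∈ S, w c * mO O12 c) * 157 +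
      ((∑ c ∈ S, w c * mO O22 c) * 14 + (∑ c ∈ S, w c * mO O03 c) * (-21)))))))))) := by
  simp only [Finset.sum_mul, ← Finset.sum_add_distrib]
  exact Finset.sum_congr rfl (fun c _ => by unfold Psi; ring)

/-- **BALANCE.** `Σ_{c∈S} (m_N − m_P)(c) · Ψ(c) = 0` for every (A1) design supported in `S`. -/
theorem Psi_balance {D : Design} {S : Finset Cell} (hS : SuppIn D S) (h1 : D.A1) :
    ∑ c ∈ S, ((D.mN c : ℤ) - D.mP c) * Psi c = 0 := by
  have u2f : Word.efree ![Sym.h, Sym.h, Sym.one, Sym.one] := (O20_ok _ (by simp [O20])).1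
  have u2d : Word.deg ![Sym.h, Sym.h, Sym.one, Sym.one] = 2 := (O20_ok _ (by simp [O20])).2
  have u3f : Word.efree ![Sym.h, Sym.h, Sym.h, Sym.one] := (O30_ok _ (by simp [O30])).1
  have u3d : Word.deg ![Sym.h, Sym.h, Sym.h, Sym.one] = 3 := (O30_ok _ (by simp [O30])).2
  have u4f : Word.efree ![Sym.h, Sym.h, Sym.h, Sym.h] := (O40_ok _ (by simp [O40])).1
  have u4d : Word.deg ![Sym.h, Sym.h, Sym.h, Sym.h] = 4 := (O40_ok _ (by simp [O40])).2
  have u5f : Word.efree ![Sym.h, Sym.h, Sym.h, Sym.pt] := (O31_ok _ (by simp [O31])).1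
  have u5d : Word.deg ![Sym.h, Sym.h, Sym.h, Sym.pt] = 5 := (O31_ok _ (by simp [O31])).2
  have u6f : Word.efree ![Sym.h, Sym.h, Sym.pt, Sym.pt] := (O22_ok _ (by simp [O22])).1
  have u6d : Word.deg ![Sym.h, Sym.h, Sym.pt, Sym.pt] = 6 := (O22_ok _ (by simp [O22])).2
  have r2 := sum_mO_rel hS h1 O20 O01 _ u2f 2 u2d O20_ok O01_ok
  have r3 := sum_mO_rel hS h1 O30 O11 _ u3f 3 u3d O30_ok O11_ok
  have r4 := sum_mO_rel hS h1 O40 O21 _ u4f 4 u4d O40_ok O21_ok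
  have r4' := sum_mO_rel hS h1 O21 O02 _ u4f 4 u4d O21_ok O02_ok
  have r5 := sum_mO_rel hS h1 O31 O12 _ u5f 5 u5d O31_ok O12_ok
  have r6 := sum_mO_rel hS h1 O22 O03 _ u6f 6 u6d O22_ok O03_ok
  rw [O20_len, O01_len] at r2
  rw [O30_len, O11_len] at r3
  rw [O40_len, O21_len] at r4
  rw [O21_len, O02_len] at r4'
  rw [O31_len, O12_len] at r5
  rw [O22_len, O03_len] at r6
  rw [sum_mul_Psi]
  push_cast at r2 r3 r4 r4' r5 r6
  omega

/-! ### §10.4 S₄-SYMMETRY of `Ψ` (slot permutations) — used to cut the sign checks from `9⁴` to the `495` sorted tuples -/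

/-- letter counts of a word (as sums over the four slots, so that slot permutations visibly preserve them). -/
def cntH (u : Word) : ℕ := ∑ f, if u f = Sym.h then 1 else 0
/-- (see `cntH`) -/
def cntP (u : Word) : ℕ := ∑ f, if u f = Sym.pt then 1 else 0
/-- number of `e ∕ ē` slots. -/
def cntE (u : Word) : ℕ := ∑ f, if (u f).efree = true then 0 else 1

/-- the orbit predicate: e-free with `j` slots `h` and `k` slots `pt`. -/
def inOrb (j k : ℕ) (u : Word) : Prop := cntE u = 0 ∧ cntH u = j ∧ cntP u = k

instance decInOrb (j k : ℕ) (u : Word) : Decidable (inOrb j k u) := by unfold inOrb; infer_instance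

theorem cntH_comp (u : Word) (τ : Equiv.Perm (Fin 4)) : cntH (u ∘ τ) = cntH u := by
  show (∑ f, if u (τ f) = Sym.h then 1 else 0) = _
  exact Equiv.sum_comp τ (fun f => if u f = Sym.h then 1 else 0)
theorem cntP_comp (u : Word) (τ : Equiv.Perm (Fin 4)) : cntP (u ∘ τ) = cntP u := by
  show (∑ f, if u (τ f) = Sym.pt then 1 else 0) = _
  exact Equiv.sum_comp τ (fun f => if u f = Sym.pt then 1 else 0)
theorem cntE_comp (u : Word) (τ : Equiv.Perm (Fin 4)) : cntE (u ∘ τ) = cntE u := by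
  show (∑ f, if (u (τ f)).efree = true then 0 else 1) = _
  exact Equiv.sum_comp τ (fun f => if (u f).efree = true then 0 else 1)

theorem inOrb_comp (j k : ℕ) (u : Word) (τ : Equiv.Perm (Fin 4)) : inOrb j k (u ∘ τ) ↔ inOrb j k u := by
  simp only [inOrb, cntH_comp, cntP_comp, cntE_comp]

/-- the orbit lists ARE the orbits (kernel `decide` over the `625` words). -/
theorem O20_char : O20.Nodup ∧ ∀ u : Word, u ∈ O20 ↔ inOrb 2 0 u := by decide +kernel
theorem O01_char : O01.Nodup ∧ ∀ u : Word, u ∈ O01 ↔ inOrb 0 1 u := by decide +kernel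
theorem O30_char : O30.Nodup ∧ ∀ u : Word, u ∈ O30 ↔ inOrb 3 0 u := by decide +kernel
theorem O11_char : O11.Nodup ∧ ∀ u : Word, u ∈ O11 ↔ inOrb 1 1 u := by decide +kernel
theorem O40_char : O40.Nodup ∧ ∀ u : Word, u ∈ O40 ↔ inOrb 4 0 u := by decide +kernel
theorem O21_char : O21.Nodup ∧ ∀ u : Word, u ∈ O21 ↔ inOrb 2 1 u := by decide +kernel
theorem O02_char : O02.Nodup ∧ ∀ u : Word, u ∈ O02 ↔ inOrb 0 2 u := by decide +kernel
theorem O31_char : O31.Nodup ∧ ∀ u : Word, u ∈ O31 ↔ inOrb 3 1 u := by decide +kernel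
theorem O12_char : O12.Nodup ∧ ∀ u : Word, u ∈ O12 ↔ inOrb 1 2 u := by decide +kernel
theorem O22_char : O22.Nodup ∧ ∀ u : Word, u ∈ O22 ↔ inOrb 2 2 u := by decide +kernel
theorem O03_char : O03.Nodup ∧ ∀ u : Word, u ∈ O03 ↔ inOrb 0 3 u := by decide +kernel

/-- an orbit sum as a `Finset` sum over the orbit predicate. -/
theorem mO_eq_sum {O : List Word} {j k : ℕ} (hO : O.Nodup ∧ ∀ u : Word, u ∈ O ↔ inOrb j k u) (c : Cell) :
    mO O c = ∑ u ∈ Finset.univ.filter (inOrb j k), ccZ c u := by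
  have e : O.toFinset = Finset.univ.filter (inOrb j k) := by
    ext u
    simp only [List.mem_toFinset, Finset.mem_filter, Finset.mem_univ, true_and]
    exact hO.2 u
  rw [mO, ← List.sum_toFinset _ hO.1, e]

theorem ccZ_eq_prod (c : Cell) (u : Word) : ccZ c u = ∏ f, featZ (u f) (c f) := by
  rw [Fin.prod_univ_four]; rfl

/-- permuting the slots of the cell = permuting the slots of the word the other way. -/
theorem ccZ_comp (c : Cell) (σ : Equiv.Perm (Fin 4)) (u : Word) : ccZ (c ∘ σ) u = ccZ c (u ∘ σ.symm) := by
  rw [ccZ_eq_prod, ccZ_eq_prod, ← Equiv.prod_comp σ (fun g => featZ ((u ∘ σ.symm) g) (c g))]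
  simp only [Function.comp, Equiv.symm_apply_apply]

/-- slot permutation as an equivalence of words. -/
def permWord (σ : Equiv.Perm (Fin 4)) : Word ≃ Word where
  toFun u := u ∘ σ.symm
  invFun u := u ∘ σ
  left_inv u := by funext f; simp
  right_inv u := by funext f; simp

theorem orbSum_comp (j k : ℕ) (c : Cell) (σ : Equiv.Perm (Fin 4)) :
    ∑ u ∈ Finset.univ.filter (inOrb j k), ccZ (c ∘ σ) u = ∑ u ∈ Finset.univ.filter (inOrb j k), ccZ c u := by
  rw [Finset.sum_filter, Finset.sum_filter]
  refine Fintype.sum_equiv (permWord σ) _ _ (fun u => ?_)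
  show (if inOrb j k u then ccZ (c ∘ σ) u else 0) = (if inOrb j k (u ∘ σ.symm) then ccZ c (u ∘ σ.symm) else 0)
  simp only [inOrb_comp, ccZ_comp]

/-- **`Ψ` is invariant under slot permutations.** -/
theorem Psi_comp (c : Cell) (σ : Equiv.Perm (Fin 4)) : Psi (c ∘ σ) = Psi c := by
  simp only [Psi, mO_eq_sum O20_char, mO_eq_sum O01_char, mO_eq_sum O30_char, mO_eq_sum O11_char, mO_eq_sum O40_char,
    mO_eq_sum O21_char, mO_eq_sum O02_char, mO_eq_sum O31_char, mO_eq_sum O12_char, mO_eq_sum O22_char, mO_eq_sum O03_char,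
    orbSum_comp]

/-! ### §10.5 SIGNS and VALUES by kernel `decide` on SORTED tuples of representative letters (`495 + 495` cells) -/

/-- one letter per N-profile `(a, a² − |β|²)` of the height-6 alphabet (`a ≥ 2`). -/
def RepNv : Fin 9 → Letter := ![⟨2, 4, 0⟩, ⟨2, 3, 1⟩, ⟨2, 2, 2⟩, ⟨3, 3, 0⟩, ⟨3, 2, 1⟩, ⟨4, 2, 0⟩, ⟨4, 1, 1⟩, ⟨5, 1, 0⟩, ⟨6, 0, 0⟩]
/-- one letter per P-profile of the height-6 alphabet (off-axis, `a ≤ 4`). -/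
def RepPv : Fin 9 → Letter := ![⟨0, 5, 1⟩, ⟨0, 4, 2⟩, ⟨0, 3, 3⟩, ⟨1, 4, 1⟩, ⟨1, 3, 2⟩, ⟨2, 3, 1⟩, ⟨2, 2, 2⟩, ⟨3, 2, 1⟩, ⟨4, 1, 1⟩]

set_option maxRecDepth 65536 in
theorem repN_complete :
    ∀ ℓ ∈ boxList 6 6, 0 ≤ ℓ.a → 2 ≤ ℓ.a → ∃ i : Fin 9, (RepNv i).a = ℓ.a ∧ (RepNv i).selfInt = ℓ.selfInt := by
  decide +kernel
set_option maxRecDepth 65536 in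
theorem repP_complete :
    ∀ ℓ ∈ boxList 6 6, 0 ≤ ℓ.a → ℓ.a ≤ 4 → ℓ.x * ℓ.y ≠ 0 → ∃ i : Fin 9, (RepPv i).a = ℓ.a ∧ (RepPv i).selfInt = ℓ.selfInt := by
  decide +kernel

set_option maxRecDepth 65536 in
set_option maxHeartbeats 4000000 in
/-- `Ψ ≤ 9216` on the `495` sorted representative N-cells (kernel `decide`; all `9⁴` by `Psi_comp`). -/
theorem Psi_repN_sorted : ∀ i0 i1 i2 i3 : Fin 9, i0 ≤ i1 → i1 ≤ i2 → i2 ≤ i3 →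
    Psi ![RepNv i0, RepNv i1, RepNv i2, RepNv i3] ≤ 9216 := by
  decide +kernel

set_option maxRecDepth 65536 in
set_option maxHeartbeats 4000000 in
/-- `Ψ ≥ 0` on the `495` sorted representative P-cells (kernel `decide`). -/
theorem Psi_repP_sorted : ∀ i0 i1 i2 i3 : Fin 9, i0 ≤ i1 → i1 ≤ i2 → i2 ≤ i3 →
    0 ≤ Psi ![RepPv i0, RepPv i1, RepPv i2, RepPv i3] := by
  decide +kernel

/-- the values on the two deepest isotypic floor families. -/
theorem Psi_val_033 : Psi (fun _ : Fin 4 => (⟨0, 3, 3⟩ : Letter)) = 214272 := by decide +kernel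
theorem Psi_val_042 : Psi (fun _ : Fin 4 => (⟨0, 4, 2⟩ : Letter)) = 158400 := by decide +kernel

theorem mem_boxList_six {ℓ : Letter} (hℓ : ℓ.OnAlphabet 6) : ℓ ∈ boxList 6 6 := by
  refine mem_boxList.mpr ⟨hℓ.1, ?_, ?_⟩
  · have e := hℓ.1; have h0 := hℓ.2; unfold Letter.height at e
    have := abs_nonneg ℓ.y; push_cast; omega
  · have e := hℓ.1; have h0 := hℓ.2; unfold Letter.height at e
    have := abs_nonneg ℓ.x; push_cast; omega

/-- sorting the four representative indices: by `Psi_comp` a bound on sorted tuples is a bound on all tuples. -/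
theorem Psi_sorted_transport (R : Fin 9 → Letter) (P : ℤ → Prop)
    (hsorted : ∀ i0 i1 i2 i3 : Fin 9, i0 ≤ i1 → i1 ≤ i2 → i2 ≤ i3 → P (Psi ![R i0, R i1, R i2, R i3]))
    (j : Fin 4 → Fin 9) : P (Psi (R ∘ j)) := by
  have hmono : Monotone (j ∘ ⇑(Tuple.sort j)) := Tuple.monotone_sort j
  rw [← Psi_comp (R ∘ j) (Tuple.sort j)]
  have e : ((R ∘ j) ∘ ⇑(Tuple.sort j) : Cell) =
      ![R (j (Tuple.sort j 0)), R (j (Tuple.sort j 1)), R (j (Tuple.sort j 2)), R (j (Tuple.sort j 3))] := by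
    funext f
    fin_cases f <;> rfl
  rw [e]
  have h01 : j (Tuple.sort j 0) ≤ j (Tuple.sort j 1) := hmono (show (0 : Fin 4) ≤ 1 by decide)
  have h12 : j (Tuple.sort j 1) ≤ j (Tuple.sort j 2) := hmono (show (1 : Fin 4) ≤ 2 by decide)
  have h23 : j (Tuple.sort j 2) ≤ j (Tuple.sort j 3) := hmono (show (2 : Fin 4) ≤ 3 by decide)
  exact hsorted _ _ _ _ h01 h12 h23

/-- `Ψ ≤ 9216` on every N-type cell of the height-6 alphabet. -/
theorem Psi_le_of_N {c : Cell} (hA : ∀ f, (c f).OnAlphabet 6) (h2 : ∀ f, 2 ≤ (c f).a) : Psi c ≤ 9216 := by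
  have hrep : ∀ f, ∃ i : Fin 9, (RepNv i).a = (c f).a ∧ (RepNv i).selfInt = (c f).selfInt := fun f =>
    repN_complete (c f) (mem_boxList_six (hA f)) (hA f).2 (h2 f)
  choose j hj using hrep
  rw [Psi_congr (c' := RepNv ∘ j) (fun f => ⟨(hj f).1.symm, (hj f).2.symm⟩)]
  exact Psi_sorted_transport RepNv (fun v => v ≤ 9216) Psi_repN_sorted j

/-- `Ψ ≥ 0` on every P-type cell of the height-6 alphabet. -/
theorem Psi_nonneg_of_P {c : Cell} (hA : ∀ f, (c f).OnAlphabet 6) (h4 : ∀ f, (c f).a ≤ 4) (hoff : ∀ f, (c f).x * (c f).y ≠ 0) :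
    0 ≤ Psi c := by
  have hrep : ∀ f, ∃ i : Fin 9, (RepPv i).a = (c f).a ∧ (RepPv i).selfInt = (c f).selfInt := fun f =>
    repP_complete (c f) (mem_boxList_six (hA f)) (hA f).2 (h4 f) (hoff f)
  choose j hj using hrep
  rw [Psi_congr (c' := RepPv ∘ j) (fun f => ⟨(hj f).1.symm, (hj f).2.symm⟩)]
  exact Psi_sorted_transport RepPv (fun v => 0 ≤ v) Psi_repP_sorted j

/-! ### §10.6 the two family-mass lemmas -/


/-- the deepest floor family `X₁₈ = (0;±3,±3)⁴` (letters `a = 0`, `a² − |β|² = −18`; 256 cells). -/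
def famDeep18 (c : Cell) : Prop := ∀ f : Fin 4, (c f).a = 0 ∧ (c f).selfInt = -18
/-- the floor family `X₂₀ = {(0;±4,±2),(0;±2,±4)}⁴` (4 096 cells). -/
def famDeep20 (c : Cell) : Prop := ∀ f : Fin 4, (c f).a = 0 ∧ (c f).selfInt = -20

instance decFamDeep18 : DecidablePred famDeep18 := fun c => by unfold famDeep18; infer_instance
instance decFamDeep20 : DecidablePred famDeep20 := fun c => by unfold famDeep20; infer_instance

theorem Psi_of_famDeep18 {c : Cell} (hc : famDeep18 c) : Psi c = 214272 := by
  rw [Psi_congr (c' := fun _ : Fin 4 => (⟨0, 3, 3⟩ : Letter)) (fun f => ⟨(hc f).1, (hc f).2.trans (by decide +kernel)⟩)]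
  exact Psi_val_033

theorem Psi_of_famDeep20 {c : Cell} (hc : famDeep20 c) : Psi c = 158400 := by
  rw [Psi_congr (c' := fun _ : Fin 4 => (⟨0, 4, 2⟩ : Letter)) (fun f => ⟨(hc f).1, (hc f).2.trans (by decide +kernel)⟩)]
  exact Psi_val_042

/-- the mass argument, abstract in the family and in the supporting cell set `S`: a family on which `Ψ = V` has P-mass `x`
with `(V + 9216)·x ≤ 9216·199`. -/
theorem family_mass_core {D : Design} {rmin : ℤ} (hD : Admissible 6 199 rmin D) {S : Finset Cell} (hS : SuppIn D S)
    (X : Cell → Prop) [DecidablePred X] (V : ℤ) (hV : ∀ c, X c → Psi c = V) :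
    (V + 9216) * (∑ c ∈ S.filter X, (D.mP c : ℤ)) ≤ 9216 * 199 := by
  obtain ⟨hA, h1, h4, -, hB, -⟩ := hD
  have hbal := Psi_balance hS h1
  have hN : ∀ c ∈ S, (D.mN c : ℤ) * Psi c ≤ 9216 * D.mN c := by
    intro c _
    by_cases h0 : D.mN c = 0
    · simp [h0]
    · have hy : c ∈ D.suppN := (mem_suppN_iff_pos D c).mpr (Nat.pos_of_ne_zero h0)
      have hle : Psi c ≤ 9216 :=
        Psi_le_of_N (fun f => hA c (List.mem_append_left _ hy) f) (fun f => n_letter_two_le hA h4 hy f)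
      have h0' : (0 : ℤ) ≤ D.mN c := by exact_mod_cast Nat.zero_le _
      have := mul_le_mul_of_nonneg_left hle h0'
      linarith
  have hP : ∀ c ∈ S, 0 ≤ (D.mP c : ℤ) * Psi c := by
    intro c _
    by_cases h0 : D.mP c = 0
    · simp [h0]
    · have hx : c ∈ D.suppP := (mem_suppP_iff_pos D c).mpr (Nat.pos_of_ne_zero h0)
      have hle : 0 ≤ Psi c :=
        Psi_nonneg_of_P (fun f => hA c (List.mem_append_right _ hx) f)
          (fun f => by have := p_letter_le hA h4 hx f; omega) (fun f => p_letter_offaxis hA h4 hx f)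
      have h0' : (0 : ℤ) ≤ D.mP c := by exact_mod_cast Nat.zero_le _
      exact mul_nonneg h0' hle
  have sN : ∑ c ∈ S, (D.mN c : ℤ) * Psi c ≤ 9216 * ∑ c ∈ S, (D.mN c : ℤ) := by
    rw [Finset.mul_sum]; exact Finset.sum_le_sum hN
  have sP : V * ∑ c ∈ S.filter X, (D.mP c : ℤ) ≤ ∑ c ∈ S, (D.mP c : ℤ) * Psi c := by
    rw [← Finset.sum_filter_add_sum_filter_not S X (fun c => (D.mP c : ℤ) * Psi c), Finset.mul_sum]
    have e1 : ∑ c ∈ S.filter X, V * (D.mP c : ℤ) = ∑ c ∈ S.filter X, (D.mP c : ℤ) * Psi c :=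
      Finset.sum_congr rfl (fun c hc => by rw [hV c (Finset.mem_filter.mp hc).2]; ring)
    have e2 : 0 ≤ ∑ c ∈ S.filter (fun c => ¬ X c), (D.mP c : ℤ) * Psi c :=
      Finset.sum_nonneg (fun c hc => hP c (Finset.mem_filter.mp hc).1)
    rw [e1]
    linarith
  have sB : (∑ c ∈ S, (D.mN c : ℤ)) + ∑ c ∈ S, (D.mP c : ℤ) ≤ 199 := by
    have e := copies_eq_sum hS
    have hB' : ∑ c ∈ S, D.mN c + ∑ c ∈ S, D.mP c ≤ 199 := by rw [← e]; exact hB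
    exact_mod_cast hB'
  have sX : ∑ c ∈ S.filter X, (D.mP c : ℤ) ≤ ∑ c ∈ S, (D.mP c : ℤ) :=
    Finset.sum_le_sum_of_subset_of_nonneg (Finset.filter_subset _ _) (fun c _ _ => by exact_mod_cast Nat.zero_le _)
  have hbal' : ∑ c ∈ S, (D.mN c : ℤ) * Psi c = ∑ c ∈ S, (D.mP c : ℤ) * Psi c := by
    have e : ∑ c ∈ S, ((D.mN c : ℤ) - D.mP c) * Psi c = ∑ c ∈ S, (D.mN c : ℤ) * Psi c - ∑ c ∈ S, (D.mP c : ℤ) * Psi c := by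
      rw [← Finset.sum_sub_distrib]; exact Finset.sum_congr rfl (fun c _ => by ring)
    rw [e] at hbal; linarith
  have hfin : V * ∑ c ∈ S.filter X, (D.mP c : ℤ) + 9216 * ∑ c ∈ S.filter X, (D.mP c : ℤ) ≤ 9216 * 199 := by linarith
  linarith

/-- **(w3) FAMILY-MASS LEMMA, deepest floor family, `h = 6`:** every admissible design at `(6, 199, rmin)` has total
P-multiplicity at most `8` on the (`256`) cells of `(0;±3,±3)⁴` — for any supporting cell set `S` (e.g. `cellsOn 6`,
`suppIn_cellsOn`, or a certificate cover). -/
theorem deep18_family_mass_le {D : Design} {rmin : ℤ} (hD : Admissible 6 199 rmin D) {S : Finset Cell} (hS : SuppIn D S) :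
    ∑ c ∈ S.filter famDeep18, D.mP c ≤ 8 := by
  have h := family_mass_core hD hS famDeep18 214272 (fun c hc => Psi_of_famDeep18 hc)
  have : (∑ c ∈ S.filter famDeep18, (D.mP c : ℤ)) ≤ 8 := by omega
  exact_mod_cast this

/-- **(w3) FAMILY-MASS LEMMA, second floor family, `h = 6`:** at most `10` on the (`4 096`) cells of `{(0;±4,±2),(0;±2,±4)}⁴`. -/
theorem deep20_family_mass_le {D : Design} {rmin : ℤ} (hD : Admissible 6 199 rmin D) {S : Finset Cell} (hS : SuppIn D S) :
    ∑ c ∈ S.filter famDeep20, D.mP c ≤ 10 := by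
  have h := family_mass_core hD hS famDeep20 158400 (fun c hc => Psi_of_famDeep20 hc)
  have : (∑ c ∈ S.filter famDeep20, (D.mP c : ℤ)) ≤ 10 := by omega
  exact_mod_cast this

/- USAGE: for the whole alphabet take `S := cellsOn 6`, `hS := suppIn_cellsOn hD.1`; for a certificate cover `U` take
`hS := hU.covers …`.  (A statement with the literal `cellsOn 6` inside a `Finset.filter` trips the elaborator's recursion
limit on this toolchain, so the rows are stated over a general supporting set.) -/

/-! ### §10.7 W-2′: the ALL-FLOOR family row `Σ_{all four letters on the floor} m_P ≤ 14` (second certificate `Ψ_A`, same template) -/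

/-- the all-floor certificate functional `Ψ_A = 2 583 168 · Φ_A` (`Φ_A` = the optimal S₄-profile certificate uniform on the 81
floor-profile multisets, value `86697∕6727 ≈ 12.89`; STRENGTHEN-MEMO-17 §8). -/
def PsiA (c : Cell) : ℤ :=
  mO O20 c * (735072) + (mO O01 c * (-1102608) + (mO O30 c * (-700398) + (mO O11 c * (233466) +
      (mO O40 c * (439944) + (mO O21 c * (-20702) + (mO O02 c * (-31920) + (mO O31 c * (-14943) +
      (mO O12 c * (4981) + (mO O22 c * (456) + (mO O03 c * (-684)))))))))))

theorem PsiA_congr {c c' : Cell} (h : ∀ f, (c f).a = (c' f).a ∧ (c f).selfInt = (c' f).selfInt) : PsiA c = PsiA c' := by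
  unfold PsiA
  simp only [mO_congr h]

theorem PsiA_comp (c : Cell) (σ : Equiv.Perm (Fin 4)) : PsiA (c ∘ σ) = PsiA c := by
  simp only [PsiA, mO_eq_sum O20_char, mO_eq_sum O01_char, mO_eq_sum O30_char, mO_eq_sum O11_char, mO_eq_sum O40_char,
    mO_eq_sum O21_char, mO_eq_sum O02_char, mO_eq_sum O31_char, mO_eq_sum O12_char, mO_eq_sum O22_char, mO_eq_sum O03_char,
    orbSum_comp]

theorem sum_mul_PsiA (S : Finset Cell) (w : Cell → ℤ) :
    ∑ c ∈ S, w c * PsiA c =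
      (∑ c ∈ S, w c * mO O20 c) * (735072) + ((∑ c ∈ S, w c * mO O01 c) * (-1102608) +
      ((∑ c ∈ S, w c * mO O30 c) * (-700398) + ((∑ c ∈ S, w c * mO O11 c) * (233466) +
      ((∑ c ∈ S, w c * mO O40 c) * (439944) + ((∑ c ∈ S, w c * mO O21 c) * (-20702) +
      ((∑ c ∈ S, w c * mO O02 c) * (-31920) + ((∑ c ∈ S, w c * mO O31 c) * (-14943) +
      ((∑ c ∈ S, w c * mO O12 c) * (4981) + ((∑ c ∈ S, w c * mO O22 c) * (456) +
      ((∑ c ∈ S, w c * mO O03 c) * (-684))))))))))) := by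
  simp only [Finset.sum_mul, ← Finset.sum_add_distrib]
  exact Finset.sum_congr rfl (fun c _ => by unfold PsiA; ring)

/-- BALANCE of `Ψ_A` from (A1.2). -/
theorem PsiA_balance {D : Design} {S : Finset Cell} (hS : SuppIn D S) (h1 : D.A1) :
    ∑ c ∈ S, ((D.mN c : ℤ) - D.mP c) * PsiA c = 0 := by
  have u2f : Word.efree ![Sym.h, Sym.h, Sym.one, Sym.one] := (O20_ok _ (by simp [O20])).1
  have u2d : Word.deg ![Sym.h, Sym.h, Sym.one, Sym.one] = 2 := (O20_ok _ (by simp [O20])).2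
  have u3f : Word.efree ![Sym.h, Sym.h, Sym.h, Sym.one] := (O30_ok _ (by simp [O30])).1
  have u3d : Word.deg ![Sym.h, Sym.h, Sym.h, Sym.one] = 3 := (O30_ok _ (by simp [O30])).2
  have u4f : Word.efree ![Sym.h, Sym.h, Sym.h, Sym.h] := (O40_ok _ (by simp [O40])).1
  have u4d : Word.deg ![Sym.h, Sym.h, Sym.h, Sym.h] = 4 := (O40_ok _ (by simp [O40])).2
  have u5f : Word.efree ![Sym.h, Sym.h, Sym.h, Sym.pt] := (O31_ok _ (by simp [O31])).1
  have u5d : Word.deg ![Sym.h, Sym.h, Sym.h, Sym.pt] = 5 := (O31_ok _ (by simp [O31])).2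
  have u6f : Word.efree ![Sym.h, Sym.h, Sym.pt, Sym.pt] := (O22_ok _ (by simp [O22])).1
  have u6d : Word.deg ![Sym.h, Sym.h, Sym.pt, Sym.pt] = 6 := (O22_ok _ (by simp [O22])).2
  have r2 := sum_mO_rel hS h1 O20 O01 _ u2f 2 u2d O20_ok O01_ok
  have r3 := sum_mO_rel hS h1 O30 O11 _ u3f 3 u3d O30_ok O11_ok
  have r4 := sum_mO_rel hS h1 O40 O21 _ u4f 4 u4d O40_ok O21_ok
  have r4' := sum_mO_rel hS h1 O21 O02 _ u4f 4 u4d O21_ok O02_ok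
  have r5 := sum_mO_rel hS h1 O31 O12 _ u5f 5 u5d O31_ok O12_ok
  have r6 := sum_mO_rel hS h1 O22 O03 _ u6f 6 u6d O22_ok O03_ok
  rw [O20_len, O01_len] at r2
  rw [O30_len, O11_len] at r3
  rw [O40_len, O21_len] at r4
  rw [O21_len, O02_len] at r4'
  rw [O31_len, O12_len] at r5
  rw [O22_len, O03_len] at r6
  rw [sum_mul_PsiA]
  push_cast at r2 r3 r4 r4' r5 r6
  omega

set_option maxRecDepth 65536 in
set_option maxHeartbeats 4000000 in
/-- `Ψ_A ≤ 2 583 168` on the sorted representative N-cells. -/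
theorem PsiA_repN_sorted : ∀ i0 i1 i2 i3 : Fin 9, i0 ≤ i1 → i1 ≤ i2 → i2 ≤ i3 →
    PsiA ![RepNv i0, RepNv i1, RepNv i2, RepNv i3] ≤ 2583168 := by
  decide +kernel

set_option maxRecDepth 65536 in
set_option maxHeartbeats 4000000 in
/-- `Ψ_A ≥ 0` on the sorted representative P-cells. -/
theorem PsiA_repP_sorted : ∀ i0 i1 i2 i3 : Fin 9, i0 ≤ i1 → i1 ≤ i2 → i2 ≤ i3 →
    0 ≤ PsiA ![RepPv i0, RepPv i1, RepPv i2, RepPv i3] := by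
  decide +kernel

set_option maxRecDepth 65536 in
set_option maxHeartbeats 4000000 in
/-- `Ψ_A ≥ 33 291 648` on the sorted representative P-cells ALL ON THE FLOOR (the floor representatives are the indices with
`a = 0`, i.e. `0, 1, 2`; by sortedness `(RepPv i3).a = 0` suffices). -/
theorem PsiA_repFloor_sorted : ∀ i0 i1 i2 i3 : Fin 9, i0 ≤ i1 → i1 ≤ i2 → i2 ≤ i3 → (RepPv i3).a = 0 →
    33291648 ≤ PsiA ![RepPv i0, RepPv i1, RepPv i2, RepPv i3] := by
  decide +kernel

theorem PsiA_sorted_transport (R : Fin 9 → Letter) (P : ℤ → Prop)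
    (hsorted : ∀ i0 i1 i2 i3 : Fin 9, i0 ≤ i1 → i1 ≤ i2 → i2 ≤ i3 → P (PsiA ![R i0, R i1, R i2, R i3]))
    (j : Fin 4 → Fin 9) : P (PsiA (R ∘ j)) := by
  have hmono : Monotone (j ∘ ⇑(Tuple.sort j)) := Tuple.monotone_sort j
  rw [← PsiA_comp (R ∘ j) (Tuple.sort j)]
  have e : ((R ∘ j) ∘ ⇑(Tuple.sort j) : Cell) =
      ![R (j (Tuple.sort j 0)), R (j (Tuple.sort j 1)), R (j (Tuple.sort j 2)), R (j (Tuple.sort j 3))] := by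
    funext f
    fin_cases f <;> rfl
  rw [e]
  have h01 : j (Tuple.sort j 0) ≤ j (Tuple.sort j 1) := hmono (show (0 : Fin 4) ≤ 1 by decide)
  have h12 : j (Tuple.sort j 1) ≤ j (Tuple.sort j 2) := hmono (show (1 : Fin 4) ≤ 2 by decide)
  have h23 : j (Tuple.sort j 2) ≤ j (Tuple.sort j 3) := hmono (show (2 : Fin 4) ≤ 3 by decide)
  exact hsorted _ _ _ _ h01 h12 h23

theorem PsiA_le_of_N {c : Cell} (hA : ∀ f, (c f).OnAlphabet 6) (h2 : ∀ f, 2 ≤ (c f).a) : PsiA c ≤ 2583168 := by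
  have hrep : ∀ f, ∃ i : Fin 9, (RepNv i).a = (c f).a ∧ (RepNv i).selfInt = (c f).selfInt := fun f =>
    repN_complete (c f) (mem_boxList_six (hA f)) (hA f).2 (h2 f)
  choose j hj using hrep
  rw [PsiA_congr (c' := RepNv ∘ j) (fun f => ⟨(hj f).1.symm, (hj f).2.symm⟩)]
  exact PsiA_sorted_transport RepNv (fun v => v ≤ 2583168) PsiA_repN_sorted j

theorem PsiA_nonneg_of_P {c : Cell} (hA : ∀ f, (c f).OnAlphabet 6) (h4 : ∀ f, (c f).a ≤ 4)
    (hoff : ∀ f, (c f).x * (c f).y ≠ 0) : 0 ≤ PsiA c := by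
  have hrep : ∀ f, ∃ i : Fin 9, (RepPv i).a = (c f).a ∧ (RepPv i).selfInt = (c f).selfInt := fun f =>
    repP_complete (c f) (mem_boxList_six (hA f)) (hA f).2 (h4 f) (hoff f)
  choose j hj using hrep
  rw [PsiA_congr (c' := RepPv ∘ j) (fun f => ⟨(hj f).1.symm, (hj f).2.symm⟩)]
  exact PsiA_sorted_transport RepPv (fun v => 0 ≤ v) PsiA_repP_sorted j

/-- the ALL-FLOOR family: all four letters on the floor `a = 0` (at `h = 6`: `20⁴ = 160 000` cells, P-profiles `−26, −20, −18`). -/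
def famFloor (c : Cell) : Prop := ∀ f : Fin 4, (c f).a = 0

instance decFamFloor : DecidablePred famFloor := fun c => by unfold famFloor; infer_instance

/-- `Ψ_A ≥ 33 291 648` on every P-type all-floor cell. -/
theorem PsiA_ge_of_floor {c : Cell} (hA : ∀ f, (c f).OnAlphabet 6) (hoff : ∀ f, (c f).x * (c f).y ≠ 0) (hfl : famFloor c) :
    33291648 ≤ PsiA c := by
  have hrep : ∀ f, ∃ i : Fin 9, (RepPv i).a = (c f).a ∧ (RepPv i).selfInt = (c f).selfInt := fun f =>
    repP_complete (c f) (mem_boxList_six (hA f)) (hA f).2 (by rw [hfl f]; decide) (hoff f)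
  choose j hj using hrep
  rw [PsiA_congr (c' := RepPv ∘ j) (fun f => ⟨(hj f).1.symm, (hj f).2.symm⟩)]
  have hz : ∀ f, (RepPv (j f)).a = 0 := fun f => (hj f).1.trans (hfl f)
  have hmono : Monotone (j ∘ ⇑(Tuple.sort j)) := Tuple.monotone_sort j
  rw [← PsiA_comp (RepPv ∘ j) (Tuple.sort j)]
  have e : ((RepPv ∘ j) ∘ ⇑(Tuple.sort j) : Cell) = ![RepPv (j (Tuple.sort j 0)), RepPv (j (Tuple.sort j 1)),
      RepPv (j (Tuple.sort j 2)), RepPv (j (Tuple.sort j 3))] := by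
    funext f
    fin_cases f <;> rfl
  rw [e]
  have h01 : j (Tuple.sort j 0) ≤ j (Tuple.sort j 1) := hmono (show (0 : Fin 4) ≤ 1 by decide)
  have h12 : j (Tuple.sort j 1) ≤ j (Tuple.sort j 2) := hmono (show (1 : Fin 4) ≤ 2 by decide)
  have h23 : j (Tuple.sort j 2) ≤ j (Tuple.sort j 3) := hmono (show (2 : Fin 4) ≤ 3 by decide)
  exact PsiA_repFloor_sorted _ _ _ _ h01 h12 h23 (hz _)

/-- the mass argument for a general certificate `Φ` with N-cap `U ≥ 0` and a family floor value `V` read on P-cells only. -/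
theorem mass_core₀ {D : Design} (hB : D.copies ≤ 199) {S : Finset Cell} (hS : SuppIn D S)
    (Φ : Cell → ℤ) (U V : ℤ) (hU : 0 ≤ U) (hbal : ∑ c ∈ S, ((D.mN c : ℤ) - D.mP c) * Φ c = 0)
    (hN : ∀ c ∈ D.suppN, Φ c ≤ U) (hP : ∀ c ∈ D.suppP, 0 ≤ Φ c)
    (X : Cell → Prop) [DecidablePred X] (hV : ∀ c ∈ D.suppP, X c → V ≤ Φ c) :
    (V + U) * (∑ c ∈ S.filter X, (D.mP c : ℤ)) ≤ U * 199 := by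
  have hN' : ∀ c ∈ S, (D.mN c : ℤ) * Φ c ≤ U * D.mN c := by
    intro c _
    by_cases h0 : D.mN c = 0
    · simp [h0]
    · have hy : c ∈ D.suppN := (mem_suppN_iff_pos D c).mpr (Nat.pos_of_ne_zero h0)
      have h0' : (0 : ℤ) ≤ D.mN c := by exact_mod_cast Nat.zero_le _
      have := mul_le_mul_of_nonneg_left (hN c hy) h0'
      linarith
  have hP' : ∀ c ∈ S, 0 ≤ (D.mP c : ℤ) * Φ c := by
    intro c _
    by_cases h0 : D.mP c = 0
    · simp [h0]
    · have hx : c ∈ D.suppP := (mem_suppP_iff_pos D c).mpr (Nat.pos_of_ne_zero h0)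
      have h0' : (0 : ℤ) ≤ D.mP c := by exact_mod_cast Nat.zero_le _
      exact mul_nonneg h0' (hP c hx)
  have hV' : ∀ c ∈ S.filter X, V * (D.mP c : ℤ) ≤ (D.mP c : ℤ) * Φ c := by
    intro c hc
    by_cases h0 : D.mP c = 0
    · simp [h0]
    · have hx : c ∈ D.suppP := (mem_suppP_iff_pos D c).mpr (Nat.pos_of_ne_zero h0)
      have h0' : (0 : ℤ) ≤ D.mP c := by exact_mod_cast Nat.zero_le _
      have := mul_le_mul_of_nonneg_left (hV c hx (Finset.mem_filter.mp hc).2) h0'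
      linarith
  have sN : ∑ c ∈ S, (D.mN c : ℤ) * Φ c ≤ U * ∑ c ∈ S, (D.mN c : ℤ) := by
    rw [Finset.mul_sum]; exact Finset.sum_le_sum hN'
  have sP : V * ∑ c ∈ S.filter X, (D.mP c : ℤ) ≤ ∑ c ∈ S, (D.mP c : ℤ) * Φ c := by
    rw [← Finset.sum_filter_add_sum_filter_not S X (fun c => (D.mP c : ℤ) * Φ c), Finset.mul_sum]
    have e1 : ∑ c ∈ S.filter X, V * (D.mP c : ℤ) ≤ ∑ c ∈ S.filter X, (D.mP c : ℤ) * Φ c := Finset.sum_le_sum hV'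
    have e2 : 0 ≤ ∑ c ∈ S.filter (fun c => ¬ X c), (D.mP c : ℤ) * Φ c :=
      Finset.sum_nonneg (fun c hc => hP' c (Finset.mem_filter.mp hc).1)
    linarith
  have sB : (∑ c ∈ S, (D.mN c : ℤ)) + ∑ c ∈ S, (D.mP c : ℤ) ≤ 199 := by
    have e := copies_eq_sum hS
    have hB' : ∑ c ∈ S, D.mN c + ∑ c ∈ S, D.mP c ≤ 199 := by rw [← e]; exact hB
    exact_mod_cast hB'
  have sX : ∑ c ∈ S.filter X, (D.mP c : ℤ) ≤ ∑ c ∈ S, (D.mP c : ℤ) :=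
    Finset.sum_le_sum_of_subset_of_nonneg (Finset.filter_subset _ _) (fun c _ _ => by exact_mod_cast Nat.zero_le _)
  have hbal' : ∑ c ∈ S, (D.mN c : ℤ) * Φ c = ∑ c ∈ S, (D.mP c : ℤ) * Φ c := by
    have e : ∑ c ∈ S, ((D.mN c : ℤ) - D.mP c) * Φ c = ∑ c ∈ S, (D.mN c : ℤ) * Φ c - ∑ c ∈ S, (D.mP c : ℤ) * Φ c := by
      rw [← Finset.sum_sub_distrib]; exact Finset.sum_congr rfl (fun c _ => by ring)
    rw [e] at hbal; linarith
  have hUx : U * ∑ c ∈ S.filter X, (D.mP c : ℤ) ≤ U * ∑ c ∈ S, (D.mP c : ℤ) := mul_le_mul_of_nonneg_left sX hU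
  have hUN : U * ∑ c ∈ S, (D.mN c : ℤ) ≤ U * (199 - ∑ c ∈ S, (D.mP c : ℤ)) :=
    mul_le_mul_of_nonneg_left (by linarith) hU
  have hfin : V * ∑ c ∈ S.filter X, (D.mP c : ℤ) + U * ∑ c ∈ S.filter X, (D.mP c : ℤ) ≤ U * 199 := by linarith
  linarith

/-- the mass argument under the bundled admissibility (only the budget is used; `μ ≠ 0` and the rank are not). -/
theorem mass_core {D : Design} {rmin : ℤ} (hD : Admissible 6 199 rmin D) {S : Finset Cell} (hS : SuppIn D S)
    (Φ : Cell → ℤ) (U V : ℤ) (hU : 0 ≤ U) (hbal : ∑ c ∈ S, ((D.mN c : ℤ) - D.mP c) * Φ c = 0)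
    (hN : ∀ c ∈ D.suppN, Φ c ≤ U) (hP : ∀ c ∈ D.suppP, 0 ≤ Φ c)
    (X : Cell → Prop) [DecidablePred X] (hV : ∀ c ∈ D.suppP, X c → V ≤ Φ c) :
    (V + U) * (∑ c ∈ S.filter X, (D.mP c : ℤ)) ≤ U * 199 :=
  mass_core₀ hD.2.2.2.2.1 hS Φ U V hU hbal hN hP X hV

/-- **(w3) ALL-FLOOR FAMILY-MASS ROW, `h = 6`:** every admissible design at `(6, 199, rmin)` has total P-multiplicity at most `14`
on the cells all four of whose letters lie on the floor `a = 0` (`160 000` cells; any supporting cell set `S`). -/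
theorem floor4_family_mass_le {D : Design} {rmin : ℤ} (hD : Admissible 6 199 rmin D) {S : Finset Cell} (hS : SuppIn D S) :
    ∑ c ∈ S.filter famFloor, D.mP c ≤ 14 := by
  have hA := hD.1
  have h4 := hD.2.2.1
  have h := mass_core hD hS PsiA 2583168 33291648 (by norm_num) (PsiA_balance hS hD.2.1)
    (fun c hy => PsiA_le_of_N (fun f => hA c (List.mem_append_left _ hy) f) (fun f => n_letter_two_le hA h4 hy f))
    (fun c hx => PsiA_nonneg_of_P (fun f => hA c (List.mem_append_right _ hx) f)
      (fun f => by have := p_letter_le hA h4 hx f; omega) (fun f => p_letter_offaxis hA h4 hx f))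
    famFloor (fun c hx hfl => PsiA_ge_of_floor (fun f => hA c (List.mem_append_right _ hx) f)
      (fun f => p_letter_offaxis hA h4 hx f) hfl)
  have : (∑ c ∈ S.filter famFloor, (D.mP c : ℤ)) ≤ 14 := by omega
  exact_mod_cast this

/-! ### §10.8 W-2″: the isotypic row `Σ_{(0;{±5,±1})⁴} m_P ≤ 13` (third certificate `Ψ_B`, same template) -/

/-- the `(0,−26)`-isotypic certificate functional `Ψ_B = 12 288 · Φ₂₆` (`Φ₂₆ = 871∕64` the exact S₄-profile LP optimum for this family). -/
def PsiB (c : Cell) : ℤ :=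
  mO O20 c * (3048) + (mO O01 c * (-4572) + (mO O30 c * (-2856) + (mO O11 c * (952) +
      (mO O40 c * (1764) + (mO O21 c * (-83) + (mO O02 c * (-128) + (mO O31 c * (-60) +
      (mO O12 c * (20) + (mO O22 c * (2) + (mO O03 c * (-3)))))))))))

theorem PsiB_congr {c c' : Cell} (h : ∀ f, (c f).a = (c' f).a ∧ (c f).selfInt = (c' f).selfInt) : PsiB c = PsiB c' := by
  unfold PsiB
  simp only [mO_congr h]

theorem PsiB_comp (c : Cell) (σ : Equiv.Perm (Fin 4)) : PsiB (c ∘ σ) = PsiB c := by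
  simp only [PsiB, mO_eq_sum O20_char, mO_eq_sum O01_char, mO_eq_sum O30_char, mO_eq_sum O11_char, mO_eq_sum O40_char,
    mO_eq_sum O21_char, mO_eq_sum O02_char, mO_eq_sum O31_char, mO_eq_sum O12_char, mO_eq_sum O22_char, mO_eq_sum O03_char,
    orbSum_comp]

theorem sum_mul_PsiB (S : Finset Cell) (w : Cell → ℤ) :
    ∑ c ∈ S, w c * PsiB c =
      (∑ c ∈ S, w c * mO O20 c) * (3048) + ((∑ c ∈ S, w c * mO O01 c) * (-4572) +
      ((∑ c ∈ S, w c * mO O30 c) * (-2856) + ((∑ c ∈ S, w c * mO O11 c) * (952) +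
      ((∑ c ∈ S, w c * mO O40 c) * (1764) + ((∑ c ∈ S, w c * mO O21 c) * (-83) +
      ((∑ c ∈ S, w c * mO O02 c) * (-128) + ((∑ c ∈ S, w c * mO O31 c) * (-60) +
      ((∑ c ∈ S, w c * mO O12 c) * (20) + ((∑ c ∈ S, w c * mO O22 c) * (2) +
      ((∑ c ∈ S, w c * mO O03 c) * (-3))))))))))) := by
  simp only [Finset.sum_mul, ← Finset.sum_add_distrib]
  exact Finset.sum_congr rfl (fun c _ => by unfold PsiB; ring)

/-- BALANCE of `Ψ_B` from (A1.2). -/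
theorem PsiB_balance {D : Design} {S : Finset Cell} (hS : SuppIn D S) (h1 : D.A1) :
    ∑ c ∈ S, ((D.mN c : ℤ) - D.mP c) * PsiB c = 0 := by
  have u2f : Word.efree ![Sym.h, Sym.h, Sym.one, Sym.one] := (O20_ok _ (by simp [O20])).1
  have u2d : Word.deg ![Sym.h, Sym.h, Sym.one, Sym.one] = 2 := (O20_ok _ (by simp [O20])).2
  have u3f : Word.efree ![Sym.h, Sym.h, Sym.h, Sym.one] := (O30_ok _ (by simp [O30])).1
  have u3d : Word.deg ![Sym.h, Sym.h, Sym.h, Sym.one] = 3 := (O30_ok _ (by simp [O30])).2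
  have u4f : Word.efree ![Sym.h, Sym.h, Sym.h, Sym.h] := (O40_ok _ (by simp [O40])).1
  have u4d : Word.deg ![Sym.h, Sym.h, Sym.h, Sym.h] = 4 := (O40_ok _ (by simp [O40])).2
  have u5f : Word.efree ![Sym.h, Sym.h, Sym.h, Sym.pt] := (O31_ok _ (by simp [O31])).1
  have u5d : Word.deg ![Sym.h, Sym.h, Sym.h, Sym.pt] = 5 := (O31_ok _ (by simp [O31])).2
  have u6f : Word.efree ![Sym.h, Sym.h, Sym.pt, Sym.pt] := (O22_ok _ (by simp [O22])).1
  have u6d : Word.deg ![Sym.h, Sym.h, Sym.pt, Sym.pt] = 6 := (O22_ok _ (by simp [O22])).2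
  have r2 := sum_mO_rel hS h1 O20 O01 _ u2f 2 u2d O20_ok O01_ok
  have r3 := sum_mO_rel hS h1 O30 O11 _ u3f 3 u3d O30_ok O11_ok
  have r4 := sum_mO_rel hS h1 O40 O21 _ u4f 4 u4d O40_ok O21_ok
  have r4' := sum_mO_rel hS h1 O21 O02 _ u4f 4 u4d O21_ok O02_ok
  have r5 := sum_mO_rel hS h1 O31 O12 _ u5f 5 u5d O31_ok O12_ok
  have r6 := sum_mO_rel hS h1 O22 O03 _ u6f 6 u6d O22_ok O03_ok
  rw [O20_len, O01_len] at r2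
  rw [O30_len, O11_len] at r3
  rw [O40_len, O21_len] at r4
  rw [O21_len, O02_len] at r4'
  rw [O31_len, O12_len] at r5
  rw [O22_len, O03_len] at r6
  rw [sum_mul_PsiB]
  push_cast at r2 r3 r4 r4' r5 r6
  omega

set_option maxRecDepth 65536 in
set_option maxHeartbeats 4000000 in
/-- `Ψ_B ≤ 12 288` on the sorted representative N-cells. -/
theorem PsiB_repN_sorted : ∀ i0 i1 i2 i3 : Fin 9, i0 ≤ i1 → i1 ≤ i2 → i2 ≤ i3 →
    PsiB ![RepNv i0, RepNv i1, RepNv i2, RepNv i3] ≤ 12288 := by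
  decide +kernel

set_option maxRecDepth 65536 in
set_option maxHeartbeats 4000000 in
/-- `Ψ_B ≥ 0` on the sorted representative P-cells. -/
theorem PsiB_repP_sorted : ∀ i0 i1 i2 i3 : Fin 9, i0 ≤ i1 → i1 ≤ i2 → i2 ≤ i3 →
    0 ≤ PsiB ![RepPv i0, RepPv i1, RepPv i2, RepPv i3] := by
  decide +kernel

theorem PsiB_sorted_transport (R : Fin 9 → Letter) (P : ℤ → Prop)
    (hsorted : ∀ i0 i1 i2 i3 : Fin 9, i0 ≤ i1 → i1 ≤ i2 → i2 ≤ i3 → P (PsiB ![R i0, R i1, R i2, R i3]))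
    (j : Fin 4 → Fin 9) : P (PsiB (R ∘ j)) := by
  have hmono : Monotone (j ∘ ⇑(Tuple.sort j)) := Tuple.monotone_sort j
  rw [← PsiB_comp (R ∘ j) (Tuple.sort j)]
  have e : ((R ∘ j) ∘ ⇑(Tuple.sort j) : Cell) =
      ![R (j (Tuple.sort j 0)), R (j (Tuple.sort j 1)), R (j (Tuple.sort j 2)), R (j (Tuple.sort j 3))] := by
    funext f
    fin_cases f <;> rfl
  rw [e]
  have h01 : j (Tuple.sort j 0) ≤ j (Tuple.sort j 1) := hmono (show (0 : Fin 4) ≤ 1 by decide)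
  have h12 : j (Tuple.sort j 1) ≤ j (Tuple.sort j 2) := hmono (show (1 : Fin 4) ≤ 2 by decide)
  have h23 : j (Tuple.sort j 2) ≤ j (Tuple.sort j 3) := hmono (show (2 : Fin 4) ≤ 3 by decide)
  exact hsorted _ _ _ _ h01 h12 h23

theorem PsiB_le_of_N {c : Cell} (hA : ∀ f, (c f).OnAlphabet 6) (h2 : ∀ f, 2 ≤ (c f).a) : PsiB c ≤ 12288 := by
  have hrep : ∀ f, ∃ i : Fin 9, (RepNv i).a = (c f).a ∧ (RepNv i).selfInt = (c f).selfInt := fun f =>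
    repN_complete (c f) (mem_boxList_six (hA f)) (hA f).2 (h2 f)
  choose j hj using hrep
  rw [PsiB_congr (c' := RepNv ∘ j) (fun f => ⟨(hj f).1.symm, (hj f).2.symm⟩)]
  exact PsiB_sorted_transport RepNv (fun v => v ≤ 12288) PsiB_repN_sorted j

theorem PsiB_nonneg_of_P {c : Cell} (hA : ∀ f, (c f).OnAlphabet 6) (h4 : ∀ f, (c f).a ≤ 4)
    (hoff : ∀ f, (c f).x * (c f).y ≠ 0) : 0 ≤ PsiB c := by
  have hrep : ∀ f, ∃ i : Fin 9, (RepPv i).a = (c f).a ∧ (RepPv i).selfInt = (c f).selfInt := fun f =>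
    repP_complete (c f) (mem_boxList_six (hA f)) (hA f).2 (h4 f) (hoff f)
  choose j hj using hrep
  rw [PsiB_congr (c' := RepPv ∘ j) (fun f => ⟨(hj f).1.symm, (hj f).2.symm⟩)]
  exact PsiB_sorted_transport RepPv (fun v => 0 ≤ v) PsiB_repP_sorted j

/-- the deepest isotypic floor family `X₂₆ = {(0;±5,±1),(0;±1,±5)}⁴` (4 096 cells). -/
def famDeep26 (c : Cell) : Prop := ∀ f : Fin 4, (c f).a = 0 ∧ (c f).selfInt = -26

instance decFamDeep26 : DecidablePred famDeep26 := fun c => by unfold famDeep26; infer_instance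

theorem PsiB_val_051 : PsiB (fun _ : Fin 4 => (⟨0, 5, 1⟩ : Letter)) = 167232 := by decide +kernel

theorem PsiB_of_famDeep26 {c : Cell} (hc : famDeep26 c) : PsiB c = 167232 := by
  rw [PsiB_congr (c' := fun _ : Fin 4 => (⟨0, 5, 1⟩ : Letter)) (fun f => ⟨(hc f).1, (hc f).2.trans (by decide +kernel)⟩)]
  exact PsiB_val_051

/-- **(w3) ISOTYPIC FAMILY-MASS ROW, deepest family, `h = 6`:** at most `13` on the (`4 096`) cells of `{(0;±5,±1),(0;±1,±5)}⁴`
(the all-floor row §10.7 gives `14` there; `13 = ⌊199·12288∕179520⌋` is the family's own e-free certificate optimum `871∕64`). -/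
theorem deep26_family_mass_le {D : Design} {rmin : ℤ} (hD : Admissible 6 199 rmin D) {S : Finset Cell} (hS : SuppIn D S) :
    ∑ c ∈ S.filter famDeep26, D.mP c ≤ 13 := by
  have hA := hD.1
  have h4 := hD.2.2.1
  have h := mass_core hD hS PsiB 12288 167232 (by norm_num) (PsiB_balance hS hD.2.1)
    (fun c hy => PsiB_le_of_N (fun f => hA c (List.mem_append_left _ hy) f) (fun f => n_letter_two_le hA h4 hy f))
    (fun c hx => PsiB_nonneg_of_P (fun f => hA c (List.mem_append_right _ hx) f)
      (fun f => by have := p_letter_le hA h4 hx f; omega) (fun f => p_letter_offaxis hA h4 hx f))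
    famDeep26 (fun c _ hc => (PsiB_of_famDeep26 hc).symm.le)
  have : (∑ c ∈ S.filter famDeep26, (D.mP c : ℤ)) ≤ 13 := by omega
  exact_mod_cast this

/-! ### §10.9 The four rows with MINIMAL hypotheses and in FUNCTION FORM on any cell set `U ⊆ cellsOn 6`
(the form `FinCheckOn U 199 rmin` ∕ a branch-and-cut certificate over a cover `U` consumes: (A1), (A4), copies `≤ 199` — no `μ ≠ 0`,
no rank; so the rows prune every node of a search over `m : U → Fin 200 × Fin 200`, admissible or not yet). -/

/-- merged multiplicity of a once-listed cell set. -/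
theorem mult_map_eq {l : List Cell} (hl : l.Nodup) (g : Cell → ℕ) (c : Cell) :
    mult (l.map fun d => (d, g d)) c = if c ∈ l then g c else 0 := by
  induction l with
  | nil => simp [mult_nil]
  | cons d t ih =>
    rw [List.map_cons, mult_cons, ih (List.nodup_cons.mp hl).2]
    have hd : d ∉ t := (List.nodup_cons.mp hl).1
    by_cases hc : d = c
    · subst hc
      simp [hd]
    · have hc' : ¬ c = d := fun e => hc e.symm
      simp [hc, hc', List.mem_cons]

theorem realise_mN (U : Finset Cell) (gN gP : Cell → ℕ) {c : Cell} (hc : c ∈ U) : (realise U gN gP).mN c = gN c := by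
  rw [mN_eq_mult]
  unfold realise
  rw [mult_map_eq (Finset.nodup_toList U)]
  simp [Finset.mem_toList, hc]

theorem realise_mP (U : Finset Cell) (gN gP : Cell → ℕ) {c : Cell} (hc : c ∈ U) : (realise U gN gP).mP c = gP c := by
  rw [mP_eq_mult]
  unfold realise
  rw [mult_map_eq (Finset.nodup_toList U)]
  simp [Finset.mem_toList, hc]

theorem suppIn_realise (U : Finset Cell) (gN gP : Cell → ℕ) : SuppIn (realise U gN gP) U := by
  intro c hc
  rcases List.mem_append.mp hc with hN | hP
  · exact ((mem_suppN_realise U gN gP).mp hN).1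
  · exact ((mem_suppP_realise U gN gP).mp hP).1

/-- the four rows from (A1), (A4), alphabet and budget ALONE (design form, any supporting cell set). -/
theorem rows_of_budget {D : Design} (hA : D.OnAlphabet 6) (h1 : D.A1) (h4 : D.A4) (hB : D.copies ≤ 199)
    {S : Finset Cell} (hS : SuppIn D S) :
    (∑ c ∈ S.filter famDeep18, D.mP c ≤ 8) ∧ (∑ c ∈ S.filter famDeep20, D.mP c ≤ 10) ∧
    (∑ c ∈ S.filter famDeep26, D.mP c ≤ 13) ∧ (∑ c ∈ S.filter famFloor, D.mP c ≤ 14) := by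
  have hAN : ∀ c ∈ D.suppN, ∀ f, (c f).OnAlphabet 6 := fun c hy f => hA c (List.mem_append_left _ hy) f
  have hAP : ∀ c ∈ D.suppP, ∀ f, (c f).OnAlphabet 6 := fun c hx f => hA c (List.mem_append_right _ hx) f
  have h2 : ∀ c ∈ D.suppN, ∀ f, 2 ≤ (c f).a := fun c hy f => n_letter_two_le hA h4 hy f
  have h4' : ∀ c ∈ D.suppP, ∀ f, (c f).a ≤ 4 := fun c hx f => by have := p_letter_le hA h4 hx f; omega
  have hoff : ∀ c ∈ D.suppP, ∀ f, (c f).x * (c f).y ≠ 0 := fun c hx f => p_letter_offaxis hA h4 hx f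
  have r18 := mass_core₀ hB hS Psi 9216 214272 (by norm_num) (Psi_balance hS h1)
    (fun c hy => Psi_le_of_N (hAN c hy) (h2 c hy)) (fun c hx => Psi_nonneg_of_P (hAP c hx) (h4' c hx) (hoff c hx))
    famDeep18 (fun c _ hc => (Psi_of_famDeep18 hc).symm.le)
  have r20 := mass_core₀ hB hS Psi 9216 158400 (by norm_num) (Psi_balance hS h1)
    (fun c hy => Psi_le_of_N (hAN c hy) (h2 c hy)) (fun c hx => Psi_nonneg_of_P (hAP c hx) (h4' c hx) (hoff c hx))
    famDeep20 (fun c _ hc => (Psi_of_famDeep20 hc).symm.le)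
  have r26 := mass_core₀ hB hS PsiB 12288 167232 (by norm_num) (PsiB_balance hS h1)
    (fun c hy => PsiB_le_of_N (hAN c hy) (h2 c hy)) (fun c hx => PsiB_nonneg_of_P (hAP c hx) (h4' c hx) (hoff c hx))
    famDeep26 (fun c _ hc => (PsiB_of_famDeep26 hc).symm.le)
  have rfl4 := mass_core₀ hB hS PsiA 2583168 33291648 (by norm_num) (PsiA_balance hS h1)
    (fun c hy => PsiA_le_of_N (hAN c hy) (h2 c hy)) (fun c hx => PsiA_nonneg_of_P (hAP c hx) (h4' c hx) (hoff c hx))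
    famFloor (fun c hx hfl => PsiA_ge_of_floor (hAP c hx) (hoff c hx) hfl)
  have e18 : (∑ c ∈ S.filter famDeep18, (D.mP c : ℤ)) ≤ 8 := by omega
  have e20 : (∑ c ∈ S.filter famDeep20, (D.mP c : ℤ)) ≤ 10 := by omega
  have e26 : (∑ c ∈ S.filter famDeep26, (D.mP c : ℤ)) ≤ 13 := by omega
  have efl : (∑ c ∈ S.filter famFloor, (D.mP c : ℤ)) ≤ 14 := by omega
  refine ⟨?_, ?_, ?_, ?_⟩ <;> assumption_mod_cast

/-- **THE FOUR ROWS IN FUNCTION FORM** on any cell set `U ⊆ cellsOn 6` (a cover, a branch of a search, the whole alphabet): for every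
multiplicity pair `gN gP` on `U` satisfying (A1), (A4) and copies `≤ 199` — `Σ_{U ∩ (0;±3,±3)⁴} gP ≤ 8`, `Σ_{U ∩ (0;{4,2})⁴} gP ≤ 10`,
`Σ_{U ∩ (0;{5,1})⁴} gP ≤ 13`, `Σ_{U ∩ floor⁴} gP ≤ 14`. -/
theorem rows_fun {U : Finset Cell} (hU : U ⊆ cellsOn 6) {gN gP : Cell → ℕ} (h1 : A1fun U gN gP) (h4 : A4fun U gN gP)
    (hB : copiesfun U gN gP ≤ 199) :
    (∑ c ∈ U.filter famDeep18, gP c ≤ 8) ∧ (∑ c ∈ U.filter famDeep20, gP c ≤ 10) ∧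
    (∑ c ∈ U.filter famDeep26, gP c ≤ 13) ∧ (∑ c ∈ U.filter famFloor, gP c ≤ 14) := by
  have hB' : (realise U gN gP).copies ≤ 199 := by rw [realise_copies]; exact hB
  obtain ⟨r18, r20, r26, rfl4⟩ := rows_of_budget (onAlphabet_realise U gN gP hU) (a1_realise U gN gP h1)
    (a4_realise U gN gP h4) hB' (suppIn_realise U gN gP)
  have e : ∀ (X : Cell → Prop) [DecidablePred X], ∑ c ∈ U.filter X, gP c = ∑ c ∈ U.filter X, (realise U gN gP).mP c :=
    fun X _ => Finset.sum_congr rfl (fun c hc => (realise_mP U gN gP (Finset.mem_filter.mp hc).1).symm)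
  rw [e famDeep18, e famDeep20, e famDeep26, e famFloor]
  exact ⟨r18, r20, r26, rfl4⟩

/-- the all-floor row in the search language of §3: for every point `m : U → Fin 200 × Fin 200` of the search space `FinCheckOn U 199 rmin`
quantifies over, (A1) ∧ (A4) ∧ copies `≤ 199` already force floor P-mass `≤ 14` (a node whose fixed floor P-mass exceeds `14` has no
admissible completion — a sound pruning rule, threshold `14`, not law type). -/
theorem floor4_row_ext {U : Finset Cell} (hU : U ⊆ cellsOn 6) (m : U → Fin (199 + 1) × Fin (199 + 1))
    (h1 : A1fun U (extN m) (extP m)) (h4 : A4fun U (extN m) (extP m)) (hB : copiesfun U (extN m) (extP m) ≤ 199) :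
    ∑ c ∈ U.filter famFloor, extP m c ≤ 14 :=
  (rows_fun hU h1 h4 hB).2.2.2

/-! ### §10.10 THE STOREY COLUMN, first entry `h = 7`: the all-floor row `Σ_{floor⁴} m_P ≤ 24` (same template; 12 + 12 profiles) -/

/-- one letter per N-profile of the height-7 alphabet (`a ≥ 2`). -/
def RepN7v : Fin 12 → Letter :=
  ![⟨2, 5, 0⟩, ⟨2, 4, 1⟩, ⟨2, 3, 2⟩, ⟨3, 4, 0⟩, ⟨3, 3, 1⟩, ⟨3, 2, 2⟩, ⟨4, 3, 0⟩, ⟨4, 2, 1⟩, ⟨5, 2, 0⟩, ⟨5, 1, 1⟩, ⟨6, 1, 0⟩, ⟨7, 0, 0⟩]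
/-- one letter per P-profile of the height-7 alphabet (off-axis, `a ≤ 5`); the floor profiles are the indices `0, 1, 2`. -/
def RepP7v : Fin 12 → Letter :=
  ![⟨0, 6, 1⟩, ⟨0, 5, 2⟩, ⟨0, 4, 3⟩, ⟨1, 5, 1⟩, ⟨1, 4, 2⟩, ⟨1, 3, 3⟩, ⟨2, 4, 1⟩, ⟨2, 3, 2⟩, ⟨3, 3, 1⟩, ⟨3, 2, 2⟩, ⟨4, 2, 1⟩, ⟨5, 1, 1⟩]

set_option maxRecDepth 65536 in
theorem repN7_complete :
    ∀ ℓ ∈ boxList 7 7, 0 ≤ ℓ.a → 2 ≤ ℓ.a → ∃ i : Fin 12, (RepN7v i).a = ℓ.a ∧ (RepN7v i).selfInt = ℓ.selfInt := by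
  decide +kernel
set_option maxRecDepth 65536 in
theorem repP7_complete :
    ∀ ℓ ∈ boxList 7 7, 0 ≤ ℓ.a → ℓ.a ≤ 5 → ℓ.x * ℓ.y ≠ 0 → ∃ i : Fin 12, (RepP7v i).a = ℓ.a ∧ (RepP7v i).selfInt = ℓ.selfInt := by
  decide +kernel

theorem mem_boxList_seven {ℓ : Letter} (hℓ : ℓ.OnAlphabet 7) : ℓ ∈ boxList 7 7 := by
  refine mem_boxList.mpr ⟨hℓ.1, ?_, ?_⟩
  · have e := hℓ.1; have h0 := hℓ.2; unfold Letter.height at e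
    have := abs_nonneg ℓ.y; push_cast; omega
  · have e := hℓ.1; have h0 := hℓ.2; unfold Letter.height at e
    have := abs_nonneg ℓ.x; push_cast; omega

/-- the `h = 7` all-floor certificate functional `Ψ₇ = 560 207 700 · Φ₇` (`Φ₇ = 4411029∕622453 ≈ 7.09` the exact S₄-profile LP optimum). -/
def PsiC (c : Cell) : ℤ :=
  mO O20 c * (68176274) + (mO O01 c * (-102264411) + (mO O30 c * (-54198672) + (mO O11 c * (18066224) +
      (mO O40 c * (28338660) + (mO O21 c * (-1194278) + (mO O02 c * (-2334554) + (mO O31 c * (-935916) +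
      (mO O12 c * (311972) + (mO O22 c * (26646) + (mO O03 c * (-39969)))))))))))

theorem PsiC_congr {c c' : Cell} (h : ∀ f, (c f).a = (c' f).a ∧ (c f).selfInt = (c' f).selfInt) : PsiC c = PsiC c' := by
  unfold PsiC
  simp only [mO_congr h]

theorem PsiC_comp (c : Cell) (σ : Equiv.Perm (Fin 4)) : PsiC (c ∘ σ) = PsiC c := by
  simp only [PsiC, mO_eq_sum O20_char, mO_eq_sum O01_char, mO_eq_sum O30_char, mO_eq_sum O11_char, mO_eq_sum O40_char,
    mO_eq_sum O21_char, mO_eq_sum O02_char, mO_eq_sum O31_char, mO_eq_sum O12_char, mO_eq_sum O22_char, mO_eq_sum O03_char,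
    orbSum_comp]

theorem sum_mul_PsiC (S : Finset Cell) (w : Cell → ℤ) :
    ∑ c ∈ S, w c * PsiC c =
      (∑ c ∈ S, w c * mO O20 c) * (68176274) + ((∑ c ∈ S, w c * mO O01 c) * (-102264411) +
      ((∑ c ∈ S, w c * mO O30 c) * (-54198672) + ((∑ c ∈ S, w c * mO O11 c) * (18066224) +
      ((∑ c ∈ S, w c * mO O40 c) * (28338660) + ((∑ c ∈ S, w c * mO O21 c) * (-1194278) +
      ((∑ c ∈ S, w c * mO O02 c) * (-2334554) + ((∑ c ∈ S, w c * mO O31 c) * (-935916) +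
      ((∑ c ∈ S, w c * mO O12 c) * (311972) + ((∑ c ∈ S, w c * mO O22 c) * (26646) +
      ((∑ c ∈ S, w c * mO O03 c) * (-39969))))))))))) := by
  simp only [Finset.sum_mul, ← Finset.sum_add_distrib]
  exact Finset.sum_congr rfl (fun c _ => by unfold PsiC; ring)

/-- BALANCE of `Ψ₇` from (A1.2). -/
theorem PsiC_balance {D : Design} {S : Finset Cell} (hS : SuppIn D S) (h1 : D.A1) :
    ∑ c ∈ S, ((D.mN c : ℤ) - D.mP c) * PsiC c = 0 := by
  have u2f : Word.efree ![Sym.h, Sym.h, Sym.one, Sym.one] := (O20_ok _ (by simp [O20])).1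
  have u2d : Word.deg ![Sym.h, Sym.h, Sym.one, Sym.one] = 2 := (O20_ok _ (by simp [O20])).2
  have u3f : Word.efree ![Sym.h, Sym.h, Sym.h, Sym.one] := (O30_ok _ (by simp [O30])).1
  have u3d : Word.deg ![Sym.h, Sym.h, Sym.h, Sym.one] = 3 := (O30_ok _ (by simp [O30])).2
  have u4f : Word.efree ![Sym.h, Sym.h, Sym.h, Sym.h] := (O40_ok _ (by simp [O40])).1
  have u4d : Word.deg ![Sym.h, Sym.h, Sym.h, Sym.h] = 4 := (O40_ok _ (by simp [O40])).2
  have u5f : Word.efree ![Sym.h, Sym.h, Sym.h, Sym.pt] := (O31_ok _ (by simp [O31])).1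
  have u5d : Word.deg ![Sym.h, Sym.h, Sym.h, Sym.pt] = 5 := (O31_ok _ (by simp [O31])).2
  have u6f : Word.efree ![Sym.h, Sym.h, Sym.pt, Sym.pt] := (O22_ok _ (by simp [O22])).1
  have u6d : Word.deg ![Sym.h, Sym.h, Sym.pt, Sym.pt] = 6 := (O22_ok _ (by simp [O22])).2
  have r2 := sum_mO_rel hS h1 O20 O01 _ u2f 2 u2d O20_ok O01_ok
  have r3 := sum_mO_rel hS h1 O30 O11 _ u3f 3 u3d O30_ok O11_ok
  have r4 := sum_mO_rel hS h1 O40 O21 _ u4f 4 u4d O40_ok O21_ok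
  have r4' := sum_mO_rel hS h1 O21 O02 _ u4f 4 u4d O21_ok O02_ok
  have r5 := sum_mO_rel hS h1 O31 O12 _ u5f 5 u5d O31_ok O12_ok
  have r6 := sum_mO_rel hS h1 O22 O03 _ u6f 6 u6d O22_ok O03_ok
  rw [O20_len, O01_len] at r2
  rw [O30_len, O11_len] at r3
  rw [O40_len, O21_len] at r4
  rw [O21_len, O02_len] at r4'
  rw [O31_len, O12_len] at r5
  rw [O22_len, O03_len] at r6
  rw [sum_mul_PsiC]
  push_cast at r2 r3 r4 r4' r5 r6
  omega

set_option maxRecDepth 65536 in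
set_option maxHeartbeats 4000000 in
theorem PsiC_repN7_sorted : ∀ i0 i1 i2 i3 : Fin 12, i0 ≤ i1 → i1 ≤ i2 → i2 ≤ i3 →
    PsiC ![RepN7v i0, RepN7v i1, RepN7v i2, RepN7v i3] ≤ 560207700 := by
  decide +kernel

set_option maxRecDepth 65536 in
set_option maxHeartbeats 4000000 in
theorem PsiC_repP7_sorted : ∀ i0 i1 i2 i3 : Fin 12, i0 ≤ i1 → i1 ≤ i2 → i2 ≤ i3 →
    0 ≤ PsiC ![RepP7v i0, RepP7v i1, RepP7v i2, RepP7v i3] := by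
  decide +kernel

set_option maxRecDepth 65536 in
set_option maxHeartbeats 4000000 in
theorem PsiC_repFloor7_sorted : ∀ i0 i1 i2 i3 : Fin 12, i0 ≤ i1 → i1 ≤ i2 → i2 ≤ i3 → (RepP7v i3).a = 0 →
    3969926100 ≤ PsiC ![RepP7v i0, RepP7v i1, RepP7v i2, RepP7v i3] := by
  decide +kernel

theorem PsiC_sorted_transport (R : Fin 12 → Letter) (P : ℤ → Prop)
    (hsorted : ∀ i0 i1 i2 i3 : Fin 12, i0 ≤ i1 → i1 ≤ i2 → i2 ≤ i3 → P (PsiC ![R i0, R i1, R i2, R i3]))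
    (j : Fin 4 → Fin 12) : P (PsiC (R ∘ j)) := by
  have hmono : Monotone (j ∘ ⇑(Tuple.sort j)) := Tuple.monotone_sort j
  rw [← PsiC_comp (R ∘ j) (Tuple.sort j)]
  have e : ((R ∘ j) ∘ ⇑(Tuple.sort j) : Cell) =
      ![R (j (Tuple.sort j 0)), R (j (Tuple.sort j 1)), R (j (Tuple.sort j 2)), R (j (Tuple.sort j 3))] := by
    funext f
    fin_cases f <;> rfl
  rw [e]
  have h01 : j (Tuple.sort j 0) ≤ j (Tuple.sort j 1) := hmono (show (0 : Fin 4) ≤ 1 by decide)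
  have h12 : j (Tuple.sort j 1) ≤ j (Tuple.sort j 2) := hmono (show (1 : Fin 4) ≤ 2 by decide)
  have h23 : j (Tuple.sort j 2) ≤ j (Tuple.sort j 3) := hmono (show (2 : Fin 4) ≤ 3 by decide)
  exact hsorted _ _ _ _ h01 h12 h23

theorem PsiC_le_of_N {c : Cell} (hA : ∀ f, (c f).OnAlphabet 7) (h2 : ∀ f, 2 ≤ (c f).a) : PsiC c ≤ 560207700 := by
  have hrep : ∀ f, ∃ i : Fin 12, (RepN7v i).a = (c f).a ∧ (RepN7v i).selfInt = (c f).selfInt := fun f =>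
    repN7_complete (c f) (mem_boxList_seven (hA f)) (hA f).2 (h2 f)
  choose j hj using hrep
  rw [PsiC_congr (c' := RepN7v ∘ j) (fun f => ⟨(hj f).1.symm, (hj f).2.symm⟩)]
  exact PsiC_sorted_transport RepN7v (fun v => v ≤ 560207700) PsiC_repN7_sorted j

theorem PsiC_nonneg_of_P {c : Cell} (hA : ∀ f, (c f).OnAlphabet 7) (h5 : ∀ f, (c f).a ≤ 5)
    (hoff : ∀ f, (c f).x * (c f).y ≠ 0) : 0 ≤ PsiC c := by
  have hrep : ∀ f, ∃ i : Fin 12, (RepP7v i).a = (c f).a ∧ (RepP7v i).selfInt = (c f).selfInt := fun f =>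
    repP7_complete (c f) (mem_boxList_seven (hA f)) (hA f).2 (h5 f) (hoff f)
  choose j hj using hrep
  rw [PsiC_congr (c' := RepP7v ∘ j) (fun f => ⟨(hj f).1.symm, (hj f).2.symm⟩)]
  exact PsiC_sorted_transport RepP7v (fun v => 0 ≤ v) PsiC_repP7_sorted j

theorem PsiC_ge_of_floor {c : Cell} (hA : ∀ f, (c f).OnAlphabet 7) (hoff : ∀ f, (c f).x * (c f).y ≠ 0) (hfl : famFloor c) :
    3969926100 ≤ PsiC c := by
  have hrep : ∀ f, ∃ i : Fin 12, (RepP7v i).a = (c f).a ∧ (RepP7v i).selfInt = (c f).selfInt := fun f =>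
    repP7_complete (c f) (mem_boxList_seven (hA f)) (hA f).2 (by rw [hfl f]; decide) (hoff f)
  choose j hj using hrep
  rw [PsiC_congr (c' := RepP7v ∘ j) (fun f => ⟨(hj f).1.symm, (hj f).2.symm⟩)]
  have hz : ∀ f, (RepP7v (j f)).a = 0 := fun f => (hj f).1.trans (hfl f)
  have hmono : Monotone (j ∘ ⇑(Tuple.sort j)) := Tuple.monotone_sort j
  rw [← PsiC_comp (RepP7v ∘ j) (Tuple.sort j)]
  have e : ((RepP7v ∘ j) ∘ ⇑(Tuple.sort j) : Cell) = ![RepP7v (j (Tuple.sort j 0)), RepP7v (j (Tuple.sort j 1)),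
      RepP7v (j (Tuple.sort j 2)), RepP7v (j (Tuple.sort j 3))] := by
    funext f
    fin_cases f <;> rfl
  rw [e]
  have h01 : j (Tuple.sort j 0) ≤ j (Tuple.sort j 1) := hmono (show (0 : Fin 4) ≤ 1 by decide)
  have h12 : j (Tuple.sort j 1) ≤ j (Tuple.sort j 2) := hmono (show (1 : Fin 4) ≤ 2 by decide)
  have h23 : j (Tuple.sort j 2) ≤ j (Tuple.sort j 3) := hmono (show (2 : Fin 4) ≤ 3 by decide)
  exact PsiC_repFloor7_sorted _ _ _ _ h01 h12 h23 (hz _)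

/-- **(w3) THE STOREY COLUMN, `h = 7`: the all-floor row `Σ_{all four letters on the floor} m_P ≤ 24`** for every design on the height-7
alphabet with (A1), (A4) and copies `≤ 199` (`24⁴ = 331 776` cells; `24 = ⌊199·U∕(V+U)⌋`, `U = 560 207 700`, `V = 3 969 926 100`, the optimum
of the e-free S₄-profile certificate LP `4411029∕622453`). -/
theorem floor4_row_seven {D : Design} (hA : D.OnAlphabet 7) (h1 : D.A1) (h4 : D.A4) (hB : D.copies ≤ 199)
    {S : Finset Cell} (hS : SuppIn D S) : ∑ c ∈ S.filter famFloor, D.mP c ≤ 24 := by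
  have hAN : ∀ c ∈ D.suppN, ∀ f, (c f).OnAlphabet 7 := fun c hy f => hA c (List.mem_append_left _ hy) f
  have hAP : ∀ c ∈ D.suppP, ∀ f, (c f).OnAlphabet 7 := fun c hx f => hA c (List.mem_append_right _ hx) f
  have h := mass_core₀ hB hS PsiC 560207700 3969926100 (by norm_num) (PsiC_balance hS h1)
    (fun c hy => PsiC_le_of_N (hAN c hy) (fun f => n_letter_two_le hA h4 hy f))
    (fun c hx => PsiC_nonneg_of_P (hAP c hx) (fun f => by have := p_letter_le hA h4 hx f; omega)
      (fun f => p_letter_offaxis hA h4 hx f))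
    famFloor (fun c hx hfl => PsiC_ge_of_floor (hAP c hx) (fun f => p_letter_offaxis hA h4 hx f) hfl)
  have : (∑ c ∈ S.filter famFloor, (D.mP c : ℤ)) ≤ 24 := by omega
  exact_mod_cast this

theorem floor4_family_mass_le_seven {D : Design} {rmin : ℤ} (hD : Admissible 7 199 rmin D) {S : Finset Cell} (hS : SuppIn D S) :
    ∑ c ∈ S.filter famFloor, D.mP c ≤ 24 :=
  floor4_row_seven hD.1 hD.2.1 hD.2.2.1 hD.2.2.2.2.1 hS

/-- the `h = 7` all-floor row in FUNCTION FORM on any `U ⊆ cellsOn 7`. -/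
theorem floor4_row_fun_seven {U : Finset Cell} (hU : U ⊆ cellsOn 7) {gN gP : Cell → ℕ} (h1 : A1fun U gN gP)
    (h4 : A4fun U gN gP) (hB : copiesfun U gN gP ≤ 199) : ∑ c ∈ U.filter famFloor, gP c ≤ 24 := by
  have hB' : (realise U gN gP).copies ≤ 199 := by rw [realise_copies]; exact hB
  have r := floor4_row_seven (onAlphabet_realise U gN gP hU) (a1_realise U gN gP h1) (a4_realise U gN gP h4) hB'
    (suppIn_realise U gN gP)
  have e : ∑ c ∈ U.filter famFloor, gP c = ∑ c ∈ U.filter famFloor, (realise U gN gP).mP c :=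
    Finset.sum_congr rfl (fun c hc => (realise_mP U gN gP (Finset.mem_filter.mp hc).1).symm)
  rw [e]; exact r

/-! ### §10.11 THE STOREY COLUMN, second entry `h = 8`: the all-floor row `Σ_{floor⁴} m_P ≤ 34` (same template; 16 + 16 profiles) -/

/-- one letter per N-profile of the height-8 alphabet (`a ≥ 2`). -/
def RepN8v : Fin 16 → Letter :=
  ![⟨2, 6, 0⟩, ⟨2, 5, 1⟩, ⟨2, 4, 2⟩, ⟨2, 3, 3⟩, ⟨3, 5, 0⟩, ⟨3, 4, 1⟩, ⟨3, 3, 2⟩, ⟨4, 4, 0⟩, ⟨4, 3, 1⟩, ⟨4, 2, 2⟩, ⟨5, 3, 0⟩, ⟨5, 2, 1⟩,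
    ⟨6, 2, 0⟩, ⟨6, 1, 1⟩, ⟨7, 1, 0⟩, ⟨8, 0, 0⟩]
/-- one letter per P-profile of the height-8 alphabet (off-axis, `a ≤ 6`); the floor profiles are the indices `0, 1, 2, 3`. -/
def RepP8v : Fin 16 → Letter :=
  ![⟨0, 7, 1⟩, ⟨0, 6, 2⟩, ⟨0, 5, 3⟩, ⟨0, 4, 4⟩, ⟨1, 6, 1⟩, ⟨1, 5, 2⟩, ⟨1, 4, 3⟩, ⟨2, 5, 1⟩, ⟨2, 4, 2⟩, ⟨2, 3, 3⟩, ⟨3, 4, 1⟩, ⟨3, 3, 2⟩,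
    ⟨4, 3, 1⟩, ⟨4, 2, 2⟩, ⟨5, 2, 1⟩, ⟨6, 1, 1⟩]

set_option maxRecDepth 65536 in
theorem repN8_complete :
    ∀ ℓ ∈ boxList 8 8, 0 ≤ ℓ.a → 2 ≤ ℓ.a → ∃ i : Fin 16, (RepN8v i).a = ℓ.a ∧ (RepN8v i).selfInt = ℓ.selfInt := by
  decide +kernel
set_option maxRecDepth 65536 in
theorem repP8_complete :
    ∀ ℓ ∈ boxList 8 8, 0 ≤ ℓ.a → ℓ.a ≤ 6 → ℓ.x * ℓ.y ≠ 0 → ∃ i : Fin 16, (RepP8v i).a = ℓ.a ∧ (RepP8v i).selfInt = ℓ.selfInt := by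
  decide +kernel

theorem mem_boxList_eight {ℓ : Letter} (hℓ : ℓ.OnAlphabet 8) : ℓ ∈ boxList 8 8 := by
  refine mem_boxList.mpr ⟨hℓ.1, ?_, ?_⟩
  · have e := hℓ.1; have h0 := hℓ.2; unfold Letter.height at e
    have := abs_nonneg ℓ.y; push_cast; omega
  · have e := hℓ.1; have h0 := hℓ.2; unfold Letter.height at e
    have := abs_nonneg ℓ.x; push_cast; omega

/-- the `h = 8` all-floor certificate functional `Ψ₈ = 22 693 991 616 · Φ₈` (`Φ₈ = 184907200∕39399291 ≈ 4.69` the exact S₄-profile LP optimum). -/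
def PsiD (c : Cell) : ℤ :=
  mO O20 c * (1367513600) + (mO O01 c * (-2051270400) + (mO O30 c * (-904367262) + (mO O11 c * (301455754) +
      (mO O40 c * (388257288) + (mO O21 c * (-14914963) + (mO O02 c * (-34879622) + (mO O31 c * (-11656125) +
      (mO O12 c * (3885375) + (mO O22 c * (296246) + (mO O03 c * (-444369)))))))))))

theorem PsiD_congr {c c' : Cell} (h : ∀ f, (c f).a = (c' f).a ∧ (c f).selfInt = (c' f).selfInt) : PsiD c = PsiD c' := by
  unfold PsiD
  simp only [mO_congr h]

theorem PsiD_comp (c : Cell) (σ : Equiv.Perm (Fin 4)) : PsiD (c ∘ σ) = PsiD c := by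
  simp only [PsiD, mO_eq_sum O20_char, mO_eq_sum O01_char, mO_eq_sum O30_char, mO_eq_sum O11_char, mO_eq_sum O40_char,
    mO_eq_sum O21_char, mO_eq_sum O02_char, mO_eq_sum O31_char, mO_eq_sum O12_char, mO_eq_sum O22_char, mO_eq_sum O03_char,
    orbSum_comp]

theorem sum_mul_PsiD (S : Finset Cell) (w : Cell → ℤ) :
    ∑ c ∈ S, w c * PsiD c =
      (∑ c ∈ S, w c * mO O20 c) * (1367513600) + ((∑ c ∈ S, w c * mO O01 c) * (-2051270400) +
      ((∑ c ∈ S, w c * mO O30 c) * (-904367262) + ((∑ c ∈ S, w c * mO O11 c) * (301455754) +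
      ((∑ c ∈ S, w c * mO O40 c) * (388257288) + ((∑ c ∈ S, w c * mO O21 c) * (-14914963) +
      ((∑ c ∈ S, w c * mO O02 c) * (-34879622) + ((∑ c ∈ S, w c * mO O31 c) * (-11656125) +
      ((∑ c ∈ S, w c * mO O12 c) * (3885375) + ((∑ c ∈ S, w c * mO O22 c) * (296246) +
      ((∑ c ∈ S, w c * mO O03 c) * (-444369))))))))))) := by
  simp only [Finset.sum_mul, ← Finset.sum_add_distrib]
  exact Finset.sum_congr rfl (fun c _ => by unfold PsiD; ring)

/-- BALANCE of `Ψ₈` from (A1.2). -/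
theorem PsiD_balance {D : Design} {S : Finset Cell} (hS : SuppIn D S) (h1 : D.A1) :
    ∑ c ∈ S, ((D.mN c : ℤ) - D.mP c) * PsiD c = 0 := by
  have u2f : Word.efree ![Sym.h, Sym.h, Sym.one, Sym.one] := (O20_ok _ (by simp [O20])).1
  have u2d : Word.deg ![Sym.h, Sym.h, Sym.one, Sym.one] = 2 := (O20_ok _ (by simp [O20])).2
  have u3f : Word.efree ![Sym.h, Sym.h, Sym.h, Sym.one] := (O30_ok _ (by simp [O30])).1
  have u3d : Word.deg ![Sym.h, Sym.h, Sym.h, Sym.one] = 3 := (O30_ok _ (by simp [O30])).2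
  have u4f : Word.efree ![Sym.h, Sym.h, Sym.h, Sym.h] := (O40_ok _ (by simp [O40])).1
  have u4d : Word.deg ![Sym.h, Sym.h, Sym.h, Sym.h] = 4 := (O40_ok _ (by simp [O40])).2
  have u5f : Word.efree ![Sym.h, Sym.h, Sym.h, Sym.pt] := (O31_ok _ (by simp [O31])).1
  have u5d : Word.deg ![Sym.h, Sym.h, Sym.h, Sym.pt] = 5 := (O31_ok _ (by simp [O31])).2
  have u6f : Word.efree ![Sym.h, Sym.h, Sym.pt, Sym.pt] := (O22_ok _ (by simp [O22])).1
  have u6d : Word.deg ![Sym.h, Sym.h, Sym.pt, Sym.pt] = 6 := (O22_ok _ (by simp [O22])).2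
  have r2 := sum_mO_rel hS h1 O20 O01 _ u2f 2 u2d O20_ok O01_ok
  have r3 := sum_mO_rel hS h1 O30 O11 _ u3f 3 u3d O30_ok O11_ok
  have r4 := sum_mO_rel hS h1 O40 O21 _ u4f 4 u4d O40_ok O21_ok
  have r4' := sum_mO_rel hS h1 O21 O02 _ u4f 4 u4d O21_ok O02_ok
  have r5 := sum_mO_rel hS h1 O31 O12 _ u5f 5 u5d O31_ok O12_ok
  have r6 := sum_mO_rel hS h1 O22 O03 _ u6f 6 u6d O22_ok O03_ok
  rw [O20_len, O01_len] at r2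
  rw [O30_len, O11_len] at r3
  rw [O40_len, O21_len] at r4
  rw [O21_len, O02_len] at r4'
  rw [O31_len, O12_len] at r5
  rw [O22_len, O03_len] at r6
  rw [sum_mul_PsiD]
  push_cast at r2 r3 r4 r4' r5 r6
  omega

set_option maxRecDepth 65536 in
set_option maxHeartbeats 4000000 in
theorem PsiD_repN7_sorted : ∀ i0 i1 i2 i3 : Fin 16, i0 ≤ i1 → i1 ≤ i2 → i2 ≤ i3 →
    PsiD ![RepN8v i0, RepN8v i1, RepN8v i2, RepN8v i3] ≤ 22693991616 := by
  decide +kernel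

set_option maxRecDepth 65536 in
set_option maxHeartbeats 4000000 in
theorem PsiD_repP7_sorted : ∀ i0 i1 i2 i3 : Fin 16, i0 ≤ i1 → i1 ≤ i2 → i2 ≤ i3 →
    0 ≤ PsiD ![RepP8v i0, RepP8v i1, RepP8v i2, RepP8v i3] := by
  decide +kernel

set_option maxRecDepth 65536 in
set_option maxHeartbeats 4000000 in
theorem PsiD_repFloor7_sorted : ∀ i0 i1 i2 i3 : Fin 16, i0 ≤ i1 → i1 ≤ i2 → i2 ≤ i3 → (RepP8v i3).a = 0 →
    106506547200 ≤ PsiD ![RepP8v i0, RepP8v i1, RepP8v i2, RepP8v i3] := by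
  decide +kernel

theorem PsiD_sorted_transport (R : Fin 16 → Letter) (P : ℤ → Prop)
    (hsorted : ∀ i0 i1 i2 i3 : Fin 16, i0 ≤ i1 → i1 ≤ i2 → i2 ≤ i3 → P (PsiD ![R i0, R i1, R i2, R i3]))
    (j : Fin 4 → Fin 16) : P (PsiD (R ∘ j)) := by
  have hmono : Monotone (j ∘ ⇑(Tuple.sort j)) := Tuple.monotone_sort j
  rw [← PsiD_comp (R ∘ j) (Tuple.sort j)]
  have e : ((R ∘ j) ∘ ⇑(Tuple.sort j) : Cell) =
      ![R (j (Tuple.sort j 0)), R (j (Tuple.sort j 1)), R (j (Tuple.sort j 2)), R (j (Tuple.sort j 3))] := by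
    funext f
    fin_cases f <;> rfl
  rw [e]
  have h01 : j (Tuple.sort j 0) ≤ j (Tuple.sort j 1) := hmono (show (0 : Fin 4) ≤ 1 by decide)
  have h12 : j (Tuple.sort j 1) ≤ j (Tuple.sort j 2) := hmono (show (1 : Fin 4) ≤ 2 by decide)
  have h23 : j (Tuple.sort j 2) ≤ j (Tuple.sort j 3) := hmono (show (2 : Fin 4) ≤ 3 by decide)
  exact hsorted _ _ _ _ h01 h12 h23

theorem PsiD_le_of_N {c : Cell} (hA : ∀ f, (c f).OnAlphabet 8) (h2 : ∀ f, 2 ≤ (c f).a) : PsiD c ≤ 22693991616 := by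
  have hrep : ∀ f, ∃ i : Fin 16, (RepN8v i).a = (c f).a ∧ (RepN8v i).selfInt = (c f).selfInt := fun f =>
    repN8_complete (c f) (mem_boxList_eight (hA f)) (hA f).2 (h2 f)
  choose j hj using hrep
  rw [PsiD_congr (c' := RepN8v ∘ j) (fun f => ⟨(hj f).1.symm, (hj f).2.symm⟩)]
  exact PsiD_sorted_transport RepN8v (fun v => v ≤ 22693991616) PsiD_repN7_sorted j

theorem PsiD_nonneg_of_P {c : Cell} (hA : ∀ f, (c f).OnAlphabet 8) (h6 : ∀ f, (c f).a ≤ 6)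
    (hoff : ∀ f, (c f).x * (c f).y ≠ 0) : 0 ≤ PsiD c := by
  have hrep : ∀ f, ∃ i : Fin 16, (RepP8v i).a = (c f).a ∧ (RepP8v i).selfInt = (c f).selfInt := fun f =>
    repP8_complete (c f) (mem_boxList_eight (hA f)) (hA f).2 (h6 f) (hoff f)
  choose j hj using hrep
  rw [PsiD_congr (c' := RepP8v ∘ j) (fun f => ⟨(hj f).1.symm, (hj f).2.symm⟩)]
  exact PsiD_sorted_transport RepP8v (fun v => 0 ≤ v) PsiD_repP7_sorted j

theorem PsiD_ge_of_floor {c : Cell} (hA : ∀ f, (c f).OnAlphabet 8) (hoff : ∀ f, (c f).x * (c f).y ≠ 0) (hfl : famFloor c) :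
    106506547200 ≤ PsiD c := by
  have hrep : ∀ f, ∃ i : Fin 16, (RepP8v i).a = (c f).a ∧ (RepP8v i).selfInt = (c f).selfInt := fun f =>
    repP8_complete (c f) (mem_boxList_eight (hA f)) (hA f).2 (by rw [hfl f]; decide) (hoff f)
  choose j hj using hrep
  rw [PsiD_congr (c' := RepP8v ∘ j) (fun f => ⟨(hj f).1.symm, (hj f).2.symm⟩)]
  have hz : ∀ f, (RepP8v (j f)).a = 0 := fun f => (hj f).1.trans (hfl f)
  have hmono : Monotone (j ∘ ⇑(Tuple.sort j)) := Tuple.monotone_sort j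
  rw [← PsiD_comp (RepP8v ∘ j) (Tuple.sort j)]
  have e : ((RepP8v ∘ j) ∘ ⇑(Tuple.sort j) : Cell) = ![RepP8v (j (Tuple.sort j 0)), RepP8v (j (Tuple.sort j 1)),
      RepP8v (j (Tuple.sort j 2)), RepP8v (j (Tuple.sort j 3))] := by
    funext f
    fin_cases f <;> rfl
  rw [e]
  have h01 : j (Tuple.sort j 0) ≤ j (Tuple.sort j 1) := hmono (show (0 : Fin 4) ≤ 1 by decide)
  have h12 : j (Tuple.sort j 1) ≤ j (Tuple.sort j 2) := hmono (show (1 : Fin 4) ≤ 2 by decide)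
  have h23 : j (Tuple.sort j 2) ≤ j (Tuple.sort j 3) := hmono (show (2 : Fin 4) ≤ 3 by decide)
  exact PsiD_repFloor7_sorted _ _ _ _ h01 h12 h23 (hz _)

/-- **(w3) THE STOREY COLUMN, `h = 8`: the all-floor row `Σ_{all four letters on the floor} m_P ≤ 34`** for every design on the height-8
alphabet with (A1), (A4) and copies `≤ 199` (`28⁴ = 614 656` cells; `34 = ⌊199·U∕(V+U)⌋`, `U = 22 693 991 616`, `V = 106 506 547 200`, the optimum
of the e-free S₄-profile certificate LP `184907200∕39399291`). -/
theorem floor4_row_eight {D : Design} (hA : D.OnAlphabet 8) (h1 : D.A1) (h4 : D.A4) (hB : D.copies ≤ 199)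
    {S : Finset Cell} (hS : SuppIn D S) : ∑ c ∈ S.filter famFloor, D.mP c ≤ 34 := by
  have hAN : ∀ c ∈ D.suppN, ∀ f, (c f).OnAlphabet 8 := fun c hy f => hA c (List.mem_append_left _ hy) f
  have hAP : ∀ c ∈ D.suppP, ∀ f, (c f).OnAlphabet 8 := fun c hx f => hA c (List.mem_append_right _ hx) f
  have h := mass_core₀ hB hS PsiD 22693991616 106506547200 (by norm_num) (PsiD_balance hS h1)
    (fun c hy => PsiD_le_of_N (hAN c hy) (fun f => n_letter_two_le hA h4 hy f))
    (fun c hx => PsiD_nonneg_of_P (hAP c hx) (fun f => by have := p_letter_le hA h4 hx f; omega)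
      (fun f => p_letter_offaxis hA h4 hx f))
    famFloor (fun c hx hfl => PsiD_ge_of_floor (hAP c hx) (fun f => p_letter_offaxis hA h4 hx f) hfl)
  have : (∑ c ∈ S.filter famFloor, (D.mP c : ℤ)) ≤ 34 := by omega
  exact_mod_cast this

theorem floor4_family_mass_le_eight {D : Design} {rmin : ℤ} (hD : Admissible 8 199 rmin D) {S : Finset Cell} (hS : SuppIn D S) :
    ∑ c ∈ S.filter famFloor, D.mP c ≤ 34 :=
  floor4_row_eight hD.1 hD.2.1 hD.2.2.1 hD.2.2.2.2.1 hS

/-- the `h = 8` all-floor row in FUNCTION FORM on any `U ⊆ cellsOn 8`. -/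
theorem floor4_row_fun_eight {U : Finset Cell} (hU : U ⊆ cellsOn 8) {gN gP : Cell → ℕ} (h1 : A1fun U gN gP)
    (h4 : A4fun U gN gP) (hB : copiesfun U gN gP ≤ 199) : ∑ c ∈ U.filter famFloor, gP c ≤ 34 := by
  have hB' : (realise U gN gP).copies ≤ 199 := by rw [realise_copies]; exact hB
  have r := floor4_row_eight (onAlphabet_realise U gN gP hU) (a1_realise U gN gP h1) (a4_realise U gN gP h4) hB'
    (suppIn_realise U gN gP)
  have e : ∑ c ∈ U.filter famFloor, gP c = ∑ c ∈ U.filter famFloor, (realise U gN gP).mP c :=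
    Finset.sum_congr rfl (fun c hc => (realise_mP U gN gP (Finset.mem_filter.mp hc).1).symm)
  rw [e]; exact r

end familyMass

end Summit.HodgeConjecture.HodgeConjecture.Cruxes.BlochSeedDiscOne.FinCheck
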